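import Mathlib
import HarnessLib

/-!
# The line section of the trivariate hypergeometric law: exact tilts in the sample size, the consecutive
# ratio, and log-concavity

Sample `s` of `a + b + d` items without replacement, the items being of three kinds (`a` of kind `A`, `b` of
kind `B`, `d` of kind `D`); the numbers `(α, β, δ)` drawn of each kind follow the trivariate hypergeometric
law `C(a,α)C(b,β)C(d,δ)/C(a+b+d, s)`, `α + β + δ = s` [Chattamvelli–Shanmugam 2020, §7.4 (PDF p. 144):
"the multivariate hypergeometric distribution is obtained when the population comprises of k groups"]. Score
kind `A` twice and kind `B` once: `X = 2α + β`. CONDITIONAL ON `X = x` the law of `α` is supported on the LINE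
`β = x − 2α`, `δ = s + α − x` and has the weights

  `W_s(α) = C(a, α) · C(b, x − 2α) · C(d, s + α − x)`      (`lineW a b d s x α`; zero off `2α ≤ x ≤ s + α`).

In cell pnp-psdrank (summit `PneNP`, crux `TracialDecayExp20`) this is the conditional law of the number `n_A`
of `HH` edges of a cut given the block statistic, the level and the half-edge data (`a, b, d` = the numbers of
`HH`, mixed and `NN` edges left for the full edges, [Rothvoss2017, §2]); prover MEMO-28 §3c's recommended line
for the γ-directions asks for its «line-section» technology — consecutive-`s` weight ratio, log-concavity in
`α`, ratio structure — one dimension up from `HypergeometricRatioWindow.lean`. §1–§4 (v1) are the EXACT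
structure, §5–§7 (v2) the window/envelope structure and the pinning identities, §8 (v3) unimodality and
the ratio window, §9 (v4) the exact moment identities under the moves, §10 (v5) the variance floor, §11–§12 (v6) central moments about the maximiser in closed form, §13–§14 (v7) the variance ceiling and the size-biased (one-pinned) law, §15–§16 (v8) the variance floor PACKAGED (maximiser-explicit and maximiser-free closed forms) and the exact law of total variance.

* §1 `lineW` and its range: `lineW_of_le`, `lineW_eq_zero_of_lt`, `lineW_eq_zero_of_lt'`.
* §2 **the tilt in the sample size** (`lineW_succ_sample_mul`): `W_{s+1}(α)·(s+α+1−x) = W_s(α)·(d − (s+α−x))` —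
  passing from `s` to `s + 1` multiplies the weight of `α` by `(d − m)/(m + 1)`, `m = s + α − x`, an
  affine-fractional DEcreasing function of `α` (`tiltRatio_anti`); so the line-section laws for consecutive
  sample sizes are monotone exponential-type tilts of each other.
* §3 **the consecutive ratio in `α`** (`lineW_succ_mul`): with `j = x − 2α`, `m = s + α − x`,
  `W(α+1)·(α+1)·(b−j+2)(b−j+1)·(m+1) = W(α)·(a−α)·j(j−1)·(d−m)`.
* §4 **log-concavity in `α`** (`lineW_mul_lineW_le_sq`): `W(α)·W(α+2) ≤ W(α+1)²` for all parameters — from the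
  one- and two-step log-concavity of a binomial row (`choose_mul_choose_le_sq`, `choose_mul_choose_le_sq_two`,
  proved here from the recurrence `C(n,k+1)(k+1) = C(n,k)(n−k)` [Chattamvelli–Shanmugam 2020, §7.4 Table 7.1]).

(v2, the ANALYTIC half — the window structure of `HypergeometricRatioWindow.lean` one dimension up.)
* §5 `lineW_pos_iff` (the support is an interval: five linear constraints), `lineW_succ_mul'` (the `α`-ratio
  identity `W(α+1)·D(α) = W(α)·N(α)` with NO side conditions), and **two-sided strong log-concavity**:
  `lineW_sq_mul_pow_le` — `(M−2)^8·W(α+1)² ≤ M^8·W(α)·W(α+2)` when the six margins `a−α`, `α+2`, `j−1`,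
  `b+3−j`, `m+2`, `d−m` are `≥ M` (REVERSE log-concavity with defect: the ratio `R(α) = W(α+1)/W(α)` falls by
  at most the factor `(1−2/M)^8` per step), and `lineW_mul_lineW_mul_pow_le` — `Y^{12}·W(α)W(α+2) ≤
  (Y−1)^{12}·W(α+1)²` when `a+2, b+4, d+2 ≤ Y` (the ratio falls by at least the factor `(1−1/Y)^{12}` per
  step); real forms `lineW_sq_mul_le_real`, `lineW_mul_lineW_le_real`. The discrete form of "strongly
  log-concave = log-concave relative to a Gaussian" [Saumard–Wellner 2014, §4 and Def. 2.8].
* §6 **modes and discrete-Gaussian envelopes**: generic envelope lemmas for a nonnegative sequence with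
  `f(l)f(l+2) ≤ q·f(l+1)²` (`le_envelope_of_strongLogConcave`: `f(i) ≤ f(0)(f(1)/f(0))^i q^{C(i,2)}`) resp.
  `p·f(l+1)² ≤ f(l)f(l+2)` (`envelope_le_of_reverseLogConcave`); the four line-section envelopes from any
  anchor (`lineW_add_le_envelope`, `lineW_sub_le_envelope`, `lineW_envelope_le_add`, `lineW_envelope_le_sub`);
  `exists_lineW_max`; the LC-free MODE PINNING `numer_le_denom_of_max` / `denom_le_numer_of_max_succ`
  (`N(α*) ≤ D(α*)`, `D(α*−1) ≤ N(α*−1)` at any maximiser) with `numer_antitone`, `denom_monotone` and the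
  bracketing `lt_max_of_denom_lt_numer`, `max_le_of_numer_lt_denom` (no closed mode formula needed); the
  sandwich at a maximiser `((1−2/M)^8)^{C(i+1,2)} ≤ W(α*±i)/W(α*) ≤ ((1−1/Y)^{12})^{C(i,2)}`
  (`lineW_max_add_le`, `lineW_max_sub_le`, `lineW_max_mul_pow_le_add`, `lineW_max_mul_pow_le_sub`) and the
  tail mass `Σ_{|α−α*| ≥ L} W ≤ (a+1)·((1−1/Y)^{12})^{C(L,2)}·W(α*)` (`sum_lineW_ge_max_add_le`,
  `sum_lineW_le_max_sub_le`).
* §7 **neighbouring parameters are affine tilts** (`lineW_succ_a_mul`, `lineW_succ_b_mul`, `lineW_succ_d_mul`,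
  `lineW_succ_x_mul`), the three **pinning identities** (`lineW_pinA_mul`, `lineW_pinB_mul`, `lineW_pinD_mul`
  — the line-section shadow of full-edge pinning), factorial moments as shifted line sums
  (`sum_lineW_mul_alpha`, `sum_lineW_mul_alpha_mul`, `sum_lineW_mul_j`, `sum_lineW_mul_m`; with
  `ShellLawLineSection.shellCount_zero_eq_sum_lineW` these are the cell's `E[n_A·1{X=x}] = a(s/N)·law'(x−2)`
  identities), and the complementation symmetry `lineW_compl` (`W_{a,b,d,s,x}(α) = W_{a,b,d,N−s,2a+b−x}(a−α)`).
* §8 (v3) **unimodality and the ratio window around a maximiser**: the generic ratio-step lemmas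
  `succ_le_ratio_mul_of_strongLogConcave` (`f(i+1) ≤ q^i (f1/f0) f(i)`) and
  `ratio_mul_le_succ_of_reverseLogConcave` (`p^i (f1/f0) f(i) ≤ f(i+1)`); `lineW_succ_le_of_max_le` /
  `lineW_le_succ_of_lt_max` (the ratio is `≤ 1` right of a maximiser and `≥ 1` left of it — log-concavity
  alone); `lineW_ratio_window_right` / `lineW_ratio_window_left` (inside the margins, at distance `i` from the
  maximiser the ratio is within the factor `(1−2/M)^{−8(i+1)}` of `1`) — the analogue of
  `HypergeometricRatioWindow.abs_one_sub_hyperRatio_le` with the maximiser in place of the mean.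
* §9 (v4) **moments under the one-parameter moves — EXACT covariance identities** (prover MEMO-29 §3 (L2)):
  every move is a tilt by an affine function of `α` or its inverse (`lineW_succ_sample_mul_real`,
  `lineW_succ_a_mul_real`, `lineW_succ_b_mul_real`, `lineW_succ_d_mul_real`: honest real factors, no side
  conditions); `sum_affine_tilt` (an affine tilt changes any expectation by `e·Cov(g,α)/E[ℓ]`, division-free);
  `lineW_aShift_moment_identity`, `lineW_bShift_moment_identity`, `lineW_dShift_moment_identity` (one covariance
  each) and **`lineW_sStep_moment_identity`** (the `s`-step through the intermediate weight
  `W_s·(d−m) = W_{s+1}·(m+1)`: `E_{s+1}[g] − E_s[g] = −Cov_s(g,α)/E_s[d−m] − Cov_{s+1}(g,α)/E_{s+1}[m+1]`,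
  division-free); corollary `lineW_sStep_mean_antitone` (the conditional mean of the `HH` count is
  non-increasing in the sample size, unconditionally). With `g = α` the mean moves by two variances over
  margins (`O(1)`), with `g = (α − m₀)²` the second moment about a fixed centre by two third-moment
  covariances; the moments themselves are bounded through the envelopes of §6.
* §10 (v5) **the variance floor and the law of total variance** (prover brick 130's input (V)):
  `lineW_mode_mul_floorSum_le_sum` (mass floor `W(α*)·(1 + 2Σ_{i≤L} p^{C(i+1,2)}) ≤ Σ W` from the two-sided
  floor of §6), `sq_mul_sub_le_sum_sq_mul_lineW` (Chebyshev in counting form: `r²(Σ_I W − (2r+1)W(α*)) ≤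
  Σ_I (α−m)²W` for every real centre `m`), and the generic `sum_mul_sum_var_le` (law of total variance in
  numerator form, Sedrakyan's Cauchy–Schwarz). Together: `Var ≥ r²(1 − (2r+1)/T_L)`, `T_L ≍ √M` for `L ≍ √M`.
* §11 (v6) **central moments about the maximiser** under the envelope: `sum_pow_mul_lineW_add_le`,
  `sum_pow_mul_lineW_sub_le` (one-sided power sums) and `sum_even_pow_sub_mul_lineW_le`
  (`Σ_{α≤a} (α−α*)^{2p} W ≤ 2·W(α*)·Σ_{i=1}^{a} i^{2p}((1−1/Y)^{12})^{C(i,2)}`, `p ≥ 1`) — with the mass floor,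
  every even central moment is `≤ 2G_{2p}(q)/T_L` with the explicit finite Gaussian-type sum
  `G_p(q) = Σ_{i≤a} i^p q^{C(i,2)} ≍ Y^{(p+1)/2}` (the fourth-moment input of the (L2) estimates).
* §12 (v6) **closed form for the Gaussian-type sums**: `sum_pow_mul_pow_choose_two_le` (block at `B`:
  `Σ_{i≤K} i^p q^{C(i,2)} ≤ B^{p+1} + 2^p(B^p/(Bδ) + p!(1+1/(Bδ))^{p+1})` for `0 ≤ q ≤ 1−δ`, via `C(i,2) ≥ B(i−B)`,
  Bernoulli `(1−δ)^B ≤ 1/(1+Bδ)` and the binomial series), `gaussSum_pow_le` (`δ = 1/Y`, `B = ⌈√Y⌉`: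
  `≤ (1 + 2^p(1+p!))·(√Y+1)^{p+1}`) and `sum_even_pow_sub_mul_lineW_le_closed`
  (`Σ_{α≤a}(α−α*)^{2p}W ≤ 2(1 + 4^p(1+(2p)!))(√Y+1)^{2p+1}·W(α*)`; with the mass floor: `E(α−α*)⁴ ≤ C(β)·N²`).
* §13 (v7) **the variance CEILING in closed form**: the division-free Steiner/bias–variance identity
  `sum_mul_sum_sq_sub_mul_eq` (`(Σw)·Σ(α−c)²w = ((Σw)(Σα²w) − (Σαw)²) + (Σαw − cΣw)²`, [Durrett 2019, §1.6.3]),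
  `varNumer_le_sum_mul_sum_sq_sub`, `sum_sq_sub_mean_mul_eq`, `sum_sq_sub_mean_mul_le` (the mean minimises the
  second moment); `sum_sq_sub_max_mul_lineW_le` (`p = 1`: `Σ_{α≤a}(α−α*)²W ≤ 26(√Y+1)³·W(α*)`),
  `lineW_varNumer_le`, **`lineW_variance_le_of_massFloor`** (`T·W(α*) ≤ ΣW ⇒ Var ≤ 26(√Y+1)³/T`) and the
  assembled **`lineW_variance_ceiling`** (`T = T_L` of §10): `Var(α | line section) ≤ 26(√Y+1)³/T_L = C(β)·N`.
* §14 (v7) **the one-pinned law is the size-biased full law**: `sum_mul_lineW_eq_sum_pin`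
  (`(a+1)·Σ g(α)W_{a,b,d,s,x}(α) = Σ (α+1)g(α)W_{a+1,b,d,s+1,x+2}(α+1)`), `sum_lineW_pin_mass`,
  `sum_lineW_pin_firstMoment` (`(a+1)·Σ αW_small = Σ k(k−1)W_full`), `lineW_pinned_mean_eq`
  (`E_small[α] = (Σk²W_full)/(ΣkW_full) − 1`), `sum_sq_mul_div_sum_mul_eq` (`(Σk²w)/(Σkw) = μ + V/μ`) and
  `lineW_pinned_mean_eq_mean_add_var_div` (`E_small[α] = μ + V/μ − 1`: prover MEMO-29 §3b's size-biasing line).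
* §15 (v8) **the variance FLOOR packaged** (prover MEMO-30 (B3a)): `lineW_eq_zero_of_lt_s`, `sum_range_mul_lineW_eq_of_s`
  (`Σ_{α≤s} = Σ_{α≤a}`), **`var_lineW_ge`** (margins with slack AT THE MAXIMISER ⇒ for every real centre `m` and
  every `r`: `r²(1 − (2r+1)/T_L)·ΣW ≤ Σ(α−m)²W`), `floorSum_ge` (`16L(L+1) ≤ M ⇒ T_L ≥ 1 + L`),
  **`var_lineW_ge_closed`** (`4r+2 ≤ L+1 ⇒ (r²/2)·ΣW ≤ Σ(α−m)²W`) and the maximiser-free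
  **`var_lineW_ge_of_bracket`** (mode brackets `D(lo) < N(lo)`, `N(hi) < D(hi)` + margins on `[lo+1, hi]`).
* §16 (v8) **the law of total variance, exact**: `sum_mul_sum_var_eq` (within + between, numerator form),
  `between_eq_steiner` (the between part as a Steiner sum about any centre minus a square) and
  `mixture_varNumer_le` (component variances `≤ v`, component means within `Δ` of a centre ⇒ `Var_mix ≤ v + Δ²`).

All PROVED, one definition (`lineW`), no named facts; finite arithmetic in `ℕ` and `ℝ`.

## References
* [ChattamvelliShanmugam2020] R. Chattamvelli, R. Shanmugam, *Discrete Distributions in Engineering and the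
  Applied Sciences* (2020), §7.4 (PDF p. 143 Table 7.1: the hypergeometric recurrence; p. 144: the multivariate
  hypergeometric law).
* [Rothvoss2017] T. Rothvoß, *The matching polytope has exponential extension complexity*, J. ACM 64 (2017),
  §2 (PDF pp. 5–6): cuts, perfect matchings, the three edge types.
* [Durrett2019] R. Durrett, *Probability: Theory and Examples*, 5th ed. (2019), Thm. 1.6.4 (Chebyshev's
  inequality; §10 uses its counting form) and §4.1 (conditional expectation; the law of total variance).
* [SaumardWellner2014] A. Saumard, J. A. Wellner, *Log-concavity and strong log-concavity: a review*, Statistics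
  Surveys 8 (2014) 45–114 (arXiv:1404.5886): §4 (arXiv p. 13) discrete log-concavity `p_x² ≥ p_{x−1}p_{x+1}` iff
  the ratio `p_{x+1}/p_x` is non-increasing; Definition 2.8 (arXiv p. 5) strong log-concavity (log-concave
  relative to a Gaussian). The quantitative envelopes of §5–§6 are elementary consequences proved here.
-/

namespace Literature.Probability.Distributions.TrinomialLineSection

/-! ### §1 The line-section weight -/

/-- **The line-section weight** `W_s(α) = C(a,α)·C(b,x−2α)·C(d,s+α−x)`: the number of `s`-subsets of
`a + b + d` items (`a` of kind `A`, `b` of kind `B`, `d` of kind `D`) containing exactly `α` items of kind `A`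
and having score `2α + β = x` (`β` = the number of kind-`B` items); zero unless `2α ≤ x ≤ s + α`. Dividing by
the sum over `α` gives the conditional law of `α` given the score under the trivariate hypergeometric law.
[cite: ChattamvelliShanmugam2020, §7.4 (PDF p. 144), multivariate hypergeometric law] -/
def lineW (a b d s x α : ℕ) : ℕ :=
  if 2 * α ≤ x ∧ x ≤ s + α then a.choose α * b.choose (x - 2 * α) * d.choose (s + α - x) else 0

/-- In range the weight is the product of the three binomial coefficients.
[cite: ChattamvelliShanmugam2020, §7.4 (PDF p. 144)] -/
theorem lineW_of_le {a b d s x α : ℕ} (h1 : 2 * α ≤ x) (h2 : x ≤ s + α) :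
    lineW a b d s x α = a.choose α * b.choose (x - 2 * α) * d.choose (s + α - x) := by
  simp [lineW, h1, h2]

/-- Below the line (`x < 2α`) the weight vanishes. [cite: ChattamvelliShanmugam2020, §7.4 (PDF p. 144)] -/
theorem lineW_eq_zero_of_lt {a b d s x α : ℕ} (h : x < 2 * α) : lineW a b d s x α = 0 := by
  simp [lineW, Nat.not_le.2 h]

/-- Above the line (`s + α < x`) the weight vanishes. [cite: ChattamvelliShanmugam2020, §7.4 (PDF p. 144)] -/
theorem lineW_eq_zero_of_lt' {a b d s x α : ℕ} (h : s + α < x) : lineW a b d s x α = 0 := by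
  simp [lineW, Nat.not_le.2 h]

/-- More kind-`A` items than exist: the weight vanishes. [cite: ChattamvelliShanmugam2020, §7.4 (PDF p. 144)] -/
theorem lineW_eq_zero_of_lt_alpha {a b d s x α : ℕ} (h : a < α) : lineW a b d s x α = 0 := by
  unfold lineW
  split_ifs
  · rw [Nat.choose_eq_zero_of_lt h]; simp
  · rfl

/-! ### §2 The tilt in the sample size -/

/-- **The `s`-step tilt.** `W_{s+1}(α)·(s+α+1−x) = W_s(α)·(d − (s+α−x))`: one more sampled item multiplies the
weight of `α` by `(d−m)/(m+1)` with `m = s+α−x` the number of kind-`D` items — the hypergeometric recurrence in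
the kind-`D` coordinate. (For `x = s+α+1` both sides vanish: the left factor is `0`, the right weight is off the
line.) [cite: ChattamvelliShanmugam2020, §7.4 Table 7.1 (PDF p. 143), recurrence of the hypergeometric law] -/
theorem lineW_succ_sample_mul (a b d s x α : ℕ) (h1 : 2 * α ≤ x) (h2 : x ≤ s + α + 1) :
    lineW a b d (s + 1) x α * (s + α + 1 - x) = lineW a b d s x α * (d - (s + α - x)) := by
  rcases Nat.lt_or_ge (s + α) x with h3 | h3
  · -- `x = s + α + 1`: both sides vanish
    rw [lineW_eq_zero_of_lt' h3]
    have : s + α + 1 - x = 0 := by omega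
    rw [this]; simp
  · rw [lineW_of_le h1 (by omega), lineW_of_le h1 h3]
    have e : s + 1 + α - x = (s + α - x) + 1 := by omega
    have e' : s + α + 1 - x = (s + α - x) + 1 := by omega
    rw [e, e']
    have key := Nat.choose_succ_right_eq d (s + α - x)
    -- `C(d, m+1)·(m+1) = C(d, m)·(d−m)`
    calc a.choose α * b.choose (x - 2 * α) * d.choose (s + α - x + 1) * (s + α - x + 1)
        = a.choose α * b.choose (x - 2 * α) * (d.choose (s + α - x + 1) * (s + α - x + 1)) := by ring
      _ = a.choose α * b.choose (x - 2 * α) * (d.choose (s + α - x) * (d - (s + α - x))) := by rw [key]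
      _ = a.choose α * b.choose (x - 2 * α) * d.choose (s + α - x) * (d - (s + α - x)) := by ring

/-- The `s`-step tilt ratio `(d − m)/(m + 1)`, `m = s + α − x`, is ANTITONE in `α` (cross-multiplied, for
`α ≤ α'` on the line): `(d − m')·(m + 1) ≤ (d − m)·(m' + 1)`. Hence the line-section law for sample size
`s + 1` is a monotone (decreasing) tilt of the one for `s`. [cite: ChattamvelliShanmugam2020, §7.4 (PDF p. 144)] -/
theorem tiltRatio_anti {d s x α α' : ℕ} (hα : α ≤ α') (hx : x ≤ s + α) :
    (d - (s + α' - x)) * (s + α - x + 1) ≤ (d - (s + α - x)) * (s + α' - x + 1) := by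
  have h1 : s + α - x ≤ s + α' - x := by omega
  have h2 : d - (s + α' - x) ≤ d - (s + α - x) := Nat.sub_le_sub_left h1 d
  exact Nat.mul_le_mul h2 (by omega)

/-! ### §3 The consecutive ratio in `α` -/

/-- **The `α`-step ratio**, cross-multiplied in `ℕ`: with `j = x − 2α ≥ 2` and `m = s + α − x`,
`W(α+1)·((α+1)·((b+2−j)(b+1−j))·(m+1)) = W(α)·((a−α)·(j(j−1))·(d−m))` — three hypergeometric recurrences
(kind `A` up by one, kind `B` down by two, kind `D` up by one).
[cite: ChattamvelliShanmugam2020, §7.4 Table 7.1 (PDF p. 143)] -/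
theorem lineW_succ_mul (a b d s x α : ℕ) (h1 : 2 * α + 2 ≤ x) (h2 : x ≤ s + α) :
    lineW a b d s x (α + 1) * ((α + 1) * ((b + 2 - (x - 2 * α)) * (b + 1 - (x - 2 * α))) *
        (s + α - x + 1)) =
      lineW a b d s x α * ((a - α) * ((x - 2 * α) * (x - 2 * α - 1)) * (d - (s + α - x))) := by
  rw [lineW_of_le (by omega : 2 * (α + 1) ≤ x) (by omega : x ≤ s + (α + 1)), lineW_of_le (by omega) h2]
  set j := x - 2 * α with hj
  set m := s + α - x with hm
  have ej : x - 2 * (α + 1) = j - 2 := by omega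
  have em : s + (α + 1) - x = m + 1 := by omega
  rw [ej, em]
  have hj2 : 2 ≤ j := by omega
  -- the three recurrences
  have kA := Nat.choose_succ_right_eq a α            -- C(a,α+1)(α+1) = C(a,α)(a−α)
  have kD := Nat.choose_succ_right_eq d m            -- C(d,m+1)(m+1) = C(d,m)(d−m)
  have kB1 := Nat.choose_succ_right_eq b (j - 2)     -- C(b,j−1)(j−1) = C(b,j−2)(b−(j−2))
  have kB2 := Nat.choose_succ_right_eq b (j - 1)     -- C(b,j)·j = C(b,j−1)(b−(j−1))
  have e1 : j - 2 + 1 = j - 1 := by omega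
  have e2 : j - 1 + 1 = j := by omega
  rw [e1] at kB1
  rw [e2] at kB2
  have eb1 : b + 2 - j = b - (j - 2) := by omega
  have eb2 : b + 1 - j = b - (j - 1) := by omega
  rw [eb1, eb2]
  -- `C(b,j−2)(b−(j−2))(b−(j−1)) = C(b,j)·j·(j−1)`
  have kB : b.choose (j - 2) * ((b - (j - 2)) * (b - (j - 1))) = b.choose j * (j * (j - 1)) := by
    calc b.choose (j - 2) * ((b - (j - 2)) * (b - (j - 1)))
        = (b.choose (j - 2) * (b - (j - 2))) * (b - (j - 1)) := by ring
      _ = (b.choose (j - 1) * (j - 1)) * (b - (j - 1)) := by rw [kB1]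
      _ = (b.choose (j - 1) * (b - (j - 1))) * (j - 1) := by ring
      _ = (b.choose j * j) * (j - 1) := by rw [kB2]
      _ = b.choose j * (j * (j - 1)) := by ring
  calc a.choose (α + 1) * b.choose (j - 2) * d.choose (m + 1) *
        ((α + 1) * ((b - (j - 2)) * (b - (j - 1))) * (m + 1))
      = (a.choose (α + 1) * (α + 1)) * (b.choose (j - 2) * ((b - (j - 2)) * (b - (j - 1)))) *
          (d.choose (m + 1) * (m + 1)) := by ring
    _ = (a.choose α * (a - α)) * (b.choose j * (j * (j - 1))) * (d.choose m * (d - m)) := by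
        rw [kA, kB, kD]
    _ = a.choose α * b.choose j * d.choose m * ((a - α) * (j * (j - 1)) * (d - m)) := by ring

/-! ### §4 Log-concavity in `α` -/

/-- **A binomial row is log-concave** (one step): `C(n,k)·C(n,k+2) ≤ C(n,k+1)²`.
[cite: ChattamvelliShanmugam2020, §7.4 Table 7.1 (PDF p. 143), the recurrence `C(n,k+1)(k+1) = C(n,k)(n−k)`] -/
theorem choose_mul_choose_le_sq (n k : ℕ) : n.choose k * n.choose (k + 2) ≤ n.choose (k + 1) ^ 2 := by
  rcases Nat.lt_or_ge n (k + 2) with h | h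
  · rw [Nat.choose_eq_zero_of_lt h]; simp
  · have h1 := Nat.choose_succ_right_eq n k          -- C(k+1)(k+1) = C(k)(n−k)
    have h2 := Nat.choose_succ_right_eq n (k + 1)    -- C(k+2)(k+2) = C(k+1)(n−(k+1))
    have hpos : 0 < (k + 2) * (n - k) := Nat.mul_pos (by omega) (by omega)
    refine Nat.le_of_mul_le_mul_right ?_ hpos
    calc n.choose k * n.choose (k + 2) * ((k + 2) * (n - k))
        = (n.choose k * (n - k)) * (n.choose (k + 1 + 1) * (k + 1 + 1)) := by ring
      _ = (n.choose (k + 1) * (k + 1)) * (n.choose (k + 1) * (n - (k + 1))) := by rw [← h1, h2]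
      _ = n.choose (k + 1) ^ 2 * ((k + 1) * (n - (k + 1))) := by ring
      _ ≤ n.choose (k + 1) ^ 2 * ((k + 2) * (n - k)) :=
          Nat.mul_le_mul_left _ (Nat.mul_le_mul (by omega) (by omega))

/-- **A binomial row is log-concave** (two steps): `C(n,k)·C(n,k+4) ≤ C(n,k+2)²` — from the one-step
inequality applied three times (no internal zeros). [cite: ChattamvelliShanmugam2020, §7.4 Table 7.1 (PDF p. 143)] -/
theorem choose_mul_choose_le_sq_two (n k : ℕ) : n.choose k * n.choose (k + 4) ≤ n.choose (k + 2) ^ 2 := by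
  rcases Nat.lt_or_ge n (k + 4) with h | h
  · rw [Nat.choose_eq_zero_of_lt h]; simp
  · have l1 := choose_mul_choose_le_sq n k            -- u0 u2 ≤ u1²
    have l2 := choose_mul_choose_le_sq n (k + 1)      -- u1 u3 ≤ u2²
    have l3 := choose_mul_choose_le_sq n (k + 2)      -- u2 u4 ≤ u3²
    have p1 : 0 < n.choose (k + 1) := Nat.choose_pos (by omega)
    have p3 : 0 < n.choose (k + 3) := Nat.choose_pos (by omega)
    -- `u1 u3 ≥ u0 u4`: from `(u1 u3)² ≥ (u0 u2)(u2 u4) = u0 u4 · u2²` and `u2² ≥ u1 u3`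
    have h13 : n.choose k * n.choose (k + 4) ≤ n.choose (k + 1) * n.choose (k + 3) := by
      have hsq : (n.choose k * n.choose (k + 4)) * (n.choose (k + 1) * n.choose (k + 3)) ≤
          (n.choose (k + 1) * n.choose (k + 3)) * (n.choose (k + 1) * n.choose (k + 3)) := by
        calc (n.choose k * n.choose (k + 4)) * (n.choose (k + 1) * n.choose (k + 3))
            ≤ (n.choose k * n.choose (k + 4)) * (n.choose (k + 2) ^ 2) := by
              refine Nat.mul_le_mul_left _ ?_
              have := l2; simpa [pow_two, add_assoc] using this
          _ = (n.choose k * n.choose (k + 2)) * (n.choose (k + 2) * n.choose (k + 4)) := by ring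
          _ ≤ n.choose (k + 1) ^ 2 * n.choose (k + 3) ^ 2 := by
              refine Nat.mul_le_mul l1 ?_
              have := l3; simpa [pow_two, add_assoc] using this
          _ = (n.choose (k + 1) * n.choose (k + 3)) * (n.choose (k + 1) * n.choose (k + 3)) := by ring
      exact Nat.le_of_mul_le_mul_right hsq (Nat.mul_pos p1 p3)
    calc n.choose k * n.choose (k + 4) ≤ n.choose (k + 1) * n.choose (k + 3) := h13
      _ ≤ n.choose (k + 2) ^ 2 := by have := l2; simpa [pow_two, add_assoc] using this

/-- **Log-concavity of the line section in `α`**: `W(α)·W(α+2) ≤ W(α+1)²` for all parameters — the product of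
the log-concave rows `α ↦ C(a,α)`, `α ↦ C(b, x−2α)` (a binomial row read along an arithmetic progression of
step `2`, `choose_mul_choose_le_sq_two`) and `α ↦ C(d, s+α−x)`. In particular the conditional law of `α`
given the score is unimodal and its consecutive ratio `W(α+1)/W(α)` is non-increasing.
[cite: ChattamvelliShanmugam2020, §7.4 (PDF p. 144)] -/
theorem lineW_mul_lineW_le_sq (a b d s x α : ℕ) :
    lineW a b d s x α * lineW a b d s x (α + 2) ≤ lineW a b d s x (α + 1) ^ 2 := by
  by_cases h : 2 * (α + 2) ≤ x ∧ x ≤ s + α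
  · obtain ⟨h1, h2⟩ := h
    rw [lineW_of_le (by omega : 2 * α ≤ x) h2, lineW_of_le h1 (by omega : x ≤ s + (α + 2)),
      lineW_of_le (by omega : 2 * (α + 1) ≤ x) (by omega : x ≤ s + (α + 1))]
    -- indices: `j = x − 2α − 4`, so the three middle arguments are `j+4, j+2, j`; `m = s+α−x`, last are `m, m+1, m+2`
    obtain ⟨j, hj⟩ : ∃ j, x - 2 * α = j + 4 := ⟨x - 2 * α - 4, by omega⟩
    have ej1 : x - 2 * (α + 1) = j + 2 := by omega
    have ej2 : x - 2 * (α + 2) = j := by omega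
    set m := s + α - x with hm
    have em1 : s + (α + 1) - x = m + 1 := by omega
    have em2 : s + (α + 2) - x = m + 2 := by omega
    rw [hj, ej1, ej2, em1, em2]
    have lA := choose_mul_choose_le_sq a α
    have lB := choose_mul_choose_le_sq_two b j
    have lD := choose_mul_choose_le_sq d m
    calc a.choose α * b.choose (j + 4) * d.choose m * (a.choose (α + 2) * b.choose j * d.choose (m + 2))
        = (a.choose α * a.choose (α + 2)) * (b.choose j * b.choose (j + 4)) *
            (d.choose m * d.choose (m + 2)) := by ring
      _ ≤ a.choose (α + 1) ^ 2 * b.choose (j + 2) ^ 2 * d.choose (m + 1) ^ 2 :=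
          Nat.mul_le_mul (Nat.mul_le_mul lA lB) lD
      _ = (a.choose (α + 1) * b.choose (j + 2) * d.choose (m + 1)) ^ 2 := by ring
  · -- one of the outer weights is off the line
    rw [not_and_or] at h
    rcases h with h | h
    · rw [lineW_eq_zero_of_lt (α := α + 2) (by omega)]; simp
    · rw [lineW_eq_zero_of_lt' (α := α) (by omega)]; simp

/-! ### §5 (v2) Positivity, the ratio identity without side conditions, two-sided strong log-concavity

The support of `α ↦ W_s(α)` is an interval (five linear constraints), the `α`-step ratio identity holds for
all parameters once the last denominator factor is written `s + α + 1 − x`, and the ratio of consecutive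
ratios `R(α+1)/R(α)` (`R(α) = W(α+1)/W(α)`) is a product of eight factors `1 − 1/y` or `1 − 2/y`: it is at
least `(1 − 2/M)^8` when the six margins are `≥ M` and at most `(1 − 1/Y)^{12}` when `Y` dominates the type —
the line section is log-concave "with constants", the discrete form of strong log-concavity
[SaumardWellner2014, §4 (arXiv p. 13): `p_x² ≥ p_{x−1}p_{x+1}` iff `p_{x+1}/p_x` is non-increasing;
Definition 2.8 (arXiv p. 5): strongly log-concave = log-concave × Gaussian]. -/

/-- **Positivity.** `W_s(α) > 0` iff `α` is on the line (`2α ≤ x ≤ s + α`) and inside the three binomial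
supports (`α ≤ a`, `x − 2α ≤ b`, `s + α − x ≤ d`): five LINEAR constraints in `α`, so the support of the
line section is an interval. [cite: ChattamvelliShanmugam2020, §7.4 (PDF p. 144)] -/
theorem lineW_pos_iff {a b d s x α : ℕ} :
    0 < lineW a b d s x α ↔ 2 * α ≤ x ∧ x ≤ s + α ∧ α ≤ a ∧ x ≤ 2 * α + b ∧ s + α ≤ x + d := by
  unfold lineW
  split_ifs with h
  · obtain ⟨h1, h2⟩ := h
    rw [Nat.pos_iff_ne_zero, mul_ne_zero_iff, mul_ne_zero_iff, Ne, Ne, Ne,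
      Nat.choose_eq_zero_iff, Nat.choose_eq_zero_iff, Nat.choose_eq_zero_iff]
    omega
  · simp only [lt_self_iff_false, false_iff]
    omega

/-- **The `α`-step ratio, unconditionally.** With `j = x − 2α`, `m = s + α − x` (truncated subtraction) and
the last denominator factor written `s + α + 1 − x`:
`W(α+1)·((α+1)·((b+2−j)(b+1−j))·(s+α+1−x)) = W(α)·((a−α)·(j(j−1))·(d−m))` for ALL parameters — on the line
this is `lineW_succ_mul`; below it (`j ≤ 1`) both sides vanish; above it (`x > s + α`) both sides vanish.
So `N(α) = (a−α)j(j−1)(d−m)` and `D(α) = (α+1)(b+2−j)(b+1−j)(s+α+1−x)` are the numerator and the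
denominator of the consecutive ratio everywhere. [cite: ChattamvelliShanmugam2020, §7.4 Table 7.1 (PDF p. 143)] -/
theorem lineW_succ_mul' (a b d s x α : ℕ) :
    lineW a b d s x (α + 1) * ((α + 1) * ((b + 2 - (x - 2 * α)) * (b + 1 - (x - 2 * α))) *
        (s + α + 1 - x)) =
      lineW a b d s x α * ((a - α) * ((x - 2 * α) * (x - 2 * α - 1)) * (d - (s + α - x))) := by
  rcases Nat.lt_or_ge x (2 * α + 2) with hj | hj
  · -- below the line for `α + 1`: `j ≤ 1`
    rw [lineW_eq_zero_of_lt (α := α + 1) (by omega)]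
    have hz : (x - 2 * α) * (x - 2 * α - 1) = 0 := by
      rcases Nat.lt_or_ge x (2 * α + 1) with h | h
      · have e : x - 2 * α = 0 := by omega
        rw [e, zero_mul]
      · have e : x - 2 * α - 1 = 0 := by omega
        rw [e, mul_zero]
    rw [hz]; simp
  rcases Nat.lt_or_ge (s + α) x with hm | hm
  · -- above the line for `α`
    rw [lineW_eq_zero_of_lt' hm]
    rcases Nat.lt_or_ge (s + α + 1) x with h | h
    · rw [lineW_eq_zero_of_lt' (α := α + 1) (by omega)]; simp
    · have e : s + α + 1 - x = 0 := by omega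
      rw [e]; simp
  · have e : s + α + 1 - x = s + α - x + 1 := by omega
    rw [e]
    exact lineW_succ_mul a b d s x α hj hm

/-- `(M−2)·y ≤ M·(y−1)` for `M ≤ y`: the step `1 − 1/y ≥ 1 − 2/M`. [folklore] -/
private theorem fac_one {M y : ℕ} (h : M ≤ y) : (M - 2) * y ≤ M * (y - 1) := by
  rcases Nat.lt_or_ge M 2 with hM | hM
  · have e : M - 2 = 0 := by omega
    rw [e, zero_mul]; exact Nat.zero_le _
  · obtain ⟨M', rfl⟩ : ∃ M', M = M' + 2 := ⟨M - 2, by omega⟩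
    obtain ⟨y', rfl⟩ : ∃ y', y = y' + 1 := ⟨y - 1, by omega⟩
    simp only [Nat.add_sub_cancel]
    nlinarith

/-- `(M−2)·y ≤ M·(y−2)` for `M ≤ y`: the step `1 − 2/y ≥ 1 − 2/M`. [folklore] -/
private theorem fac_two {M y : ℕ} (h : M ≤ y) : (M - 2) * y ≤ M * (y - 2) := by
  rcases Nat.lt_or_ge M 2 with hM | hM
  · have e : M - 2 = 0 := by omega
    rw [e, zero_mul]; exact Nat.zero_le _
  · obtain ⟨M', rfl⟩ : ∃ M', M = M' + 2 := ⟨M - 2, by omega⟩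
    obtain ⟨y', rfl⟩ : ∃ y', y = y' + 2 := ⟨y - 2, by omega⟩
    simp only [Nat.add_sub_cancel]
    nlinarith

/-- `Y·(y−1) ≤ (Y−1)·y` for `y ≤ Y`: the step `1 − 1/y ≤ 1 − 1/Y`. [folklore] -/
private theorem fac_one' {Y y : ℕ} (h : y ≤ Y) : Y * (y - 1) ≤ (Y - 1) * y := by
  rcases Nat.eq_zero_or_pos y with rfl | hy
  · simp
  · obtain ⟨y', rfl⟩ : ∃ y', y = y' + 1 := ⟨y - 1, by omega⟩
    obtain ⟨Y', rfl⟩ : ∃ Y', Y = Y' + 1 := ⟨Y - 1, by omega⟩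
    simp only [Nat.add_sub_cancel]
    nlinarith

/-- `Y²·(y−2) ≤ (Y−1)²·y` for `y ≤ Y`: the step `1 − 2/y ≤ (1 − 1/Y)²`. [folklore] -/
private theorem fac_two' {Y y : ℕ} (h : y ≤ Y) : Y ^ 2 * (y - 2) ≤ (Y - 1) ^ 2 * y := by
  rcases Nat.lt_or_ge y 2 with hy | hy
  · have e : y - 2 = 0 := by omega
    rw [e, mul_zero]; exact Nat.zero_le _
  · obtain ⟨y', rfl⟩ : ∃ y', y = y' + 2 := ⟨y - 2, by omega⟩
    obtain ⟨Y', rfl⟩ : ∃ Y', Y = Y' + 1 := ⟨Y - 1, by omega⟩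
    simp only [Nat.add_sub_cancel]
    have h2 := Nat.mul_le_mul_left Y' h
    nlinarith [h2]

/-- **Reverse log-concavity with defect.** If the six margins at `α` are at least `M ≥ 2` — `α + M ≤ a`,
`M ≤ α + 2`, `2α + M + 1 ≤ x` (`j ≥ M + 1`), `x + M ≤ 2α + b + 3` (`b + 3 − j ≥ M`), `x + M ≤ s + α + 2`
(`m + 2 ≥ M`), `s + α + M ≤ x + d` (`d − m ≥ M`), with `j = x − 2α`, `m = s + α − x` — then
`(M−2)^8 · W(α+1)² ≤ M^8 · W(α)·W(α+2)`: the consecutive ratio `R(α) = W(α+1)/W(α)` obeys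
`R(α+1) ≥ (1 − 2/M)^8 · R(α)`, because each of the eight linear factors of `R(α+1)/R(α)` (two applications of
`lineW_succ_mul`) is `≥ 1 − 2/M`. With `lineW_mul_lineW_le_sq` (`R` non-increasing) the ratio moves by a
factor in `[(1 − 2/M)^8, 1]` per step. [cite: SaumardWellner2014, §4 (arXiv p. 13); the factors from
ChattamvelliShanmugam2020, §7.4 Table 7.1 (PDF p. 143)] -/
theorem lineW_sq_mul_pow_le (a b d s x α M : ℕ) (hM : 2 ≤ M) (h1 : α + M ≤ a) (h2 : M ≤ α + 2)
    (h3 : 2 * α + M + 1 ≤ x) (h4 : x + M ≤ 2 * α + b + 3) (h5 : x + M ≤ s + α + 2)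
    (h6 : s + α + M ≤ x + d) :
    (M - 2) ^ 8 * lineW a b d s x (α + 1) ^ 2 ≤
      M ^ 8 * (lineW a b d s x α * lineW a b d s x (α + 2)) := by
  rcases (show M = 2 ∨ 3 ≤ M by omega) with rfl | hM3
  · simp
  rcases Nat.eq_zero_or_pos (lineW a b d s x (α + 1)) with h0 | hpos
  · rw [h0]; simp
  obtain ⟨-, p2, -, p4, p5⟩ := lineW_pos_iff.1 hpos
  have hxs : x ≤ s + α := by omega
  have id0 := lineW_succ_mul a b d s x α (by omega) hxs
  have id1 := lineW_succ_mul a b d s x (α + 1) (by omega) (by omega)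
  rw [show α + 2 = α + 1 + 1 from rfl]
  set W0 := lineW a b d s x α
  set W1 := lineW a b d s x (α + 1)
  set W2 := lineW a b d s x (α + 1 + 1)
  set j := x - 2 * α with hj
  set m := s + α - x with hm
  have ej : x - 2 * (α + 1) = j - 2 := by omega
  have ej' : j - 2 - 1 = j - 3 := by omega
  have em : s + (α + 1) - x = m + 1 := by omega
  have eb1 : b + 2 - (j - 2) = b + 4 - j := by omega
  have eb2 : b + 1 - (j - 2) = b + 3 - j := by omega
  have ed : d - (m + 1) = d - m - 1 := by omega
  have ea : a - (α + 1) = a - α - 1 := by omega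
  rw [ej, ej', em, eb1, eb2, ed, ea] at id1
  -- the eight factor inequalities
  have f1 : (M - 2) * (a - α) ≤ M * (a - α - 1) := fac_one (by omega)
  have f2 : (M - 2) * j ≤ M * (j - 2) := fac_two (by omega)
  have f3 : (M - 2) * (j - 1) ≤ M * (j - 3) := by
    have t := fac_two (M := M) (y := j - 1) (by omega)
    have e : j - 1 - 2 = j - 3 := by omega
    rw [e] at t; exact t
  have f4 : (M - 2) * (d - m) ≤ M * (d - m - 1) := fac_one (by omega)
  have f5 : (M - 2) * (α + 2) ≤ M * (α + 1) := by
    have t := fac_one (M := M) (y := α + 2) (by omega)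
    simpa using t
  have f6 : (M - 2) * (b + 4 - j) ≤ M * (b + 2 - j) := by
    have t := fac_two (M := M) (y := b + 4 - j) (by omega)
    have e : b + 4 - j - 2 = b + 2 - j := by omega
    rw [e] at t; exact t
  have f7 : (M - 2) * (b + 3 - j) ≤ M * (b + 1 - j) := by
    have t := fac_two (M := M) (y := b + 3 - j) (by omega)
    have e : b + 3 - j - 2 = b + 1 - j := by omega
    rw [e] at t; exact t
  have f8 : (M - 2) * (m + 2) ≤ M * (m + 1) := by
    have t := fac_one (M := M) (y := m + 2) (by omega)
    simpa using t
  -- `(M−2)^8 · N(α) · D(α+1) ≤ M^8 · N(α+1) · D(α)`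
  have key : (M - 2) ^ 8 * (((a - α) * (j * (j - 1)) * (d - m)) *
      ((α + 2) * ((b + 4 - j) * (b + 3 - j)) * (m + 2))) ≤
      M ^ 8 * (((a - α - 1) * ((j - 2) * (j - 3)) * (d - m - 1)) *
      ((α + 1) * ((b + 2 - j) * (b + 1 - j)) * (m + 1))) := by
    have t := Nat.mul_le_mul (Nat.mul_le_mul (Nat.mul_le_mul f1 f2) (Nat.mul_le_mul f3 f4))
      (Nat.mul_le_mul (Nat.mul_le_mul f5 f6) (Nat.mul_le_mul f7 f8))
    calc (M - 2) ^ 8 * (((a - α) * (j * (j - 1)) * (d - m)) *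
          ((α + 2) * ((b + 4 - j) * (b + 3 - j)) * (m + 2)))
        = ((M - 2) * (a - α)) * ((M - 2) * j) * (((M - 2) * (j - 1)) * ((M - 2) * (d - m))) *
          (((M - 2) * (α + 2)) * ((M - 2) * (b + 4 - j)) *
            (((M - 2) * (b + 3 - j)) * ((M - 2) * (m + 2)))) := by ring
      _ ≤ (M * (a - α - 1)) * (M * (j - 2)) * ((M * (j - 3)) * (M * (d - m - 1))) *
          ((M * (α + 1)) * (M * (b + 2 - j)) * ((M * (b + 1 - j)) * (M * (m + 1)))) := t
      _ = _ := by ring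
  have hN0 : 0 < (a - α) * (j * (j - 1)) * (d - m) :=
    Nat.mul_pos (Nat.mul_pos (by omega) (Nat.mul_pos (by omega) (by omega))) (by omega)
  have hD1 : 0 < (α + 2) * ((b + 4 - j) * (b + 3 - j)) * (m + 2) :=
    Nat.mul_pos (Nat.mul_pos (by omega) (Nat.mul_pos (by omega) (by omega))) (by omega)
  refine Nat.le_of_mul_le_mul_right ?_ (Nat.mul_pos hN0 hD1)
  calc (M - 2) ^ 8 * W1 ^ 2 *
        ((a - α) * (j * (j - 1)) * (d - m) * ((α + 2) * ((b + 4 - j) * (b + 3 - j)) * (m + 2)))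
      = W1 ^ 2 * ((M - 2) ^ 8 * (((a - α) * (j * (j - 1)) * (d - m)) *
          ((α + 2) * ((b + 4 - j) * (b + 3 - j)) * (m + 2)))) := by ring
    _ ≤ W1 ^ 2 * (M ^ 8 * (((a - α - 1) * ((j - 2) * (j - 3)) * (d - m - 1)) *
          ((α + 1) * ((b + 2 - j) * (b + 1 - j)) * (m + 1)))) := Nat.mul_le_mul_left _ key
    _ = M ^ 8 * ((W1 * ((α + 1) * ((b + 2 - j) * (b + 1 - j)) * (m + 1))) *
          (W1 * ((a - α - 1) * ((j - 2) * (j - 3)) * (d - m - 1)))) := by ring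
    _ = M ^ 8 * ((W0 * ((a - α) * (j * (j - 1)) * (d - m))) *
          (W2 * ((α + 1 + 1) * ((b + 4 - j) * (b + 3 - j)) * (m + 1 + 1)))) := by rw [id0, ← id1]
    _ = M ^ 8 * (W0 * W2) *
        ((a - α) * (j * (j - 1)) * (d - m) * ((α + 2) * ((b + 4 - j) * (b + 3 - j)) * (m + 2))) := by
        ring

/-- **Strong log-concavity.** If `Y` dominates the type (`a + 2 ≤ Y`, `b + 4 ≤ Y`, `d + 2 ≤ Y`) then
`Y^{12} · W(α)·W(α+2) ≤ (Y−1)^{12} · W(α+1)²` for every `α`: the consecutive ratio DEcreases by at least the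
factor `(1 − 1/Y)^{12}` at each step (each of the eight linear factors of `R(α+1)/R(α)` is `≤ 1 − 1/Y` or
`≤ (1 − 1/Y)²`), i.e. the line section is log-concave relative to a discrete Gaussian of variance `≈ Y/24`
— hence sub-Gaussian around its mode (§6). [cite: SaumardWellner2014, Definition 2.8 (arXiv p. 5) and §4
(arXiv p. 13); factors from ChattamvelliShanmugam2020, §7.4 Table 7.1 (PDF p. 143)] -/
theorem lineW_mul_lineW_mul_pow_le (a b d s x α Y : ℕ) (ha : a + 2 ≤ Y) (hb : b + 4 ≤ Y) (hd : d + 2 ≤ Y) :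
    Y ^ 12 * (lineW a b d s x α * lineW a b d s x (α + 2)) ≤
      (Y - 1) ^ 12 * lineW a b d s x (α + 1) ^ 2 := by
  rcases Nat.eq_zero_or_pos (lineW a b d s x α) with h0 | hpos0
  · rw [h0]; simp
  rcases Nat.eq_zero_or_pos (lineW a b d s x (α + 2)) with h2 | hpos2
  · rw [h2]; simp
  obtain ⟨q1, q2, q3, q4, q5⟩ := lineW_pos_iff.1 hpos0
  obtain ⟨r1, r2, r3, r4, r5⟩ := lineW_pos_iff.1 hpos2
  have id0 := lineW_succ_mul a b d s x α (by omega) q2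
  have id1 := lineW_succ_mul a b d s x (α + 1) (by omega) (by omega)
  rw [show α + 2 = α + 1 + 1 from rfl]
  set W0 := lineW a b d s x α
  set W1 := lineW a b d s x (α + 1)
  set W2 := lineW a b d s x (α + 1 + 1)
  set j := x - 2 * α with hj
  set m := s + α - x with hm
  have ej : x - 2 * (α + 1) = j - 2 := by omega
  have ej' : j - 2 - 1 = j - 3 := by omega
  have em : s + (α + 1) - x = m + 1 := by omega
  have eb1 : b + 2 - (j - 2) = b + 4 - j := by omega
  have eb2 : b + 1 - (j - 2) = b + 3 - j := by omega
  have ed : d - (m + 1) = d - m - 1 := by omega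
  have ea : a - (α + 1) = a - α - 1 := by omega
  rw [ej, ej', em, eb1, eb2, ed, ea] at id1
  -- the eight factor inequalities (opposite pairing)
  have g1 : Y * (a - α - 1) ≤ (Y - 1) * (a - α) := fac_one' (by omega)
  have g2 : Y ^ 2 * (j - 2) ≤ (Y - 1) ^ 2 * j := fac_two' (by omega)
  have g3 : Y ^ 2 * (j - 3) ≤ (Y - 1) ^ 2 * (j - 1) := by
    have t := fac_two' (Y := Y) (y := j - 1) (by omega)
    have e : j - 1 - 2 = j - 3 := by omega
    rw [e] at t; exact t
  have g4 : Y * (d - m - 1) ≤ (Y - 1) * (d - m) := fac_one' (by omega)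
  have g5 : Y * (α + 1) ≤ (Y - 1) * (α + 2) := by
    have t := fac_one' (Y := Y) (y := α + 2) (by omega)
    simpa using t
  have g6 : Y ^ 2 * (b + 2 - j) ≤ (Y - 1) ^ 2 * (b + 4 - j) := by
    have t := fac_two' (Y := Y) (y := b + 4 - j) (by omega)
    have e : b + 4 - j - 2 = b + 2 - j := by omega
    rw [e] at t; exact t
  have g7 : Y ^ 2 * (b + 1 - j) ≤ (Y - 1) ^ 2 * (b + 3 - j) := by
    have t := fac_two' (Y := Y) (y := b + 3 - j) (by omega)
    have e : b + 3 - j - 2 = b + 1 - j := by omega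
    rw [e] at t; exact t
  have g8 : Y * (m + 1) ≤ (Y - 1) * (m + 2) := by
    have t := fac_one' (Y := Y) (y := m + 2) (by omega)
    simpa using t
  -- `Y^12 · N(α+1) · D(α) ≤ (Y−1)^12 · N(α) · D(α+1)`
  have key : Y ^ 12 * (((a - α - 1) * ((j - 2) * (j - 3)) * (d - m - 1)) *
      ((α + 1) * ((b + 2 - j) * (b + 1 - j)) * (m + 1))) ≤
      (Y - 1) ^ 12 * (((a - α) * (j * (j - 1)) * (d - m)) *
      ((α + 2) * ((b + 4 - j) * (b + 3 - j)) * (m + 2))) := by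
    have t := Nat.mul_le_mul (Nat.mul_le_mul (Nat.mul_le_mul g1 g2) (Nat.mul_le_mul g3 g4))
      (Nat.mul_le_mul (Nat.mul_le_mul g5 g6) (Nat.mul_le_mul g7 g8))
    calc Y ^ 12 * (((a - α - 1) * ((j - 2) * (j - 3)) * (d - m - 1)) *
          ((α + 1) * ((b + 2 - j) * (b + 1 - j)) * (m + 1)))
        = (Y * (a - α - 1)) * (Y ^ 2 * (j - 2)) * ((Y ^ 2 * (j - 3)) * (Y * (d - m - 1))) *
          ((Y * (α + 1)) * (Y ^ 2 * (b + 2 - j)) * ((Y ^ 2 * (b + 1 - j)) * (Y * (m + 1)))) := by ring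
      _ ≤ ((Y - 1) * (a - α)) * ((Y - 1) ^ 2 * j) * (((Y - 1) ^ 2 * (j - 1)) * ((Y - 1) * (d - m))) *
          (((Y - 1) * (α + 2)) * ((Y - 1) ^ 2 * (b + 4 - j)) *
            (((Y - 1) ^ 2 * (b + 3 - j)) * ((Y - 1) * (m + 2)))) := t
      _ = _ := by ring
  have hN0 : 0 < (a - α) * (j * (j - 1)) * (d - m) :=
    Nat.mul_pos (Nat.mul_pos (by omega) (Nat.mul_pos (by omega) (by omega))) (by omega)
  have hD1 : 0 < (α + 2) * ((b + 4 - j) * (b + 3 - j)) * (m + 2) :=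
    Nat.mul_pos (Nat.mul_pos (by omega) (Nat.mul_pos (by omega) (by omega))) (by omega)
  refine Nat.le_of_mul_le_mul_right ?_ (Nat.mul_pos hN0 hD1)
  calc Y ^ 12 * (W0 * W2) *
        ((a - α) * (j * (j - 1)) * (d - m) * ((α + 2) * ((b + 4 - j) * (b + 3 - j)) * (m + 2)))
      = Y ^ 12 * ((W0 * ((a - α) * (j * (j - 1)) * (d - m))) *
          (W2 * ((α + 1 + 1) * ((b + 4 - j) * (b + 3 - j)) * (m + 1 + 1)))) := by ring
    _ = Y ^ 12 * ((W1 * ((α + 1) * ((b + 2 - j) * (b + 1 - j)) * (m + 1))) *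
          (W1 * ((a - α - 1) * ((j - 2) * (j - 3)) * (d - m - 1)))) := by rw [← id0, id1]
    _ = W1 ^ 2 * (Y ^ 12 * (((a - α - 1) * ((j - 2) * (j - 3)) * (d - m - 1)) *
          ((α + 1) * ((b + 2 - j) * (b + 1 - j)) * (m + 1)))) := by ring
    _ ≤ W1 ^ 2 * ((Y - 1) ^ 12 * (((a - α) * (j * (j - 1)) * (d - m)) *
          ((α + 2) * ((b + 4 - j) * (b + 3 - j)) * (m + 2)))) := Nat.mul_le_mul_left _ key
    _ = (Y - 1) ^ 12 * W1 ^ 2 *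
        ((a - α) * (j * (j - 1)) * (d - m) * ((α + 2) * ((b + 4 - j) * (b + 3 - j)) * (m + 2))) := by
        ring

/-- Reverse log-concavity with defect, real form: `(1 − 2/M)^8 · W(α+1)² ≤ W(α)·W(α+2)` under the six
margins `≥ M ≥ 2` of `lineW_sq_mul_pow_le`. [cite: SaumardWellner2014, §4 (arXiv p. 13)] -/
theorem lineW_sq_mul_le_real (a b d s x α M : ℕ) (hM : 2 ≤ M) (h1 : α + M ≤ a) (h2 : M ≤ α + 2)
    (h3 : 2 * α + M + 1 ≤ x) (h4 : x + M ≤ 2 * α + b + 3) (h5 : x + M ≤ s + α + 2)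
    (h6 : s + α + M ≤ x + d) :
    (1 - 2 / (M : ℝ)) ^ 8 * (lineW a b d s x (α + 1) : ℝ) ^ 2 ≤
      (lineW a b d s x α : ℝ) * lineW a b d s x (α + 2) := by
  have h := lineW_sq_mul_pow_le a b d s x α M hM h1 h2 h3 h4 h5 h6
  have hM0 : (0 : ℝ) < M := by exact_mod_cast (show 0 < M by omega)
  have h' : ((M : ℝ) - 2) ^ 8 * (lineW a b d s x (α + 1) : ℝ) ^ 2 ≤
      (M : ℝ) ^ 8 * ((lineW a b d s x α : ℝ) * lineW a b d s x (α + 2)) := by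
    have t : (((M - 2) ^ 8 * lineW a b d s x (α + 1) ^ 2 : ℕ) : ℝ) ≤
        ((M ^ 8 * (lineW a b d s x α * lineW a b d s x (α + 2)) : ℕ) : ℝ) := by exact_mod_cast h
    push_cast [Nat.cast_sub hM] at t
    exact t
  have e : (1 - 2 / (M : ℝ)) ^ 8 = ((M : ℝ) - 2) ^ 8 / (M : ℝ) ^ 8 := by
    rw [← div_pow]; congr 1; field_simp
  rw [e, div_mul_eq_mul_div, div_le_iff₀ (by positivity)]
  linarith [h']

/-- Strong log-concavity, real form: `W(α)·W(α+2) ≤ (1 − 1/Y)^{12} · W(α+1)²` when `a+2, b+4, d+2 ≤ Y`.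
[cite: SaumardWellner2014, Definition 2.8 (arXiv p. 5), §4 (arXiv p. 13)] -/
theorem lineW_mul_lineW_le_real (a b d s x α Y : ℕ) (ha : a + 2 ≤ Y) (hb : b + 4 ≤ Y) (hd : d + 2 ≤ Y) :
    (lineW a b d s x α : ℝ) * lineW a b d s x (α + 2) ≤
      (1 - 1 / (Y : ℝ)) ^ 12 * (lineW a b d s x (α + 1) : ℝ) ^ 2 := by
  have h := lineW_mul_lineW_mul_pow_le a b d s x α Y ha hb hd
  have hY1 : 1 ≤ Y := by omega
  have hY0 : (0 : ℝ) < Y := by exact_mod_cast (show 0 < Y by omega)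
  have h' : (Y : ℝ) ^ 12 * ((lineW a b d s x α : ℝ) * lineW a b d s x (α + 2)) ≤
      ((Y : ℝ) - 1) ^ 12 * (lineW a b d s x (α + 1) : ℝ) ^ 2 := by
    have t : ((Y ^ 12 * (lineW a b d s x α * lineW a b d s x (α + 2)) : ℕ) : ℝ) ≤
        (((Y - 1) ^ 12 * lineW a b d s x (α + 1) ^ 2 : ℕ) : ℝ) := by exact_mod_cast h
    push_cast [Nat.cast_sub hY1] at t
    exact t
  have e : (1 - 1 / (Y : ℝ)) ^ 12 = ((Y : ℝ) - 1) ^ 12 / (Y : ℝ) ^ 12 := by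
    rw [← div_pow]; congr 1; field_simp
  rw [e, div_mul_eq_mul_div, le_div_iff₀ (by positivity)]
  linarith [h']

/-! ### §6 (v2) Modes and discrete-Gaussian envelopes

Two generic facts about a nonnegative sequence `f` with interval support — `f(l)f(l+2) ≤ q·f(l+1)²`
forces `f(i) ≤ f(0)·(f(1)/f(0))^i·q^{C(i,2)}`, and `p·f(l+1)² ≤ f(l)f(l+2)` forces the reverse inequality —
applied to `l ↦ W(α₀ ± l)`: two-sided discrete-Gaussian envelopes of the line section around any anchor, in
particular around a maximiser `α*`, where `p^{C(i+1,2)} ≤ W(α* ± i)/W(α*) ≤ q^{C(i,2)}` with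
`p = (1 − 2/M)^8`, `q = (1 − 1/Y)^{12}`; every maximiser is pinned to within one by the sign change of
`N(α) − D(α)` (no closed mode formula is needed: `N` is antitone, `D` is monotone); tail mass past `L` steps
from the mode is at most `(a+1)·q^{C(L,2)}·W(α*)`. -/

/-- **Sub-Gaussian upper envelope from `q`-strong log-concavity** (generic). Let `f ≥ 0` with `f 0 > 0`,
support an initial segment of the window (`f l = 0 → f (l+1) = 0` for `l < n`) and
`f l · f (l+2) ≤ q · f (l+1)²` for `l + 2 ≤ n`. Then `f i ≤ f 0 · (f 1/f 0)^i · q^{C(i,2)}` for `i ≤ n`: the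
consecutive ratio decays geometrically, `f (i+1) ≤ q^i (f 1/f 0) f i`. The discrete form of "strongly
log-concave = log-concave relative to a Gaussian". [cite: SaumardWellner2014, §4 (arXiv p. 13) and
Definition 2.8 (arXiv p. 5)] -/
theorem le_envelope_of_strongLogConcave (f : ℕ → ℝ) (q : ℝ) (n : ℕ) (hq : 0 ≤ q) (hf : ∀ l, 0 ≤ f l)
    (h0 : 0 < f 0) (hsupp : ∀ l, l < n → f l = 0 → f (l + 1) = 0)
    (hlc : ∀ l, l + 2 ≤ n → f l * f (l + 2) ≤ q * f (l + 1) ^ 2) :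
    ∀ i, i ≤ n → f i ≤ f 0 * (f 1 / f 0) ^ i * q ^ (i.choose 2) := by
  have hr : 0 ≤ f 1 / f 0 := div_nonneg (hf 1) h0.le
  -- geometric decay of the consecutive ratio
  have step : ∀ i, i + 1 ≤ n → f (i + 1) ≤ q ^ i * (f 1 / f 0) * f i := by
    intro i
    induction i with
    | zero => intro _; simp [div_mul_cancel₀ _ h0.ne']
    | succ i ih =>
      intro hi
      have ih' := ih (by omega)
      rcases (hf (i + 1)).eq_or_lt with hz | hp
      · have e : f (i + 1 + 1) = 0 := hsupp (i + 1) (by omega) hz.symm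
        rw [e]
        exact mul_nonneg (mul_nonneg (pow_nonneg hq _) hr) (hf _)
      · have hpi : 0 < f i := by
          rcases (hf i).eq_or_lt with hz' | hp'
          · exact absurd (hsupp i (by omega) hz'.symm) hp.ne'
          · exact hp'
        have hq' := hlc i (by omega)
        have h1 : f (i + 1 + 1) ≤ q * f (i + 1) * (f (i + 1) / f i) := by
          rw [show i + 1 + 1 = i + 2 from rfl]
          have e : q * f (i + 1) * (f (i + 1) / f i) = q * f (i + 1) ^ 2 / f i := by
            field_simp
          rw [e, le_div_iff₀ hpi]
          linarith [hq']
        have h2 : f (i + 1) / f i ≤ q ^ i * (f 1 / f 0) := by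
          rw [div_le_iff₀ hpi]; exact ih'
        calc f (i + 1 + 1) ≤ q * f (i + 1) * (f (i + 1) / f i) := h1
          _ ≤ q * f (i + 1) * (q ^ i * (f 1 / f 0)) :=
              mul_le_mul_of_nonneg_left h2 (mul_nonneg hq (hf _))
          _ = q ^ (i + 1) * (f 1 / f 0) * f (i + 1) := by ring
  intro i
  induction i with
  | zero => intro _; simp
  | succ i ih =>
    intro hi
    have h1 := step i hi
    have h2 := ih (by omega)
    have ec : (i + 1).choose 2 = i + i.choose 2 := by
      simpa using Nat.choose_succ_succ' i 1
    calc f (i + 1) ≤ q ^ i * (f 1 / f 0) * f i := h1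
      _ ≤ q ^ i * (f 1 / f 0) * (f 0 * (f 1 / f 0) ^ i * q ^ (i.choose 2)) :=
          mul_le_mul_of_nonneg_left h2 (mul_nonneg (pow_nonneg hq _) hr)
      _ = f 0 * (f 1 / f 0) ^ (i + 1) * q ^ ((i + 1).choose 2) := by
          rw [ec, pow_add, pow_succ]; ring

/-- **Lower envelope from reverse log-concavity with defect** (generic). Let `f ≥ 0` with `f 0 > 0`, support
an initial segment of the window, and `p · f (l+1)² ≤ f l · f (l+2)` for `l + 2 ≤ n` (`p ≥ 0`). Then
`f 0 · (f 1/f 0)^i · p^{C(i,2)} ≤ f i` for `i ≤ n`. [cite: SaumardWellner2014, §4 (arXiv p. 13)] -/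
theorem envelope_le_of_reverseLogConcave (f : ℕ → ℝ) (p : ℝ) (n : ℕ) (hp : 0 ≤ p) (hf : ∀ l, 0 ≤ f l)
    (h0 : 0 < f 0) (hsupp : ∀ l, l < n → f l = 0 → f (l + 1) = 0)
    (hlc : ∀ l, l + 2 ≤ n → p * f (l + 1) ^ 2 ≤ f l * f (l + 2)) :
    ∀ i, i ≤ n → f 0 * (f 1 / f 0) ^ i * p ^ (i.choose 2) ≤ f i := by
  have hr : 0 ≤ f 1 / f 0 := div_nonneg (hf 1) h0.le
  have step : ∀ i, i + 1 ≤ n → p ^ i * (f 1 / f 0) * f i ≤ f (i + 1) := by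
    intro i
    induction i with
    | zero => intro _; simp [div_mul_cancel₀ _ h0.ne']
    | succ i ih =>
      intro hi
      have ih' := ih (by omega)
      rcases (hf (i + 1)).eq_or_lt with hz | hpos
      · rw [← hz, mul_zero]; exact hf _
      · have hpi : 0 < f i := by
          rcases (hf i).eq_or_lt with hz' | hp'
          · exact absurd (hsupp i (by omega) hz'.symm) hpos.ne'
          · exact hp'
        have hp' := hlc i (by omega)
        have h1 : p * f (i + 1) * (f (i + 1) / f i) ≤ f (i + 1 + 1) := by
          rw [show i + 1 + 1 = i + 2 from rfl]
          have e : p * f (i + 1) * (f (i + 1) / f i) = p * f (i + 1) ^ 2 / f i := by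
            field_simp
          rw [e, div_le_iff₀ hpi]
          linarith [hp']
        have h2 : p ^ i * (f 1 / f 0) ≤ f (i + 1) / f i := by
          rw [le_div_iff₀ hpi]; exact ih'
        calc p ^ (i + 1) * (f 1 / f 0) * f (i + 1) = p * f (i + 1) * (p ^ i * (f 1 / f 0)) := by ring
          _ ≤ p * f (i + 1) * (f (i + 1) / f i) :=
              mul_le_mul_of_nonneg_left h2 (mul_nonneg hp (hf _))
          _ ≤ f (i + 1 + 1) := h1
  intro i
  induction i with
  | zero => intro _; simp
  | succ i ih =>
    intro hi
    have h1 := step i hi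
    have h2 := ih (by omega)
    have ec : (i + 1).choose 2 = i + i.choose 2 := by
      simpa using Nat.choose_succ_succ' i 1
    calc f 0 * (f 1 / f 0) ^ (i + 1) * p ^ ((i + 1).choose 2)
        = p ^ i * (f 1 / f 0) * (f 0 * (f 1 / f 0) ^ i * p ^ (i.choose 2)) := by
          rw [ec, pow_add, pow_succ]; ring
      _ ≤ p ^ i * (f 1 / f 0) * f i :=
          mul_le_mul_of_nonneg_left h2 (mul_nonneg (pow_nonneg hp _) hr)
      _ ≤ f (i + 1) := h1

/-- Interval support, to the right: if `W(α₀) > 0` and `W(α₀ + l) = 0` then `W(α₀ + l + 1) = 0`.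
[cite: ChattamvelliShanmugam2020, §7.4 (PDF p. 144)] -/
theorem lineW_add_succ_eq_zero {a b d s x α₀ l : ℕ} (h0 : 0 < lineW a b d s x α₀)
    (hl : lineW a b d s x (α₀ + l) = 0) : lineW a b d s x (α₀ + l + 1) = 0 := by
  by_contra hne
  have h1 := lineW_pos_iff.1 (Nat.pos_of_ne_zero hne)
  have h2 := lineW_pos_iff.1 h0
  have h3 : 0 < lineW a b d s x (α₀ + l) := lineW_pos_iff.2 (by omega)
  omega

/-- Interval support, to the left: if `W(α₀) > 0`, `l < α₀` and `W(α₀ − l) = 0` then `W(α₀ − (l+1)) = 0`.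
[cite: ChattamvelliShanmugam2020, §7.4 (PDF p. 144)] -/
theorem lineW_sub_succ_eq_zero {a b d s x α₀ l : ℕ} (h0 : 0 < lineW a b d s x α₀) (hl0 : l < α₀)
    (hl : lineW a b d s x (α₀ - l) = 0) : lineW a b d s x (α₀ - (l + 1)) = 0 := by
  by_contra hne
  have h1 := lineW_pos_iff.1 (Nat.pos_of_ne_zero hne)
  have h2 := lineW_pos_iff.1 h0
  have h3 : 0 < lineW a b d s x (α₀ - l) := lineW_pos_iff.2 (by omega)
  omega

/-- **Upper envelope to the right of an anchor.** If `Y` dominates the type (`a+2, b+4, d+2 ≤ Y`) and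
`W(α₀) > 0` then `W(α₀+i) ≤ W(α₀)·(W(α₀+1)/W(α₀))^i·((1−1/Y)^{12})^{C(i,2)}` for every `i`: past a mode
(`W(α₀+1) ≤ W(α₀)`) the line section lies below a discrete Gaussian of variance `≈ Y/24`.
[cite: SaumardWellner2014, Definition 2.8 (arXiv p. 5), §4 (arXiv p. 13)] -/
theorem lineW_add_le_envelope (a b d s x α₀ Y : ℕ) (ha : a + 2 ≤ Y) (hb : b + 4 ≤ Y) (hd : d + 2 ≤ Y)
    (h0 : 0 < lineW a b d s x α₀) (i : ℕ) :
    (lineW a b d s x (α₀ + i) : ℝ) ≤ lineW a b d s x α₀ *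
      ((lineW a b d s x (α₀ + 1) : ℝ) / lineW a b d s x α₀) ^ i *
        ((1 - 1 / (Y : ℝ)) ^ 12) ^ (i.choose 2) := by
  have hY : (1 : ℝ) ≤ Y := by exact_mod_cast (show 1 ≤ Y by omega)
  have hq : (0 : ℝ) ≤ (1 - 1 / (Y : ℝ)) ^ 12 := by
    apply pow_nonneg
    have : 1 / (Y : ℝ) ≤ 1 := by rw [div_le_one (by linarith)]; exact hY
    linarith
  have t := le_envelope_of_strongLogConcave (fun l => (lineW a b d s x (α₀ + l) : ℝ))
    ((1 - 1 / (Y : ℝ)) ^ 12) i hq (fun l => by positivity) (by simpa using h0)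
    (fun l _ hl => by
      have hl' : lineW a b d s x (α₀ + l) = 0 := by exact_mod_cast hl
      simpa [Nat.add_assoc] using lineW_add_succ_eq_zero h0 hl')
    (fun l _ => by
      have := lineW_mul_lineW_le_real a b d s x (α₀ + l) Y ha hb hd
      simpa [Nat.add_assoc] using this)
    i le_rfl
  simpa using t

/-- **Upper envelope to the left of an anchor.** For `i ≤ α₀`, `Y` dominating the type and `W(α₀) > 0`:
`W(α₀−i) ≤ W(α₀)·(W(α₀−1)/W(α₀))^i·((1−1/Y)^{12})^{C(i,2)}`.
[cite: SaumardWellner2014, Definition 2.8 (arXiv p. 5), §4 (arXiv p. 13)] -/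
theorem lineW_sub_le_envelope (a b d s x α₀ Y : ℕ) (ha : a + 2 ≤ Y) (hb : b + 4 ≤ Y) (hd : d + 2 ≤ Y)
    (h0 : 0 < lineW a b d s x α₀) {i : ℕ} (hi : i ≤ α₀) :
    (lineW a b d s x (α₀ - i) : ℝ) ≤ lineW a b d s x α₀ *
      ((lineW a b d s x (α₀ - 1) : ℝ) / lineW a b d s x α₀) ^ i *
        ((1 - 1 / (Y : ℝ)) ^ 12) ^ (i.choose 2) := by
  have hY : (1 : ℝ) ≤ Y := by exact_mod_cast (show 1 ≤ Y by omega)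
  have hq : (0 : ℝ) ≤ (1 - 1 / (Y : ℝ)) ^ 12 := by
    apply pow_nonneg
    have : 1 / (Y : ℝ) ≤ 1 := by rw [div_le_one (by linarith)]; exact hY
    linarith
  have t := le_envelope_of_strongLogConcave (fun l => (lineW a b d s x (α₀ - l) : ℝ))
    ((1 - 1 / (Y : ℝ)) ^ 12) i hq (fun l => by positivity) (by simpa using h0)
    (fun l hl hz => by
      have hz' : lineW a b d s x (α₀ - l) = 0 := by exact_mod_cast hz
      exact_mod_cast lineW_sub_succ_eq_zero h0 (by omega) hz')
    (fun l hl => by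
      have := lineW_mul_lineW_le_real a b d s x (α₀ - (l + 2)) Y ha hb hd
      have e1 : α₀ - (l + 2) + 1 = α₀ - (l + 1) := by omega
      have e2 : α₀ - (l + 2) + 2 = α₀ - l := by omega
      rw [e1, e2] at this
      simpa [mul_comm] using this)
    i le_rfl
  simpa using t

/-- **Lower envelope to the right of an anchor.** If `W(α₀) > 0` and the six margins of `lineW_sq_mul_pow_le`
are `≥ M ≥ 2` at every `α₀ + l`, `l + 2 ≤ i`, then
`W(α₀)·(W(α₀+1)/W(α₀))^i·((1−2/M)^8)^{C(i,2)} ≤ W(α₀+i)`: inside the margins the line section lies ABOVE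
the discrete Gaussian of variance `≈ M/16` through `W(α₀), W(α₀+1)`.
[cite: SaumardWellner2014, §4 (arXiv p. 13)] -/
theorem lineW_envelope_le_add (a b d s x α₀ M i : ℕ) (hM : 2 ≤ M) (h0 : 0 < lineW a b d s x α₀)
    (hmar : ∀ l, l + 2 ≤ i → α₀ + l + M ≤ a ∧ M ≤ α₀ + l + 2 ∧ 2 * (α₀ + l) + M + 1 ≤ x ∧
      x + M ≤ 2 * (α₀ + l) + b + 3 ∧ x + M ≤ s + (α₀ + l) + 2 ∧ s + (α₀ + l) + M ≤ x + d) :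
    (lineW a b d s x α₀ : ℝ) * ((lineW a b d s x (α₀ + 1) : ℝ) / lineW a b d s x α₀) ^ i *
        ((1 - 2 / (M : ℝ)) ^ 8) ^ (i.choose 2) ≤ lineW a b d s x (α₀ + i) := by
  have hM' : (2 : ℝ) ≤ M := by exact_mod_cast hM
  have hp : (0 : ℝ) ≤ (1 - 2 / (M : ℝ)) ^ 8 := by
    apply pow_nonneg
    have : 2 / (M : ℝ) ≤ 1 := by rw [div_le_one (by linarith)]; exact hM'
    linarith
  have t := envelope_le_of_reverseLogConcave (fun l => (lineW a b d s x (α₀ + l) : ℝ))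
    ((1 - 2 / (M : ℝ)) ^ 8) i hp (fun l => by positivity) (by simpa using h0)
    (fun l _ hl => by
      have hl' : lineW a b d s x (α₀ + l) = 0 := by exact_mod_cast hl
      simpa [Nat.add_assoc] using lineW_add_succ_eq_zero h0 hl')
    (fun l hl => by
      obtain ⟨m1, m2, m3, m4, m5, m6⟩ := hmar l hl
      have := lineW_sq_mul_le_real a b d s x (α₀ + l) M hM m1 m2 m3 m4 m5 m6
      simpa [Nat.add_assoc] using this)
    i le_rfl
  simpa using t

/-- **Lower envelope to the left of an anchor.** For `i ≤ α₀`, `W(α₀) > 0` and the six margins `≥ M ≥ 2` at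
every `α₀ − l − 2`, `l + 2 ≤ i`: `W(α₀)·(W(α₀−1)/W(α₀))^i·((1−2/M)^8)^{C(i,2)} ≤ W(α₀−i)`.
[cite: SaumardWellner2014, §4 (arXiv p. 13)] -/
theorem lineW_envelope_le_sub (a b d s x α₀ M i : ℕ) (hM : 2 ≤ M) (h0 : 0 < lineW a b d s x α₀)
    (hi : i ≤ α₀)
    (hmar : ∀ l, l + 2 ≤ i → α₀ - (l + 2) + M ≤ a ∧ M ≤ α₀ - (l + 2) + 2 ∧
      2 * (α₀ - (l + 2)) + M + 1 ≤ x ∧ x + M ≤ 2 * (α₀ - (l + 2)) + b + 3 ∧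
      x + M ≤ s + (α₀ - (l + 2)) + 2 ∧ s + (α₀ - (l + 2)) + M ≤ x + d) :
    (lineW a b d s x α₀ : ℝ) * ((lineW a b d s x (α₀ - 1) : ℝ) / lineW a b d s x α₀) ^ i *
        ((1 - 2 / (M : ℝ)) ^ 8) ^ (i.choose 2) ≤ lineW a b d s x (α₀ - i) := by
  have hM' : (2 : ℝ) ≤ M := by exact_mod_cast hM
  have hp : (0 : ℝ) ≤ (1 - 2 / (M : ℝ)) ^ 8 := by
    apply pow_nonneg
    have : 2 / (M : ℝ) ≤ 1 := by rw [div_le_one (by linarith)]; exact hM'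
    linarith
  have t := envelope_le_of_reverseLogConcave (fun l => (lineW a b d s x (α₀ - l) : ℝ))
    ((1 - 2 / (M : ℝ)) ^ 8) i hp (fun l => by positivity) (by simpa using h0)
    (fun l hl hz => by
      have hz' : lineW a b d s x (α₀ - l) = 0 := by exact_mod_cast hz
      exact_mod_cast lineW_sub_succ_eq_zero h0 (by omega) hz')
    (fun l hl => by
      obtain ⟨m1, m2, m3, m4, m5, m6⟩ := hmar l hl
      have := lineW_sq_mul_le_real a b d s x (α₀ - (l + 2)) M hM m1 m2 m3 m4 m5 m6
      have e1 : α₀ - (l + 2) + 1 = α₀ - (l + 1) := by omega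
      have e2 : α₀ - (l + 2) + 2 = α₀ - l := by omega
      rw [e1, e2] at this
      simpa [mul_comm] using this)
    i le_rfl
  simpa using t

/-- **A maximiser exists** and can be taken `≤ a` (the weight vanishes for `α > a`).
[cite: ChattamvelliShanmugam2020, §7.4 (PDF p. 144)] -/
theorem exists_lineW_max (a b d s x : ℕ) :
    ∃ αs, αs ≤ a ∧ ∀ α, lineW a b d s x α ≤ lineW a b d s x αs := by
  obtain ⟨αs, hmem, hmax⟩ := Finset.exists_max_image (Finset.range (a + 1)) (lineW a b d s x)
    ⟨0, by simp⟩
  refine ⟨αs, by simpa [Nat.lt_succ_iff] using hmem, fun α => ?_⟩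
  rcases Nat.lt_or_ge a α with h | h
  · rw [lineW_eq_zero_of_lt_alpha h]; exact Nat.zero_le _
  · exact hmax α (by simpa [Nat.lt_succ_iff] using h)

/-- **At a maximiser the ratio numerator is at most the denominator**: if `W(α) ≤ W(α*)` for all `α` and
`W(α*) > 0` then `N(α*) ≤ D(α*)` (`W(α*+1)·D(α*) = W(α*)·N(α*) ≤ W(α*)·D(α*)`). No log-concavity is used.
[cite: ChattamvelliShanmugam2020, §7.4 Table 7.1 (PDF p. 143), the mode of a hypergeometric-type law from
its ratio] -/
theorem numer_le_denom_of_max {a b d s x αs : ℕ} (hmax : ∀ α, lineW a b d s x α ≤ lineW a b d s x αs)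
    (hpos : 0 < lineW a b d s x αs) :
    (a - αs) * ((x - 2 * αs) * (x - 2 * αs - 1)) * (d - (s + αs - x)) ≤
      (αs + 1) * ((b + 2 - (x - 2 * αs)) * (b + 1 - (x - 2 * αs))) * (s + αs + 1 - x) := by
  have id := lineW_succ_mul' a b d s x αs
  refine Nat.le_of_mul_le_mul_left ?_ hpos
  rw [← id]
  exact Nat.mul_le_mul_right _ (hmax _)

/-- **Just left of a maximiser the denominator is at most the numerator**: if `W(α) ≤ W(β+1)` for all `α`
and `W(β+1) > 0` then `D(β) ≤ N(β)`. [cite: ChattamvelliShanmugam2020, §7.4 Table 7.1 (PDF p. 143)] -/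
theorem denom_le_numer_of_max_succ {a b d s x β : ℕ}
    (hmax : ∀ α, lineW a b d s x α ≤ lineW a b d s x (β + 1)) (hpos : 0 < lineW a b d s x (β + 1)) :
    (β + 1) * ((b + 2 - (x - 2 * β)) * (b + 1 - (x - 2 * β))) * (s + β + 1 - x) ≤
      (a - β) * ((x - 2 * β) * (x - 2 * β - 1)) * (d - (s + β - x)) := by
  have id := lineW_succ_mul' a b d s x β
  refine Nat.le_of_mul_le_mul_left ?_ hpos
  rw [id]
  exact Nat.mul_le_mul_right _ (hmax _)

/-- The ratio numerator `N(α) = (a−α)·j(j−1)·(d−m)` is ANTITONE in `α`.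
[cite: ChattamvelliShanmugam2020, §7.4 Table 7.1 (PDF p. 143)] -/
theorem numer_antitone {a d s x α α' : ℕ} (h : α ≤ α') :
    (a - α') * ((x - 2 * α') * (x - 2 * α' - 1)) * (d - (s + α' - x)) ≤
      (a - α) * ((x - 2 * α) * (x - 2 * α - 1)) * (d - (s + α - x)) :=
  Nat.mul_le_mul (Nat.mul_le_mul (by omega) (Nat.mul_le_mul (by omega) (by omega))) (by omega)

/-- The ratio denominator `D(α) = (α+1)(b+2−j)(b+1−j)(s+α+1−x)` is MONOTONE in `α`.
[cite: ChattamvelliShanmugam2020, §7.4 Table 7.1 (PDF p. 143)] -/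
theorem denom_monotone {b s x α α' : ℕ} (h : α ≤ α') :
    (α + 1) * ((b + 2 - (x - 2 * α)) * (b + 1 - (x - 2 * α))) * (s + α + 1 - x) ≤
      (α' + 1) * ((b + 2 - (x - 2 * α')) * (b + 1 - (x - 2 * α'))) * (s + α' + 1 - x) :=
  Nat.mul_le_mul (Nat.mul_le_mul (by omega) (Nat.mul_le_mul (by omega) (by omega))) (by omega)

/-- **Mode bracketing from below**: if `D(lo) < N(lo)` then every positive maximiser is `> lo`.
[cite: ChattamvelliShanmugam2020, §7.4 Table 7.1 (PDF p. 143)] -/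
theorem lt_max_of_denom_lt_numer {a b d s x αs lo : ℕ}
    (hmax : ∀ α, lineW a b d s x α ≤ lineW a b d s x αs) (hpos : 0 < lineW a b d s x αs)
    (hlo : (lo + 1) * ((b + 2 - (x - 2 * lo)) * (b + 1 - (x - 2 * lo))) * (s + lo + 1 - x) <
      (a - lo) * ((x - 2 * lo) * (x - 2 * lo - 1)) * (d - (s + lo - x))) :
    lo < αs := by
  by_contra h
  have h' : αs ≤ lo := by omega
  have t := numer_le_denom_of_max hmax hpos
  have u := numer_antitone (a := a) (d := d) (s := s) (x := x) h'
  have v := denom_monotone (b := b) (s := s) (x := x) h'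
  omega

/-- **Mode bracketing from above**: if `N(hi) < D(hi)` then every positive maximiser is `≤ hi`. Together
with `lt_max_of_denom_lt_numer`: the maximisers are pinned by the sign change of `N − D`.
[cite: ChattamvelliShanmugam2020, §7.4 Table 7.1 (PDF p. 143)] -/
theorem max_le_of_numer_lt_denom {a b d s x αs hi : ℕ}
    (hmax : ∀ α, lineW a b d s x α ≤ lineW a b d s x αs) (hpos : 0 < lineW a b d s x αs)
    (hhi : (a - hi) * ((x - 2 * hi) * (x - 2 * hi - 1)) * (d - (s + hi - x)) <
      (hi + 1) * ((b + 2 - (x - 2 * hi)) * (b + 1 - (x - 2 * hi))) * (s + hi + 1 - x)) :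
    αs ≤ hi := by
  by_contra h
  obtain ⟨β, rfl⟩ : ∃ β, αs = β + 1 := ⟨αs - 1, by omega⟩
  have h' : hi ≤ β := by omega
  have t := denom_le_numer_of_max_succ hmax hpos
  have u := numer_antitone (a := a) (d := d) (s := s) (x := x) h'
  have v := denom_monotone (b := b) (s := s) (x := x) h'
  omega

/-- **Sub-Gaussian decay away from a maximiser** (right): `W(α*+i) ≤ ((1−1/Y)^{12})^{C(i,2)}·W(α*)`.
[cite: SaumardWellner2014, Definition 2.8 (arXiv p. 5), §4 (arXiv p. 13)] -/
theorem lineW_max_add_le (a b d s x αs Y : ℕ) (ha : a + 2 ≤ Y) (hb : b + 4 ≤ Y) (hd : d + 2 ≤ Y)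
    (hmax : ∀ α, lineW a b d s x α ≤ lineW a b d s x αs) (hpos : 0 < lineW a b d s x αs) (i : ℕ) :
    (lineW a b d s x (αs + i) : ℝ) ≤ ((1 - 1 / (Y : ℝ)) ^ 12) ^ (i.choose 2) * lineW a b d s x αs := by
  have t := lineW_add_le_envelope a b d s x αs Y ha hb hd hpos i
  have hW : (0 : ℝ) < lineW a b d s x αs := by exact_mod_cast hpos
  have hr : (lineW a b d s x (αs + 1) : ℝ) / lineW a b d s x αs ≤ 1 := by
    rw [div_le_one hW]; exact_mod_cast hmax _
  have hr0 : (0 : ℝ) ≤ (lineW a b d s x (αs + 1) : ℝ) / lineW a b d s x αs := by positivity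
  have hY : (1 : ℝ) ≤ Y := by exact_mod_cast (show 1 ≤ Y by omega)
  have hq : (0 : ℝ) ≤ (1 - 1 / (Y : ℝ)) ^ 12 := by
    apply pow_nonneg
    have : 1 / (Y : ℝ) ≤ 1 := by rw [div_le_one (by linarith)]; exact hY
    linarith
  calc (lineW a b d s x (αs + i) : ℝ)
      ≤ lineW a b d s x αs * ((lineW a b d s x (αs + 1) : ℝ) / lineW a b d s x αs) ^ i *
          ((1 - 1 / (Y : ℝ)) ^ 12) ^ (i.choose 2) := t
    _ ≤ lineW a b d s x αs * 1 ^ i * ((1 - 1 / (Y : ℝ)) ^ 12) ^ (i.choose 2) := by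
        gcongr
    _ = ((1 - 1 / (Y : ℝ)) ^ 12) ^ (i.choose 2) * lineW a b d s x αs := by ring

/-- **Sub-Gaussian decay away from a maximiser** (left): `W(α*−i) ≤ ((1−1/Y)^{12})^{C(i,2)}·W(α*)` for
`i ≤ α*`. [cite: SaumardWellner2014, Definition 2.8 (arXiv p. 5), §4 (arXiv p. 13)] -/
theorem lineW_max_sub_le (a b d s x αs Y : ℕ) (ha : a + 2 ≤ Y) (hb : b + 4 ≤ Y) (hd : d + 2 ≤ Y)
    (hmax : ∀ α, lineW a b d s x α ≤ lineW a b d s x αs) (hpos : 0 < lineW a b d s x αs) {i : ℕ}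
    (hi : i ≤ αs) :
    (lineW a b d s x (αs - i) : ℝ) ≤ ((1 - 1 / (Y : ℝ)) ^ 12) ^ (i.choose 2) * lineW a b d s x αs := by
  have t := lineW_sub_le_envelope a b d s x αs Y ha hb hd hpos hi
  have hW : (0 : ℝ) < lineW a b d s x αs := by exact_mod_cast hpos
  have hr : (lineW a b d s x (αs - 1) : ℝ) / lineW a b d s x αs ≤ 1 := by
    rw [div_le_one hW]; exact_mod_cast hmax _
  have hr0 : (0 : ℝ) ≤ (lineW a b d s x (αs - 1) : ℝ) / lineW a b d s x αs := by positivity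
  have hY : (1 : ℝ) ≤ Y := by exact_mod_cast (show 1 ≤ Y by omega)
  have hq : (0 : ℝ) ≤ (1 - 1 / (Y : ℝ)) ^ 12 := by
    apply pow_nonneg
    have : 1 / (Y : ℝ) ≤ 1 := by rw [div_le_one (by linarith)]; exact hY
    linarith
  calc (lineW a b d s x (αs - i) : ℝ)
      ≤ lineW a b d s x αs * ((lineW a b d s x (αs - 1) : ℝ) / lineW a b d s x αs) ^ i *
          ((1 - 1 / (Y : ℝ)) ^ 12) ^ (i.choose 2) := t
    _ ≤ lineW a b d s x αs * 1 ^ i * ((1 - 1 / (Y : ℝ)) ^ 12) ^ (i.choose 2) := by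
        gcongr
    _ = ((1 - 1 / (Y : ℝ)) ^ 12) ^ (i.choose 2) * lineW a b d s x αs := by ring

/-- **The discrete-Gaussian floor to the right of a maximiser.** If `W(α) ≤ W(β+1)` for all `α` (a
maximiser written `β + 1`), `W(β) > 0`, and the six margins are `≥ M ≥ 2` at every `β + l`, `l + 1 ≤ i`,
then `((1−2/M)^8)^{C(i+1,2)} · W(β+1) ≤ W(β+1+i)`: within `i` steps of the mode the line section is at
least `e^{−8 i(i+1)/(M−2)}` (as `(1−2/M) ≥ e^{−2/(M−2)}`) times its maximum. Mechanism: the lower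
envelope from the anchor `β`, whose first ratio `W(β+1)/W(β)` is `≥ 1`.
[cite: SaumardWellner2014, §4 (arXiv p. 13)] -/
theorem lineW_max_mul_pow_le_add (a b d s x β M i : ℕ) (hM : 2 ≤ M)
    (hmax : ∀ α, lineW a b d s x α ≤ lineW a b d s x (β + 1)) (hβ : 0 < lineW a b d s x β)
    (hmar : ∀ l, l + 1 ≤ i → β + l + M ≤ a ∧ M ≤ β + l + 2 ∧ 2 * (β + l) + M + 1 ≤ x ∧
      x + M ≤ 2 * (β + l) + b + 3 ∧ x + M ≤ s + (β + l) + 2 ∧ s + (β + l) + M ≤ x + d) :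
    ((1 - 2 / (M : ℝ)) ^ 8) ^ ((i + 1).choose 2) * lineW a b d s x (β + 1) ≤
      lineW a b d s x (β + 1 + i) := by
  have t := lineW_envelope_le_add a b d s x β M (i + 1) hM hβ (fun l hl => hmar l (by omega))
  have hW : (0 : ℝ) < lineW a b d s x β := by exact_mod_cast hβ
  have hr : (1 : ℝ) ≤ (lineW a b d s x (β + 1) : ℝ) / lineW a b d s x β := by
    rw [le_div_iff₀ hW, one_mul]; exact_mod_cast hmax _
  have hM' : (2 : ℝ) ≤ M := by exact_mod_cast hM
  have hp : (0 : ℝ) ≤ (1 - 2 / (M : ℝ)) ^ 8 := by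
    apply pow_nonneg
    have : 2 / (M : ℝ) ≤ 1 := by rw [div_le_one (by linarith)]; exact hM'
    linarith
  have e : β + (i + 1) = β + 1 + i := by ring
  rw [e] at t
  calc ((1 - 2 / (M : ℝ)) ^ 8) ^ ((i + 1).choose 2) * lineW a b d s x (β + 1)
      = lineW a b d s x β * ((lineW a b d s x (β + 1) : ℝ) / lineW a b d s x β) * 1 ^ i *
          ((1 - 2 / (M : ℝ)) ^ 8) ^ ((i + 1).choose 2) := by
        rw [one_pow, mul_one]; field_simp
    _ ≤ lineW a b d s x β * ((lineW a b d s x (β + 1) : ℝ) / lineW a b d s x β) *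
          (((lineW a b d s x (β + 1) : ℝ) / lineW a b d s x β) ^ i) *
          ((1 - 2 / (M : ℝ)) ^ 8) ^ ((i + 1).choose 2) := by
        gcongr
    _ = lineW a b d s x β * ((lineW a b d s x (β + 1) : ℝ) / lineW a b d s x β) ^ (i + 1) *
          ((1 - 2 / (M : ℝ)) ^ 8) ^ ((i + 1).choose 2) := by ring
    _ ≤ lineW a b d s x (β + 1 + i) := t

/-- **The discrete-Gaussian floor to the left of a maximiser.** If `W(α) ≤ W(αs)` for all `α`,
`W(αs+1) > 0`, `i ≤ αs`, and the six margins are `≥ M ≥ 2` at every `αs − 1 − l`, `l + 1 ≤ i`, then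
`((1−2/M)^8)^{C(i+1,2)} · W(αs) ≤ W(αs − i)` (the lower envelope from the anchor `αs + 1` read leftwards).
[cite: SaumardWellner2014, §4 (arXiv p. 13)] -/
theorem lineW_max_mul_pow_le_sub (a b d s x αs M i : ℕ) (hM : 2 ≤ M) (hi : i ≤ αs)
    (hmax : ∀ α, lineW a b d s x α ≤ lineW a b d s x αs) (hαs : 0 < lineW a b d s x (αs + 1))
    (hmar : ∀ l, l + 1 ≤ i → αs - (l + 1) + M ≤ a ∧ M ≤ αs - (l + 1) + 2 ∧
      2 * (αs - (l + 1)) + M + 1 ≤ x ∧ x + M ≤ 2 * (αs - (l + 1)) + b + 3 ∧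
      x + M ≤ s + (αs - (l + 1)) + 2 ∧ s + (αs - (l + 1)) + M ≤ x + d) :
    ((1 - 2 / (M : ℝ)) ^ 8) ^ ((i + 1).choose 2) * lineW a b d s x αs ≤
      lineW a b d s x (αs - i) := by
  have t := lineW_envelope_le_sub a b d s x (αs + 1) M (i + 1) hM hαs (by omega)
    (fun l hl => by
      have e : αs + 1 - (l + 2) = αs - (l + 1) := by omega
      rw [e]; exact hmar l (by omega))
  have hW : (0 : ℝ) < lineW a b d s x (αs + 1) := by exact_mod_cast hαs
  have hr : (1 : ℝ) ≤ (lineW a b d s x αs : ℝ) / lineW a b d s x (αs + 1) := by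
    rw [le_div_iff₀ hW, one_mul]; exact_mod_cast hmax _
  have hM' : (2 : ℝ) ≤ M := by exact_mod_cast hM
  have hp : (0 : ℝ) ≤ (1 - 2 / (M : ℝ)) ^ 8 := by
    apply pow_nonneg
    have : 2 / (M : ℝ) ≤ 1 := by rw [div_le_one (by linarith)]; exact hM'
    linarith
  have e1 : αs + 1 - 1 = αs := by omega
  have e2 : αs + 1 - (i + 1) = αs - i := by omega
  rw [e1, e2] at t
  calc ((1 - 2 / (M : ℝ)) ^ 8) ^ ((i + 1).choose 2) * lineW a b d s x αs
      = lineW a b d s x (αs + 1) * ((lineW a b d s x αs : ℝ) / lineW a b d s x (αs + 1)) * 1 ^ i *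
          ((1 - 2 / (M : ℝ)) ^ 8) ^ ((i + 1).choose 2) := by
        rw [one_pow, mul_one]; field_simp
    _ ≤ lineW a b d s x (αs + 1) * ((lineW a b d s x αs : ℝ) / lineW a b d s x (αs + 1)) *
          (((lineW a b d s x αs : ℝ) / lineW a b d s x (αs + 1)) ^ i) *
          ((1 - 2 / (M : ℝ)) ^ 8) ^ ((i + 1).choose 2) := by
        gcongr
    _ = lineW a b d s x (αs + 1) * ((lineW a b d s x αs : ℝ) / lineW a b d s x (αs + 1)) ^ (i + 1) *
          ((1 - 2 / (M : ℝ)) ^ 8) ^ ((i + 1).choose 2) := by ring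
    _ ≤ lineW a b d s x (αs - i) := t

/-- **Tail mass past `L` steps right of a maximiser**: `Σ_{α ≥ α*+L} W(α) ≤ (a+1)·((1−1/Y)^{12})^{C(L,2)}·W(α*)`
(at most `a + 1` nonzero terms, each under the envelope; the envelope exponent `C(i,2)` is monotone in `i`).
[cite: SaumardWellner2014, Definition 2.8 (arXiv p. 5), §4 (arXiv p. 13)] -/
theorem sum_lineW_ge_max_add_le (a b d s x αs Y L : ℕ) (ha : a + 2 ≤ Y) (hb : b + 4 ≤ Y) (hd : d + 2 ≤ Y)
    (hmax : ∀ α, lineW a b d s x α ≤ lineW a b d s x αs) (hpos : 0 < lineW a b d s x αs) :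
    ∑ α ∈ (Finset.range (a + 1)).filter (fun α => αs + L ≤ α), (lineW a b d s x α : ℝ) ≤
      (a + 1) * (((1 - 1 / (Y : ℝ)) ^ 12) ^ (L.choose 2) * lineW a b d s x αs) := by
  have hY : (1 : ℝ) ≤ Y := by exact_mod_cast (show 1 ≤ Y by omega)
  have hq : (0 : ℝ) ≤ (1 - 1 / (Y : ℝ)) ^ 12 := by
    apply pow_nonneg
    have : 1 / (Y : ℝ) ≤ 1 := by rw [div_le_one (by linarith)]; exact hY
    linarith
  have hq1 : (1 - 1 / (Y : ℝ)) ^ 12 ≤ 1 := by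
    apply pow_le_one₀ _ _
    · have : 1 / (Y : ℝ) ≤ 1 := by rw [div_le_one (by linarith)]; exact hY
      linarith
    · have : 0 ≤ 1 / (Y : ℝ) := by positivity
      linarith
  have hW : (0 : ℝ) ≤ lineW a b d s x αs := by positivity
  have each : ∀ α ∈ (Finset.range (a + 1)).filter (fun α => αs + L ≤ α),
      (lineW a b d s x α : ℝ) ≤ ((1 - 1 / (Y : ℝ)) ^ 12) ^ (L.choose 2) * lineW a b d s x αs := by
    intro α hα
    rw [Finset.mem_filter] at hα
    obtain ⟨i, rfl⟩ : ∃ i, α = αs + i := ⟨α - αs, by omega⟩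
    have hLi : L ≤ i := by omega
    calc (lineW a b d s x (αs + i) : ℝ) ≤ ((1 - 1 / (Y : ℝ)) ^ 12) ^ (i.choose 2) * lineW a b d s x αs :=
          lineW_max_add_le a b d s x αs Y ha hb hd hmax hpos i
      _ ≤ ((1 - 1 / (Y : ℝ)) ^ 12) ^ (L.choose 2) * lineW a b d s x αs := by
          apply mul_le_mul_of_nonneg_right _ hW
          exact pow_le_pow_of_le_one hq hq1 (Nat.choose_le_choose 2 hLi)
  calc ∑ α ∈ (Finset.range (a + 1)).filter (fun α => αs + L ≤ α), (lineW a b d s x α : ℝ)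
      ≤ ∑ α ∈ (Finset.range (a + 1)).filter (fun α => αs + L ≤ α),
          ((1 - 1 / (Y : ℝ)) ^ 12) ^ (L.choose 2) * lineW a b d s x αs := Finset.sum_le_sum each
    _ = ((Finset.range (a + 1)).filter (fun α => αs + L ≤ α)).card *
          (((1 - 1 / (Y : ℝ)) ^ 12) ^ (L.choose 2) * lineW a b d s x αs) := by
        rw [Finset.sum_const, nsmul_eq_mul]
    _ ≤ (a + 1) * (((1 - 1 / (Y : ℝ)) ^ 12) ^ (L.choose 2) * lineW a b d s x αs) := by
        apply mul_le_mul_of_nonneg_right _ (by positivity)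
        have hc : ((Finset.range (a + 1)).filter (fun α => αs + L ≤ α)).card ≤ a + 1 :=
          (Finset.card_filter_le _ _).trans (by simp)
        exact_mod_cast hc

/-- **Tail mass past `L` steps left of a maximiser**: `Σ_{α + L ≤ α*} W(α) ≤ (a+1)·((1−1/Y)^{12})^{C(L,2)}·W(α*)`.
[cite: SaumardWellner2014, Definition 2.8 (arXiv p. 5), §4 (arXiv p. 13)] -/
theorem sum_lineW_le_max_sub_le (a b d s x αs Y L : ℕ) (ha : a + 2 ≤ Y) (hb : b + 4 ≤ Y) (hd : d + 2 ≤ Y)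
    (hmax : ∀ α, lineW a b d s x α ≤ lineW a b d s x αs) (hpos : 0 < lineW a b d s x αs) :
    ∑ α ∈ (Finset.range (a + 1)).filter (fun α => α + L ≤ αs), (lineW a b d s x α : ℝ) ≤
      (a + 1) * (((1 - 1 / (Y : ℝ)) ^ 12) ^ (L.choose 2) * lineW a b d s x αs) := by
  have hY : (1 : ℝ) ≤ Y := by exact_mod_cast (show 1 ≤ Y by omega)
  have hq : (0 : ℝ) ≤ (1 - 1 / (Y : ℝ)) ^ 12 := by
    apply pow_nonneg
    have : 1 / (Y : ℝ) ≤ 1 := by rw [div_le_one (by linarith)]; exact hY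
    linarith
  have hq1 : (1 - 1 / (Y : ℝ)) ^ 12 ≤ 1 := by
    apply pow_le_one₀ _ _
    · have : 1 / (Y : ℝ) ≤ 1 := by rw [div_le_one (by linarith)]; exact hY
      linarith
    · have : 0 ≤ 1 / (Y : ℝ) := by positivity
      linarith
  have hW : (0 : ℝ) ≤ lineW a b d s x αs := by positivity
  have each : ∀ α ∈ (Finset.range (a + 1)).filter (fun α => α + L ≤ αs),
      (lineW a b d s x α : ℝ) ≤ ((1 - 1 / (Y : ℝ)) ^ 12) ^ (L.choose 2) * lineW a b d s x αs := by
    intro α hα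
    rw [Finset.mem_filter] at hα
    obtain ⟨i, hi, rfl⟩ : ∃ i, i ≤ αs ∧ α = αs - i := ⟨αs - α, by omega, by omega⟩
    have hLi : L ≤ i := by omega
    calc (lineW a b d s x (αs - i) : ℝ) ≤ ((1 - 1 / (Y : ℝ)) ^ 12) ^ (i.choose 2) * lineW a b d s x αs :=
          lineW_max_sub_le a b d s x αs Y ha hb hd hmax hpos hi
      _ ≤ ((1 - 1 / (Y : ℝ)) ^ 12) ^ (L.choose 2) * lineW a b d s x αs := by
          apply mul_le_mul_of_nonneg_right _ hW
          exact pow_le_pow_of_le_one hq hq1 (Nat.choose_le_choose 2 hLi)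
  calc ∑ α ∈ (Finset.range (a + 1)).filter (fun α => α + L ≤ αs), (lineW a b d s x α : ℝ)
      ≤ ∑ α ∈ (Finset.range (a + 1)).filter (fun α => α + L ≤ αs),
          ((1 - 1 / (Y : ℝ)) ^ 12) ^ (L.choose 2) * lineW a b d s x αs := Finset.sum_le_sum each
    _ = ((Finset.range (a + 1)).filter (fun α => α + L ≤ αs)).card *
          (((1 - 1 / (Y : ℝ)) ^ 12) ^ (L.choose 2) * lineW a b d s x αs) := by
        rw [Finset.sum_const, nsmul_eq_mul]
    _ ≤ (a + 1) * (((1 - 1 / (Y : ℝ)) ^ 12) ^ (L.choose 2) * lineW a b d s x αs) := by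
        apply mul_le_mul_of_nonneg_right _ (by positivity)
        have hc : ((Finset.range (a + 1)).filter (fun α => α + L ≤ αs)).card ≤ a + 1 :=
          (Finset.card_filter_le _ _).trans (by simp)
        exact_mod_cast hc

/-! ### §7 (v2) Neighbouring parameters are affine tilts; pinning identities; factorial moments

Moving one parameter by one multiplies the weight of `α` by ONE affine-fractional factor (the hypergeometric
recurrence in that coordinate): `a ↦ a+1` by `(a+1)/(a+1−α)`, `b ↦ b+1` by `(b+1)/(b+1−j)`, `d ↦ d+1` by
`(d+1)/(d+1−m)`, `x ↦ x+1` by `(b−j)m/((j+1)(d−m+1))`; and PINNING one item of a kind (the line-section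
shadow of the cell's full-edge pinning `ShellLawPinning`): `W_{a+1,s+1,x+2}(α+1)·(α+1) = W_{a,s,x}(α)·(a+1)`
(kind `A`), `W_{b+1,s+1,x+1}(α)·(x+1−2α) = W(α)·(b+1)` (kind `B`), `W_{d+1,s+1,x}(α)·(s+1+α−x) = W(α)·(d+1)`
(kind `D`). Summing the pins: the factorial moments of `α`, `j`, `m` under the line section are shifted line
sums — e.g. `Σ_α α·W_{a+1,b,d,s+1,x+2}(α) = (a+1)·Σ_α W_{a,b,d,s,x}(α)`, the conditional-mean identity
`E[n_A·1{X = x}] = a·(s/N)·law'(x−2)` of the cell (prover MEMO-28 §3) at the level of line sections. -/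

/-- `a`-shift: `W_{a+1}(α)·(a+1−α) = W_a(α)·(a+1)`. [cite: ChattamvelliShanmugam2020, §7.4 Table 7.1 (PDF p. 143)] -/
theorem lineW_succ_a_mul (a b d s x α : ℕ) :
    lineW (a + 1) b d s x α * (a + 1 - α) = lineW a b d s x α * (a + 1) := by
  by_cases h : 2 * α ≤ x ∧ x ≤ s + α
  · rw [lineW_of_le h.1 h.2, lineW_of_le h.1 h.2]
    have k := Nat.choose_mul_succ_eq a α   -- C(a,α)(a+1) = C(a+1,α)(a+1−α)
    calc (a + 1).choose α * b.choose (x - 2 * α) * d.choose (s + α - x) * (a + 1 - α)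
        = ((a + 1).choose α * (a + 1 - α)) * (b.choose (x - 2 * α) * d.choose (s + α - x)) := by ring
      _ = (a.choose α * (a + 1)) * (b.choose (x - 2 * α) * d.choose (s + α - x)) := by rw [k]
      _ = a.choose α * b.choose (x - 2 * α) * d.choose (s + α - x) * (a + 1) := by ring
  · simp [lineW, h]

/-- `b`-shift: `W_{b+1}(α)·(b+1−j) = W_b(α)·(b+1)`, `j = x − 2α`.
[cite: ChattamvelliShanmugam2020, §7.4 Table 7.1 (PDF p. 143)] -/
theorem lineW_succ_b_mul (a b d s x α : ℕ) :
    lineW a (b + 1) d s x α * (b + 1 - (x - 2 * α)) = lineW a b d s x α * (b + 1) := by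
  by_cases h : 2 * α ≤ x ∧ x ≤ s + α
  · rw [lineW_of_le h.1 h.2, lineW_of_le h.1 h.2]
    have k := Nat.choose_mul_succ_eq b (x - 2 * α)
    calc a.choose α * (b + 1).choose (x - 2 * α) * d.choose (s + α - x) * (b + 1 - (x - 2 * α))
        = ((b + 1).choose (x - 2 * α) * (b + 1 - (x - 2 * α))) * (a.choose α * d.choose (s + α - x)) := by
          ring
      _ = (b.choose (x - 2 * α) * (b + 1)) * (a.choose α * d.choose (s + α - x)) := by rw [k]
      _ = a.choose α * b.choose (x - 2 * α) * d.choose (s + α - x) * (b + 1) := by ring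
  · simp [lineW, h]

/-- `d`-shift: `W_{d+1}(α)·(d+1−m) = W_d(α)·(d+1)`, `m = s + α − x`.
[cite: ChattamvelliShanmugam2020, §7.4 Table 7.1 (PDF p. 143)] -/
theorem lineW_succ_d_mul (a b d s x α : ℕ) :
    lineW a b (d + 1) s x α * (d + 1 - (s + α - x)) = lineW a b d s x α * (d + 1) := by
  by_cases h : 2 * α ≤ x ∧ x ≤ s + α
  · rw [lineW_of_le h.1 h.2, lineW_of_le h.1 h.2]
    have k := Nat.choose_mul_succ_eq d (s + α - x)
    calc a.choose α * b.choose (x - 2 * α) * (d + 1).choose (s + α - x) * (d + 1 - (s + α - x))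
        = ((d + 1).choose (s + α - x) * (d + 1 - (s + α - x))) * (a.choose α * b.choose (x - 2 * α)) := by
          ring
      _ = (d.choose (s + α - x) * (d + 1)) * (a.choose α * b.choose (x - 2 * α)) := by rw [k]
      _ = a.choose α * b.choose (x - 2 * α) * d.choose (s + α - x) * (d + 1) := by ring
  · simp [lineW, h]

/-- **`x`-step**: `W_{x+1}(α)·((j+1)(d−m+1)) = W_x(α)·((b−j)·m)` with `j = x − 2α`, `m = s + α − x` — the score
up by one trades a kind-`D` item for a kind-`B` item. [cite: ChattamvelliShanmugam2020, §7.4 Table 7.1 (PDF p. 143)] -/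
theorem lineW_succ_x_mul (a b d s x α : ℕ) :
    lineW a b d s (x + 1) α * ((x + 1 - 2 * α) * (d + 1 - (s + α - x))) =
      lineW a b d s x α * ((b - (x - 2 * α)) * (s + α - x)) := by
  rcases Nat.lt_or_ge x (2 * α) with h1 | h1
  · rw [lineW_eq_zero_of_lt h1]
    rcases Nat.lt_or_ge (x + 1) (2 * α) with h | h
    · rw [lineW_eq_zero_of_lt h]; simp
    · have e : x + 1 - 2 * α = 0 := by omega
      rw [e]; simp
  rcases Nat.lt_or_ge (s + α) (x + 1) with h2 | h2
  · rw [lineW_eq_zero_of_lt' h2]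
    rcases Nat.lt_or_ge (s + α) x with h | h
    · rw [lineW_eq_zero_of_lt' h]; simp
    · have e : s + α - x = 0 := by omega
      rw [e]; simp
  · -- main case `2α ≤ x`, `x + 1 ≤ s + α`
    rw [lineW_of_le (by omega) h2, lineW_of_le h1 (by omega)]
    set j := x - 2 * α with hj
    obtain ⟨m', hm'⟩ : ∃ m', s + α - x = m' + 1 := ⟨s + α - x - 1, by omega⟩
    have ej : x + 1 - 2 * α = j + 1 := by omega
    have em : s + α - (x + 1) = m' := by omega
    have ed : d + 1 - (m' + 1) = d - m' := by omega
    rw [ej, em, hm', ed]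
    have kB := Nat.choose_succ_right_eq b j      -- C(b,j+1)(j+1) = C(b,j)(b−j)
    have kD := Nat.choose_succ_right_eq d m'     -- C(d,m'+1)(m'+1) = C(d,m')(d−m')
    calc a.choose α * b.choose (j + 1) * d.choose m' * ((j + 1) * (d - m'))
        = a.choose α * (b.choose (j + 1) * (j + 1)) * (d.choose m' * (d - m')) := by ring
      _ = a.choose α * (b.choose j * (b - j)) * (d.choose (m' + 1) * (m' + 1)) := by rw [kB, kD]
      _ = a.choose α * b.choose j * d.choose (m' + 1) * ((b - j) * (m' + 1)) := by ring

/-- **Pinning a kind-`A` item**: `W_{a+1,b,d,s+1,x+2}(α+1)·(α+1) = W_{a,b,d,s,x}(α)·(a+1)` — among the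
`(s+1)`-subsets of `a+1+b+d` items with `α+1` of kind `A` and score `x+2`, those containing a FIXED kind-`A`
item are counted by `W_{a,b,d,s,x}(α)`; averaging over the `a+1` items gives the factor `(α+1)/(a+1)`.
[cite: ChattamvelliShanmugam2020, §7.4 Table 7.1 (PDF p. 143)] -/
theorem lineW_pinA_mul (a b d s x α : ℕ) :
    lineW (a + 1) b d (s + 1) (x + 2) (α + 1) * (α + 1) = lineW a b d s x α * (a + 1) := by
  by_cases h : 2 * α ≤ x ∧ x ≤ s + α
  · rw [lineW_of_le h.1 h.2, lineW_of_le (by omega : 2 * (α + 1) ≤ x + 2) (by omega)]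
    have k := Nat.add_one_mul_choose_eq a α      -- (a+1) C(a,α) = C(a+1,α+1)(α+1)
    have e1 : x + 2 - 2 * (α + 1) = x - 2 * α := by omega
    have e2 : s + 1 + (α + 1) - (x + 2) = s + α - x := by omega
    rw [e1, e2]
    calc (a + 1).choose (α + 1) * b.choose (x - 2 * α) * d.choose (s + α - x) * (α + 1)
        = ((a + 1).choose (α + 1) * (α + 1)) * (b.choose (x - 2 * α) * d.choose (s + α - x)) := by ring
      _ = ((a + 1) * a.choose α) * (b.choose (x - 2 * α) * d.choose (s + α - x)) := by rw [k]
      _ = a.choose α * b.choose (x - 2 * α) * d.choose (s + α - x) * (a + 1) := by ring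
  · have h' : ¬(2 * (α + 1) ≤ x + 2 ∧ x + 2 ≤ s + 1 + (α + 1)) := by omega
    simp [lineW, h, h']

/-- **Pinning a kind-`B` item**: `W_{a,b+1,d,s+1,x+1}(α)·(x+1−2α) = W_{a,b,d,s,x}(α)·(b+1)`.
[cite: ChattamvelliShanmugam2020, §7.4 Table 7.1 (PDF p. 143)] -/
theorem lineW_pinB_mul (a b d s x α : ℕ) :
    lineW a (b + 1) d (s + 1) (x + 1) α * (x + 1 - 2 * α) = lineW a b d s x α * (b + 1) := by
  rcases Nat.lt_or_ge x (2 * α) with h1 | h1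
  · rw [lineW_eq_zero_of_lt h1]
    rcases Nat.lt_or_ge (x + 1) (2 * α) with h | h
    · rw [lineW_eq_zero_of_lt h]; simp
    · have e : x + 1 - 2 * α = 0 := by omega
      rw [e]; simp
  by_cases h2 : x ≤ s + α
  · rw [lineW_of_le h1 h2, lineW_of_le (by omega : 2 * α ≤ x + 1) (by omega)]
    have k := Nat.add_one_mul_choose_eq b (x - 2 * α)   -- (b+1) C(b,j) = C(b+1,j+1)(j+1)
    have e1 : x + 1 - 2 * α = x - 2 * α + 1 := by omega
    have e2 : s + 1 + α - (x + 1) = s + α - x := by omega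
    rw [e1, e2]
    calc a.choose α * (b + 1).choose (x - 2 * α + 1) * d.choose (s + α - x) * (x - 2 * α + 1)
        = ((b + 1).choose (x - 2 * α + 1) * (x - 2 * α + 1)) * (a.choose α * d.choose (s + α - x)) := by
          ring
      _ = ((b + 1) * b.choose (x - 2 * α)) * (a.choose α * d.choose (s + α - x)) := by rw [k]
      _ = a.choose α * b.choose (x - 2 * α) * d.choose (s + α - x) * (b + 1) := by ring
  · rw [lineW_eq_zero_of_lt' (by omega : s + α < x), lineW_eq_zero_of_lt' (by omega : s + 1 + α < x + 1)]
    simp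

/-- **Pinning a kind-`D` item**: `W_{a,b,d+1,s+1,x}(α)·(s+1+α−x) = W_{a,b,d,s,x}(α)·(d+1)`.
[cite: ChattamvelliShanmugam2020, §7.4 Table 7.1 (PDF p. 143)] -/
theorem lineW_pinD_mul (a b d s x α : ℕ) :
    lineW a b (d + 1) (s + 1) x α * (s + 1 + α - x) = lineW a b d s x α * (d + 1) := by
  rcases Nat.lt_or_ge x (2 * α) with h1 | h1
  · rw [lineW_eq_zero_of_lt h1, lineW_eq_zero_of_lt h1]; simp
  rcases Nat.lt_or_ge (s + α) x with h2 | h2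
  · rw [lineW_eq_zero_of_lt' h2]
    rcases Nat.lt_or_ge (s + 1 + α) x with h | h
    · rw [lineW_eq_zero_of_lt' h]; simp
    · have e : s + 1 + α - x = 0 := by omega
      rw [e]; simp
  · rw [lineW_of_le h1 h2, lineW_of_le h1 (by omega : x ≤ s + 1 + α)]
    have k := Nat.add_one_mul_choose_eq d (s + α - x)   -- (d+1) C(d,m) = C(d+1,m+1)(m+1)
    have e : s + 1 + α - x = s + α - x + 1 := by omega
    rw [e]
    calc a.choose α * b.choose (x - 2 * α) * (d + 1).choose (s + α - x + 1) * (s + α - x + 1)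
        = ((d + 1).choose (s + α - x + 1) * (s + α - x + 1)) * (a.choose α * b.choose (x - 2 * α)) := by
          ring
      _ = ((d + 1) * d.choose (s + α - x)) * (a.choose α * b.choose (x - 2 * α)) := by rw [k]
      _ = a.choose α * b.choose (x - 2 * α) * d.choose (s + α - x) * (d + 1) := by ring

/-- The line sum over any range containing `[0, a]` equals the sum over `range (a+1)` (the weight vanishes
for `α > a`). [cite: ChattamvelliShanmugam2020, §7.4 (PDF p. 144)] -/
theorem sum_range_lineW_eq (a b d s x : ℕ) {K : ℕ} (hK : a + 1 ≤ K) :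
    ∑ α ∈ Finset.range K, lineW a b d s x α = ∑ α ∈ Finset.range (a + 1), lineW a b d s x α := by
  obtain ⟨k, rfl⟩ : ∃ k, K = a + 1 + k := ⟨K - (a + 1), by omega⟩
  rw [Finset.sum_range_add]
  have hz : ∑ α ∈ Finset.range k, lineW a b d s x (a + 1 + α) = 0 :=
    Finset.sum_eq_zero fun α _ => lineW_eq_zero_of_lt_alpha (by omega)
  rw [hz, add_zero]

/-- **First factorial moment of `α`** (summed kind-`A` pin): `Σ_α W_{a+1,b,d,s+1,x+2}(α)·α =
(a+1)·Σ_α W_{a,b,d,s,x}(α)`. [cite: ChattamvelliShanmugam2020, §7.4 Table 7.1 (PDF p. 143)] -/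
theorem sum_lineW_mul_alpha (a b d s x : ℕ) :
    ∑ α ∈ Finset.range (a + 2), lineW (a + 1) b d (s + 1) (x + 2) α * α =
      (a + 1) * ∑ α ∈ Finset.range (a + 1), lineW a b d s x α := by
  rw [Finset.sum_range_succ', mul_zero, add_zero, Finset.mul_sum]
  refine Finset.sum_congr rfl fun α _ => ?_
  rw [lineW_pinA_mul, mul_comm]

/-- **Second factorial moment of `α`** (two kind-`A` pins): `Σ_α W_{a+2,b,d,s+2,x+4}(α)·(α(α−1)) =
((a+2)(a+1))·Σ_α W_{a,b,d,s,x}(α)`. [cite: ChattamvelliShanmugam2020, §7.4 Table 7.1 (PDF p. 143)] -/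
theorem sum_lineW_mul_alpha_mul (a b d s x : ℕ) :
    ∑ α ∈ Finset.range (a + 3), lineW (a + 2) b d (s + 2) (x + 4) α * (α * (α - 1)) =
      ((a + 2) * (a + 1)) * ∑ α ∈ Finset.range (a + 1), lineW a b d s x α := by
  have step1 : ∑ α ∈ Finset.range (a + 3), lineW (a + 2) b d (s + 2) (x + 4) α * (α * (α - 1)) =
      (a + 2) * ∑ α ∈ Finset.range (a + 2), lineW (a + 1) b d (s + 1) (x + 2) α * α := by
    rw [Finset.sum_range_succ']
    simp only [zero_mul, mul_zero, add_zero]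
    rw [Finset.mul_sum]
    refine Finset.sum_congr rfl fun α _ => ?_
    have t := lineW_pinA_mul (a + 1) b d (s + 1) (x + 2) α
    have e : α + 1 - 1 = α := by omega
    rw [e]
    calc lineW (a + 1 + 1) b d (s + 1 + 1) (x + 2 + 2) (α + 1) * ((α + 1) * α)
        = (lineW (a + 1 + 1) b d (s + 1 + 1) (x + 2 + 2) (α + 1) * (α + 1)) * α := by ring
      _ = lineW (a + 1) b d (s + 1) (x + 2) α * (a + 1 + 1) * α := by rw [t]
      _ = (a + 2) * (lineW (a + 1) b d (s + 1) (x + 2) α * α) := by ring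
  rw [step1, sum_lineW_mul_alpha, ← mul_assoc]

/-- **First moment of `j = x − 2α`** (summed kind-`B` pin): `Σ_α W_{a,b+1,d,s+1,x+1}(α)·(x+1−2α) =
(b+1)·Σ_α W_{a,b,d,s,x}(α)`. [cite: ChattamvelliShanmugam2020, §7.4 Table 7.1 (PDF p. 143)] -/
theorem sum_lineW_mul_j (a b d s x : ℕ) :
    ∑ α ∈ Finset.range (a + 1), lineW a (b + 1) d (s + 1) (x + 1) α * (x + 1 - 2 * α) =
      (b + 1) * ∑ α ∈ Finset.range (a + 1), lineW a b d s x α := by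
  rw [Finset.mul_sum]
  refine Finset.sum_congr rfl fun α _ => ?_
  rw [lineW_pinB_mul, mul_comm]

/-- **First moment of `m = s + α − x`** (summed kind-`D` pin): `Σ_α W_{a,b,d+1,s+1,x}(α)·(s+1+α−x) =
(d+1)·Σ_α W_{a,b,d,s,x}(α)`. [cite: ChattamvelliShanmugam2020, §7.4 Table 7.1 (PDF p. 143)] -/
theorem sum_lineW_mul_m (a b d s x : ℕ) :
    ∑ α ∈ Finset.range (a + 1), lineW a b (d + 1) (s + 1) x α * (s + 1 + α - x) =
      (d + 1) * ∑ α ∈ Finset.range (a + 1), lineW a b d s x α := by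
  rw [Finset.mul_sum]
  refine Finset.sum_congr rfl fun α _ => ?_
  rw [lineW_pinD_mul, mul_comm]

/-- **Complementation symmetry**: the complement of an `s`-subset is an `(N−s)`-subset with `a − α` kind-`A`
items and score `2a + b − x`: `W_{a,b,d,s,x}(α) = W_{a,b,d,N−s,2a+b−x}(a−α)` for `α ≤ a`, `x ≤ 2a + b`,
`s ≤ N = a + b + d`. Statements to the left of an anchor follow from statements to the right.
[cite: ChattamvelliShanmugam2020, §7.4 (PDF p. 144)] -/
theorem lineW_compl {a b d s x α : ℕ} (hα : α ≤ a) (hx : x ≤ 2 * a + b) (hs : s ≤ a + b + d) :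
    lineW a b d s x α = lineW a b d (a + b + d - s) (2 * a + b - x) (a - α) := by
  by_cases h : 2 * α ≤ x ∧ x ≤ s + α ∧ x ≤ 2 * α + b ∧ s + α ≤ x + d
  · obtain ⟨h1, h2, h3, h4⟩ := h
    rw [lineW_of_le h1 h2, lineW_of_le (by omega : 2 * (a - α) ≤ 2 * a + b - x) (by omega)]
    have e1 : 2 * a + b - x - 2 * (a - α) = b - (x - 2 * α) := by omega
    have e2 : a + b + d - s + (a - α) - (2 * a + b - x) = d - (s + α - x) := by omega
    rw [e1, e2, Nat.choose_symm hα, Nat.choose_symm (by omega : x - 2 * α ≤ b),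
      Nat.choose_symm (by omega : s + α - x ≤ d)]
  · -- one side is off its line, the other has a vanishing binomial coefficient
    have hl : lineW a b d s x α = 0 := by
      rcases Nat.eq_zero_or_pos (lineW a b d s x α) with h0 | h0
      · exact h0
      · exact absurd (lineW_pos_iff.1 h0) (by omega)
    have hr : lineW a b d (a + b + d - s) (2 * a + b - x) (a - α) = 0 := by
      rcases Nat.eq_zero_or_pos (lineW a b d (a + b + d - s) (2 * a + b - x) (a - α)) with h0 | h0
      · exact h0
      · exact absurd (lineW_pos_iff.1 h0) (by omega)
    rw [hl, hr]

/-! ### §8 (v3) Unimodality and the ratio window around a maximiser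

The consecutive ratio `R(α) = W(α+1)/W(α)` along the line: it is `≥ 1` left of a maximiser and `≤ 1` right of it
(unimodality, from log-concavity alone), and inside the margins it stays within the factor `(1−2/M)^{-8(i+1)}`
of `1` at distance `i` from the maximiser — the analogue of `HypergeometricRatioWindow.abs_one_sub_hyperRatio_le`
(`|1 − λ(x)| ≤ 4(N+2)(L+1)/W` on `|x − μ| ≤ L`) for the line section, with the maximiser in place of the mean:
for `|α − α*| ≤ L`, `(1−2/M)^{8(L+1)} ≤ R(α) ≤ (1−2/M)^{−8(L+1)}`. Generic ratio-step lemmas first. -/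

/-- **Geometric decay of the consecutive ratio under `q`-strong log-concavity** (generic; the step behind
`le_envelope_of_strongLogConcave`): `f (i+1) ≤ q^i · (f 1/f 0) · f i` for `i + 1 ≤ n`.
[cite: SaumardWellner2014, §4 (arXiv p. 13)] -/
theorem succ_le_ratio_mul_of_strongLogConcave (f : ℕ → ℝ) (q : ℝ) (n : ℕ) (hq : 0 ≤ q) (hf : ∀ l, 0 ≤ f l)
    (h0 : 0 < f 0) (hsupp : ∀ l, l < n → f l = 0 → f (l + 1) = 0)
    (hlc : ∀ l, l + 2 ≤ n → f l * f (l + 2) ≤ q * f (l + 1) ^ 2) :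
    ∀ i, i + 1 ≤ n → f (i + 1) ≤ q ^ i * (f 1 / f 0) * f i := by
  have hr : 0 ≤ f 1 / f 0 := div_nonneg (hf 1) h0.le
  intro i
  induction i with
  | zero => intro _; simp [div_mul_cancel₀ _ h0.ne']
  | succ i ih =>
    intro hi
    have ih' := ih (by omega)
    rcases (hf (i + 1)).eq_or_lt with hz | hp
    · have e : f (i + 1 + 1) = 0 := hsupp (i + 1) (by omega) hz.symm
      rw [e]
      exact mul_nonneg (mul_nonneg (pow_nonneg hq _) hr) (hf _)
    · have hpi : 0 < f i := by
        rcases (hf i).eq_or_lt with hz' | hp'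
        · exact absurd (hsupp i (by omega) hz'.symm) hp.ne'
        · exact hp'
      have hq' := hlc i (by omega)
      have h1 : f (i + 1 + 1) ≤ q * f (i + 1) * (f (i + 1) / f i) := by
        rw [show i + 1 + 1 = i + 2 from rfl]
        have e : q * f (i + 1) * (f (i + 1) / f i) = q * f (i + 1) ^ 2 / f i := by
          field_simp
        rw [e, le_div_iff₀ hpi]
        linarith [hq']
      have h2 : f (i + 1) / f i ≤ q ^ i * (f 1 / f 0) := by
        rw [div_le_iff₀ hpi]; exact ih'
      calc f (i + 1 + 1) ≤ q * f (i + 1) * (f (i + 1) / f i) := h1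
        _ ≤ q * f (i + 1) * (q ^ i * (f 1 / f 0)) :=
            mul_le_mul_of_nonneg_left h2 (mul_nonneg hq (hf _))
        _ = q ^ (i + 1) * (f 1 / f 0) * f (i + 1) := by ring

/-- **Geometric control of the consecutive ratio under reverse log-concavity with defect** (generic; the step
behind `envelope_le_of_reverseLogConcave`): `p^i · (f 1/f 0) · f i ≤ f (i+1)` for `i + 1 ≤ n`.
[cite: SaumardWellner2014, §4 (arXiv p. 13)] -/
theorem ratio_mul_le_succ_of_reverseLogConcave (f : ℕ → ℝ) (p : ℝ) (n : ℕ) (hp : 0 ≤ p) (hf : ∀ l, 0 ≤ f l)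
    (h0 : 0 < f 0) (hsupp : ∀ l, l < n → f l = 0 → f (l + 1) = 0)
    (hlc : ∀ l, l + 2 ≤ n → p * f (l + 1) ^ 2 ≤ f l * f (l + 2)) :
    ∀ i, i + 1 ≤ n → p ^ i * (f 1 / f 0) * f i ≤ f (i + 1) := by
  intro i
  induction i with
  | zero => intro _; simp [div_mul_cancel₀ _ h0.ne']
  | succ i ih =>
    intro hi
    have ih' := ih (by omega)
    rcases (hf (i + 1)).eq_or_lt with hz | hpos
    · rw [← hz, mul_zero]; exact hf _
    · have hpi : 0 < f i := by
        rcases (hf i).eq_or_lt with hz' | hp'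
        · exact absurd (hsupp i (by omega) hz'.symm) hpos.ne'
        · exact hp'
      have hp' := hlc i (by omega)
      have h1 : p * f (i + 1) * (f (i + 1) / f i) ≤ f (i + 1 + 1) := by
        rw [show i + 1 + 1 = i + 2 from rfl]
        have e : p * f (i + 1) * (f (i + 1) / f i) = p * f (i + 1) ^ 2 / f i := by
          field_simp
        rw [e, div_le_iff₀ hpi]
        linarith [hp']
      have h2 : p ^ i * (f 1 / f 0) ≤ f (i + 1) / f i := by
        rw [le_div_iff₀ hpi]; exact ih'
      calc p ^ (i + 1) * (f 1 / f 0) * f (i + 1) = p * f (i + 1) * (p ^ i * (f 1 / f 0)) := by ring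
        _ ≤ p * f (i + 1) * (f (i + 1) / f i) :=
            mul_le_mul_of_nonneg_left h2 (mul_nonneg hp (hf _))
        _ ≤ f (i + 1 + 1) := h1

/-- **Unimodality, right of a maximiser**: if `W(α) ≤ W(α*)` for all `α`, `W(α*) > 0` and `α* ≤ α`, then
`W(α+1) ≤ W(α)` (log-concavity `lineW_mul_lineW_le_sq`: the ratio is non-increasing, and it is `≤ 1` at `α*`).
[cite: SaumardWellner2014, §4 (arXiv p. 13)] -/
theorem lineW_succ_le_of_max_le {a b d s x αs α : ℕ} (hmax : ∀ α', lineW a b d s x α' ≤ lineW a b d s x αs)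
    (hpos : 0 < lineW a b d s x αs) (h : αs ≤ α) : lineW a b d s x (α + 1) ≤ lineW a b d s x α := by
  obtain ⟨i, rfl⟩ : ∃ i, α = αs + i := ⟨α - αs, by omega⟩
  have h0 : (0 : ℝ) < lineW a b d s x αs := by exact_mod_cast hpos
  have t := succ_le_ratio_mul_of_strongLogConcave (fun l => (lineW a b d s x (αs + l) : ℝ)) 1 (i + 1)
    zero_le_one (fun l => by positivity) (by simpa using h0)
    (fun l _ hl => by
      have hl' : lineW a b d s x (αs + l) = 0 := by exact_mod_cast hl
      simpa [Nat.add_assoc] using lineW_add_succ_eq_zero hpos hl')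
    (fun l _ => by
      have := lineW_mul_lineW_le_sq a b d s x (αs + l)
      have t : ((lineW a b d s x (αs + l) * lineW a b d s x (αs + l + 2) : ℕ) : ℝ) ≤
          ((lineW a b d s x (αs + l + 1) ^ 2 : ℕ) : ℝ) := by exact_mod_cast this
      push_cast at t
      simpa [Nat.add_assoc] using t)
    i le_rfl
  have hr : (lineW a b d s x (αs + 1) : ℝ) / lineW a b d s x αs ≤ 1 := by
    rw [div_le_one h0]; exact_mod_cast hmax _
  have hW : (0 : ℝ) ≤ lineW a b d s x (αs + i) := by positivity
  have t' : (lineW a b d s x (αs + i + 1) : ℝ) ≤ lineW a b d s x (αs + i) := by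
    simp only [one_pow, one_mul, Nat.add_zero] at t
    calc (lineW a b d s x (αs + i + 1) : ℝ) = lineW a b d s x (αs + (i + 1)) := by rw [Nat.add_assoc]
      _ ≤ (lineW a b d s x (αs + 1) : ℝ) / lineW a b d s x αs * lineW a b d s x (αs + i) := by
          simpa using t
      _ ≤ 1 * lineW a b d s x (αs + i) := mul_le_mul_of_nonneg_right hr hW
      _ = lineW a b d s x (αs + i) := one_mul _
  exact_mod_cast t'

/-- **Unimodality, left of a maximiser**: if `W(α) ≤ W(α*)` for all `α`, `W(α*) > 0` and `α < α*`, then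
`W(α) ≤ W(α+1)`. [cite: SaumardWellner2014, §4 (arXiv p. 13)] -/
theorem lineW_le_succ_of_lt_max {a b d s x αs α : ℕ} (hmax : ∀ α', lineW a b d s x α' ≤ lineW a b d s x αs)
    (hpos : 0 < lineW a b d s x αs) (h : α < αs) : lineW a b d s x α ≤ lineW a b d s x (α + 1) := by
  obtain ⟨i, hi⟩ : ∃ i, α + 1 + i = αs := ⟨αs - (α + 1), by omega⟩
  have h0 : (0 : ℝ) < lineW a b d s x αs := by exact_mod_cast hpos
  have t := succ_le_ratio_mul_of_strongLogConcave (fun l => (lineW a b d s x (αs - l) : ℝ)) 1 (i + 1)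
    zero_le_one (fun l => by positivity) (by simpa using h0)
    (fun l hl hz => by
      have hz' : lineW a b d s x (αs - l) = 0 := by exact_mod_cast hz
      exact_mod_cast lineW_sub_succ_eq_zero hpos (by omega) hz')
    (fun l hl => by
      have := lineW_mul_lineW_le_sq a b d s x (αs - (l + 2))
      have t : ((lineW a b d s x (αs - (l + 2)) * lineW a b d s x (αs - (l + 2) + 2) : ℕ) : ℝ) ≤
          ((lineW a b d s x (αs - (l + 2) + 1) ^ 2 : ℕ) : ℝ) := by exact_mod_cast this
      push_cast at t
      have e1 : αs - (l + 2) + 1 = αs - (l + 1) := by omega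
      have e2 : αs - (l + 2) + 2 = αs - l := by omega
      rw [e1, e2] at t
      simpa [mul_comm] using t)
    i le_rfl
  have hr : (lineW a b d s x (αs - 1) : ℝ) / lineW a b d s x αs ≤ 1 := by
    rw [div_le_one h0]; exact_mod_cast hmax _
  have hW : (0 : ℝ) ≤ lineW a b d s x (αs - i) := by positivity
  have e1 : αs - (i + 1) = α := by omega
  have e2 : αs - i = α + 1 := by omega
  have t' : (lineW a b d s x α : ℝ) ≤ lineW a b d s x (α + 1) := by
    simp only [one_pow, one_mul] at t
    rw [e1, e2] at t
    rw [e2] at hW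
    calc (lineW a b d s x α : ℝ)
        ≤ (lineW a b d s x (αs - 1) : ℝ) / lineW a b d s x αs * lineW a b d s x (α + 1) := by
          simpa using t
      _ ≤ 1 * lineW a b d s x (α + 1) := mul_le_mul_of_nonneg_right hr hW
      _ = lineW a b d s x (α + 1) := one_mul _
  exact_mod_cast t'

/-- **The ratio window, right of a maximiser.** Let `W(α) ≤ W(β+1)` for all `α` (a maximiser written `β + 1`),
`W(β) > 0`, and let the six margins of `lineW_sq_mul_pow_le` be `≥ M ≥ 2` at every `β + l`, `l ≤ L`. Then for
`i ≤ L`: `((1−2/M)^8)^{i+1} · W(β+1+i) ≤ W(β+2+i)` — together with `lineW_succ_le_of_max_le`, the ratio at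
distance `i` right of the maximiser lies in `[(1−2/M)^{8(i+1)}, 1]`. [cite: SaumardWellner2014, §4 (arXiv p. 13)] -/
theorem lineW_ratio_window_right (a b d s x β M L : ℕ) (hM : 2 ≤ M)
    (hmax : ∀ α, lineW a b d s x α ≤ lineW a b d s x (β + 1)) (hβ : 0 < lineW a b d s x β)
    (hmar : ∀ l, l ≤ L → β + l + M ≤ a ∧ M ≤ β + l + 2 ∧ 2 * (β + l) + M + 1 ≤ x ∧
      x + M ≤ 2 * (β + l) + b + 3 ∧ x + M ≤ s + (β + l) + 2 ∧ s + (β + l) + M ≤ x + d)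
    {i : ℕ} (hi : i ≤ L) :
    ((1 - 2 / (M : ℝ)) ^ 8) ^ (i + 1) * lineW a b d s x (β + 1 + i) ≤ lineW a b d s x (β + 2 + i) := by
  have hM' : (2 : ℝ) ≤ M := by exact_mod_cast hM
  have hp : (0 : ℝ) ≤ (1 - 2 / (M : ℝ)) ^ 8 := by
    apply pow_nonneg
    have : 2 / (M : ℝ) ≤ 1 := by rw [div_le_one (by linarith)]; exact hM'
    linarith
  have h0 : (0 : ℝ) < lineW a b d s x β := by exact_mod_cast hβ
  have t := ratio_mul_le_succ_of_reverseLogConcave (fun l => (lineW a b d s x (β + l) : ℝ))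
    ((1 - 2 / (M : ℝ)) ^ 8) (L + 2) hp (fun l => by positivity) (by simpa using h0)
    (fun l _ hl => by
      have hl' : lineW a b d s x (β + l) = 0 := by exact_mod_cast hl
      simpa [Nat.add_assoc] using lineW_add_succ_eq_zero hβ hl')
    (fun l hl => by
      obtain ⟨m1, m2, m3, m4, m5, m6⟩ := hmar l (by omega)
      have := lineW_sq_mul_le_real a b d s x (β + l) M hM m1 m2 m3 m4 m5 m6
      simpa [Nat.add_assoc] using this)
    (i + 1) (by omega)
  have hr : (1 : ℝ) ≤ (lineW a b d s x (β + 1) : ℝ) / lineW a b d s x β := by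
    rw [le_div_iff₀ h0, one_mul]; exact_mod_cast hmax _
  have hW : (0 : ℝ) ≤ lineW a b d s x (β + 1 + i) := by positivity
  have e1 : β + (i + 1) = β + 1 + i := by ring
  have e2 : β + (i + 1 + 1) = β + 2 + i := by ring
  simp only [e1, e2] at t
  calc ((1 - 2 / (M : ℝ)) ^ 8) ^ (i + 1) * lineW a b d s x (β + 1 + i)
      = ((1 - 2 / (M : ℝ)) ^ 8) ^ (i + 1) * 1 * lineW a b d s x (β + 1 + i) := by ring
    _ ≤ ((1 - 2 / (M : ℝ)) ^ 8) ^ (i + 1) * ((lineW a b d s x (β + 1) : ℝ) / lineW a b d s x β) *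
          lineW a b d s x (β + 1 + i) := by gcongr
    _ ≤ lineW a b d s x (β + 2 + i) := t

/-- **The ratio window, left of a maximiser.** Let `W(α) ≤ W(α*)` for all `α`, `W(α*+1) > 0`, `L ≤ α*`, and let
the six margins be `≥ M ≥ 2` at every `α* − 1 − l`, `l + 1 ≤ L`. Then for `i ≤ L`:
`((1−2/M)^8)^i · W(α*+1−i) ≤ W(α*−i)` — together with `lineW_le_succ_of_lt_max`, the ratio `W(α+1)/W(α)` at
`α = α* − i` lies in `[1, (1−2/M)^{−8i}]`. [cite: SaumardWellner2014, §4 (arXiv p. 13)] -/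
theorem lineW_ratio_window_left (a b d s x αs M L : ℕ) (hM : 2 ≤ M) (hL : L ≤ αs)
    (hmax : ∀ α, lineW a b d s x α ≤ lineW a b d s x αs) (hαs : 0 < lineW a b d s x (αs + 1))
    (hmar : ∀ l, l + 1 ≤ L → αs - (l + 1) + M ≤ a ∧ M ≤ αs - (l + 1) + 2 ∧
      2 * (αs - (l + 1)) + M + 1 ≤ x ∧ x + M ≤ 2 * (αs - (l + 1)) + b + 3 ∧
      x + M ≤ s + (αs - (l + 1)) + 2 ∧ s + (αs - (l + 1)) + M ≤ x + d)
    {i : ℕ} (hi : i ≤ L) :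
    ((1 - 2 / (M : ℝ)) ^ 8) ^ i * lineW a b d s x (αs + 1 - i) ≤ lineW a b d s x (αs - i) := by
  have hM' : (2 : ℝ) ≤ M := by exact_mod_cast hM
  have hp : (0 : ℝ) ≤ (1 - 2 / (M : ℝ)) ^ 8 := by
    apply pow_nonneg
    have : 2 / (M : ℝ) ≤ 1 := by rw [div_le_one (by linarith)]; exact hM'
    linarith
  have h0 : (0 : ℝ) < lineW a b d s x (αs + 1) := by exact_mod_cast hαs
  have hpos : 0 < lineW a b d s x αs := lt_of_lt_of_le hαs (hmax _)
  have t := ratio_mul_le_succ_of_reverseLogConcave (fun l => (lineW a b d s x (αs + 1 - l) : ℝ))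
    ((1 - 2 / (M : ℝ)) ^ 8) (L + 1) hp (fun l => by positivity) (by simpa using h0)
    (fun l hl hz => by
      have hz' : lineW a b d s x (αs + 1 - l) = 0 := by exact_mod_cast hz
      exact_mod_cast lineW_sub_succ_eq_zero hαs (by omega) hz')
    (fun l hl => by
      obtain ⟨m1, m2, m3, m4, m5, m6⟩ := hmar l (by omega)
      have := lineW_sq_mul_le_real a b d s x (αs - (l + 1)) M hM m1 m2 m3 m4 m5 m6
      have e0 : αs + 1 - l = αs - (l + 1) + 2 := by omega
      have e1 : αs + 1 - (l + 1) = αs - (l + 1) + 1 := by omega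
      have e2 : αs + 1 - (l + 2) = αs - (l + 1) := by omega
      rw [e0, e1, e2]
      simpa [mul_comm] using this)
    i (by omega)
  have hr : (1 : ℝ) ≤ (lineW a b d s x (αs + 1 - 1) : ℝ) / lineW a b d s x (αs + 1 - 0) := by
    rw [Nat.add_sub_cancel, Nat.sub_zero, le_div_iff₀ h0, one_mul]; exact_mod_cast hmax _
  have hW : (0 : ℝ) ≤ lineW a b d s x (αs + 1 - i) := by positivity
  have e2 : αs + 1 - (i + 1) = αs - i := by omega
  rw [e2] at t
  calc ((1 - 2 / (M : ℝ)) ^ 8) ^ i * lineW a b d s x (αs + 1 - i)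
      = ((1 - 2 / (M : ℝ)) ^ 8) ^ i * 1 * lineW a b d s x (αs + 1 - i) := by ring
    _ ≤ ((1 - 2 / (M : ℝ)) ^ 8) ^ i *
          ((lineW a b d s x (αs + 1 - 1) : ℝ) / lineW a b d s x (αs + 1 - 0)) *
          lineW a b d s x (αs + 1 - i) := by gcongr
    _ ≤ lineW a b d s x (αs - i) := t

/-! ### §9 (v4) Moments under the one-parameter moves: EXACT covariance identities (the (L2) input)

Every one-parameter move of §2/§7 is a tilt by an AFFINE function of `α` (or the inverse of one): the
`a`-shift by `a + 1 − α`, the `b`-shift by `b + 1 − j = (b + 1 − x) + 2α`, the `d`-shift by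
`d + 1 − m = (d + 1 − s + x) − α`, and the `s`-step is the composition of two such (`W_{s+1}(α)·(m+1) =
W_s(α)·(d−m)`: the intermediate weight `W_s·(d−m) = W_{s+1}·(m+1)` is an affine tilt of BOTH laws). For an
affine tilt the change of ANY expectation is an exact covariance (`sum_affine_tilt`):
`E_{wℓ}[g] − E_w[g] = e·Cov_w(g, α)/E_w[ℓ]`, `ℓ(α) = c + eα`. Hence, division-free and with no side condition
(prover MEMO-29 §3 (L2): "two-sided control of the first two moments of `lineW` under `s ↦ s+1` and under the
neighbouring moves, relative to the variance"):
`U·(E_{s+1}[g]·Z_s Z_{s+1} − E_s[g]·Z_s Z_{s+1}) = −(K_s(g)·Z_{s+1} + K_{s+1}(g)·Z_s)` with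
`K(g) = (Σ gαW)(Σ W) − (Σ gW)(Σ αW) = Z²·Cov(g, α)` and `U = Σ (d−m)W_s = Σ (m+1)W_{s+1}`, i.e.
`E_{s+1}[g] − E_s[g] = −Cov_s(g,α)/E_s[d−m] − Cov_{s+1}(g,α)/E_{s+1}[m+1]`: with `g = α` the mean DEcreases by
exactly `Var_s(α)/E_s[d−m] + Var_{s+1}(α)/E_{s+1}[m+1]` (`≈ σ²·(1/(d−m̄) + 1/m̄) = O(1)`), with `g = (α−m₀)²` the
second moment about a fixed centre moves by third-moment covariances (`O(σ³/N)` = `O(σ²/√N)` relatively); the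
moments themselves are controlled by the envelopes of §6. -/

/-- **The `s`-step tilt in `ℝ`, unconditionally**: `W_{s+1}(α)·(s + α + 1 − x) = W_s(α)·(d + x − s − α)` with
HONEST real affine factors, for all parameters (off the line or outside the supports both sides vanish).
[cite: ChattamvelliShanmugam2020, §7.4 Table 7.1 (PDF p. 143)] -/
theorem lineW_succ_sample_mul_real (a b d s x α : ℕ) :
    (lineW a b d (s + 1) x α : ℝ) * ((s : ℝ) + α + 1 - x) =
      (lineW a b d s x α : ℝ) * ((d : ℝ) + x - s - α) := by
  rcases Nat.lt_or_ge x (2 * α) with h1 | h1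
  · rw [lineW_eq_zero_of_lt h1, lineW_eq_zero_of_lt h1]; simp
  rcases Nat.lt_or_ge (s + α + 1) x with h2 | h2
  · rw [lineW_eq_zero_of_lt' (by omega : s + 1 + α < x), lineW_eq_zero_of_lt' (by omega : s + α < x)]; simp
  rcases Nat.lt_or_ge d (s + α - x) with h3 | h3
  · -- outside the kind-`D` support: both weights vanish
    have z0 : lineW a b d s x α = 0 := by
      rcases Nat.eq_zero_or_pos (lineW a b d s x α) with h | h
      · exact h
      · exact absurd (lineW_pos_iff.1 h) (by omega)
    have z1 : lineW a b d (s + 1) x α = 0 := by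
      rcases Nat.eq_zero_or_pos (lineW a b d (s + 1) x α) with h | h
      · exact h
      · exact absurd (lineW_pos_iff.1 h) (by omega)
    rw [z0, z1]; simp
  · have t := lineW_succ_sample_mul a b d s x α h1 h2
    have t' : ((lineW a b d (s + 1) x α * (s + α + 1 - x) : ℕ) : ℝ) =
        ((lineW a b d s x α * (d - (s + α - x)) : ℕ) : ℝ) := by exact_mod_cast t
    rcases Nat.lt_or_ge (s + α) x with h4 | h4
    · -- `x = s + α + 1`: the left factor vanishes and `W_s(α) = 0`
      rw [lineW_eq_zero_of_lt' h4]
      have e : (s : ℝ) + α + 1 - x = 0 := by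
        have : x = s + α + 1 := by omega
        rw [this]; push_cast; ring
      rw [e]; simp
    · push_cast [Nat.cast_sub (by omega : x ≤ s + α + 1), Nat.cast_sub h3, Nat.cast_sub h4] at t'
      linear_combination t'

/-- The `a`-shift in `ℝ`, unconditionally: `W_{a+1}(α)·(a + 1 − α) = W_a(α)·(a + 1)`.
[cite: ChattamvelliShanmugam2020, §7.4 Table 7.1 (PDF p. 143)] -/
theorem lineW_succ_a_mul_real (a b d s x α : ℕ) :
    (lineW (a + 1) b d s x α : ℝ) * ((a : ℝ) + 1 - α) = (lineW a b d s x α : ℝ) * ((a : ℝ) + 1) := by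
  rcases Nat.lt_or_ge (a + 1) α with h | h
  · rw [lineW_eq_zero_of_lt_alpha h, lineW_eq_zero_of_lt_alpha (by omega : a < α)]; simp
  · have t := lineW_succ_a_mul a b d s x α
    have t' : ((lineW (a + 1) b d s x α * (a + 1 - α) : ℕ) : ℝ) = ((lineW a b d s x α * (a + 1) : ℕ) : ℝ) := by
      exact_mod_cast t
    push_cast [Nat.cast_sub h] at t'
    linear_combination t'

/-- The `b`-shift in `ℝ`, unconditionally: `W_{b+1}(α)·(b + 1 − x + 2α) = W_b(α)·(b + 1)`.
[cite: ChattamvelliShanmugam2020, §7.4 Table 7.1 (PDF p. 143)] -/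
theorem lineW_succ_b_mul_real (a b d s x α : ℕ) :
    (lineW a (b + 1) d s x α : ℝ) * ((b : ℝ) + 1 - x + 2 * α) = (lineW a b d s x α : ℝ) * ((b : ℝ) + 1) := by
  rcases Nat.lt_or_ge x (2 * α) with h1 | h1
  · rw [lineW_eq_zero_of_lt h1, lineW_eq_zero_of_lt h1]; simp
  rcases Nat.lt_or_ge (b + 1) (x - 2 * α) with h2 | h2
  · have z0 : lineW a b d s x α = 0 := by
      rcases Nat.eq_zero_or_pos (lineW a b d s x α) with h | h
      · exact h
      · exact absurd (lineW_pos_iff.1 h) (by omega)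
    have z1 : lineW a (b + 1) d s x α = 0 := by
      rcases Nat.eq_zero_or_pos (lineW a (b + 1) d s x α) with h | h
      · exact h
      · exact absurd (lineW_pos_iff.1 h) (by omega)
    rw [z0, z1]; simp
  · have t := lineW_succ_b_mul a b d s x α
    have t' : ((lineW a (b + 1) d s x α * (b + 1 - (x - 2 * α)) : ℕ) : ℝ) =
        ((lineW a b d s x α * (b + 1) : ℕ) : ℝ) := by exact_mod_cast t
    push_cast [Nat.cast_sub h2, Nat.cast_sub h1] at t'
    linear_combination t'

/-- The `d`-shift in `ℝ`, unconditionally: `W_{d+1}(α)·(d + 1 + x − s − α) = W_d(α)·(d + 1)`.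
[cite: ChattamvelliShanmugam2020, §7.4 Table 7.1 (PDF p. 143)] -/
theorem lineW_succ_d_mul_real (a b d s x α : ℕ) :
    (lineW a b (d + 1) s x α : ℝ) * ((d : ℝ) + 1 + x - s - α) = (lineW a b d s x α : ℝ) * ((d : ℝ) + 1) := by
  rcases Nat.lt_or_ge (s + α) x with h1 | h1
  · rw [lineW_eq_zero_of_lt' h1, lineW_eq_zero_of_lt' h1]; simp
  rcases Nat.lt_or_ge (d + 1) (s + α - x) with h2 | h2
  · have z0 : lineW a b d s x α = 0 := by
      rcases Nat.eq_zero_or_pos (lineW a b d s x α) with h | h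
      · exact h
      · exact absurd (lineW_pos_iff.1 h) (by omega)
    have z1 : lineW a b (d + 1) s x α = 0 := by
      rcases Nat.eq_zero_or_pos (lineW a b (d + 1) s x α) with h | h
      · exact h
      · exact absurd (lineW_pos_iff.1 h) (by omega)
    rw [z0, z1]; simp
  · have t := lineW_succ_d_mul a b d s x α
    have t' : ((lineW a b (d + 1) s x α * (d + 1 - (s + α - x)) : ℕ) : ℝ) =
        ((lineW a b d s x α * (d + 1) : ℕ) : ℝ) := by exact_mod_cast t
    push_cast [Nat.cast_sub h2, Nat.cast_sub h1] at t'
    linear_combination t'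

/-- **Affine tilts change expectations by a covariance** (generic, exact): for weights `w`, any `g`, and the
affine function `ℓ(α) = c + e·α`,
`(Σ g·ℓ·w)(Σ w) − (Σ g·w)(Σ ℓ·w) = e·((Σ g·α·w)(Σ w) − (Σ g·w)(Σ α·w))` — i.e.
`E_{wℓ}[g] − E_w[g] = e·Cov_w(g, α)/E_w[ℓ]` after division. [cite: SaumardWellner2014, §4 (arXiv p. 13),
exponential/affine tilting of a discrete law] -/
theorem sum_affine_tilt (I : Finset ℕ) (w g : ℕ → ℝ) (c e : ℝ) :
    (∑ α ∈ I, g α * (c + e * α) * w α) * (∑ α ∈ I, w α) -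
        (∑ α ∈ I, g α * w α) * (∑ α ∈ I, (c + e * α) * w α) =
      e * ((∑ α ∈ I, g α * α * w α) * (∑ α ∈ I, w α) -
        (∑ α ∈ I, g α * w α) * (∑ α ∈ I, (α : ℝ) * w α)) := by
  have h1 : ∑ α ∈ I, g α * (c + e * α) * w α = c * ∑ α ∈ I, g α * w α + e * ∑ α ∈ I, g α * α * w α := by
    rw [Finset.mul_sum, Finset.mul_sum, ← Finset.sum_add_distrib]
    exact Finset.sum_congr rfl fun α _ => by ring
  have h2 : ∑ α ∈ I, (c + e * α) * w α = c * ∑ α ∈ I, w α + e * ∑ α ∈ I, (α : ℝ) * w α := by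
    rw [Finset.mul_sum, Finset.mul_sum, ← Finset.sum_add_distrib]
    exact Finset.sum_congr rfl fun α _ => by ring
  rw [h1, h2]; ring

/-- **The `a`-shift moves expectations by a covariance, exactly**:
`(a+1)·((Σ gW_a)(Σ W_{a+1}) − (Σ gW_{a+1})(Σ W_a)) = −((Σ gαW_{a+1})(Σ W_{a+1}) − (Σ gW_{a+1})(Σ αW_{a+1}))`,
i.e. `E_a[g] − E_{a+1}[g] = −Cov_{a+1}(g, α)/E_{a+1}[a+1−α]` (sums over any finite index set).
[cite: ChattamvelliShanmugam2020, §7.4 Table 7.1 (PDF p. 143)] -/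
theorem lineW_aShift_moment_identity (I : Finset ℕ) (g : ℕ → ℝ) (a b d s x : ℕ) :
    ((a : ℝ) + 1) * ((∑ α ∈ I, g α * lineW a b d s x α) * (∑ α ∈ I, (lineW (a + 1) b d s x α : ℝ)) -
        (∑ α ∈ I, g α * lineW (a + 1) b d s x α) * (∑ α ∈ I, (lineW a b d s x α : ℝ))) =
      -((∑ α ∈ I, g α * α * lineW (a + 1) b d s x α) * (∑ α ∈ I, (lineW (a + 1) b d s x α : ℝ)) -
        (∑ α ∈ I, g α * lineW (a + 1) b d s x α) * (∑ α ∈ I, (α : ℝ) * lineW (a + 1) b d s x α)) := by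
  have t := sum_affine_tilt I (fun α => (lineW (a + 1) b d s x α : ℝ)) g ((a : ℝ) + 1) (-1)
  have e1 : ∑ α ∈ I, g α * (((a : ℝ) + 1) + (-1) * α) * (lineW (a + 1) b d s x α : ℝ) =
      ((a : ℝ) + 1) * ∑ α ∈ I, g α * lineW a b d s x α := by
    rw [Finset.mul_sum]
    refine Finset.sum_congr rfl fun α _ => ?_
    have := lineW_succ_a_mul_real a b d s x α
    linear_combination (g α) * this
  have e2 : ∑ α ∈ I, (((a : ℝ) + 1) + (-1) * α) * (lineW (a + 1) b d s x α : ℝ) =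
      ((a : ℝ) + 1) * ∑ α ∈ I, (lineW a b d s x α : ℝ) := by
    rw [Finset.mul_sum]
    refine Finset.sum_congr rfl fun α _ => ?_
    have := lineW_succ_a_mul_real a b d s x α
    linear_combination this
  rw [e1, e2] at t
  linear_combination t

/-- **The `b`-shift moves expectations by a covariance, exactly**:
`(b+1)·((Σ gW_b)(Σ W_{b+1}) − (Σ gW_{b+1})(Σ W_b)) = 2·((Σ gαW_{b+1})(Σ W_{b+1}) − (Σ gW_{b+1})(Σ αW_{b+1}))`,
i.e. `E_b[g] − E_{b+1}[g] = 2·Cov_{b+1}(g, α)/E_{b+1}[b+1−j]`. [cite: ChattamvelliShanmugam2020, §7.4 Table 7.1 (PDF p. 143)] -/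
theorem lineW_bShift_moment_identity (I : Finset ℕ) (g : ℕ → ℝ) (a b d s x : ℕ) :
    ((b : ℝ) + 1) * ((∑ α ∈ I, g α * lineW a b d s x α) * (∑ α ∈ I, (lineW a (b + 1) d s x α : ℝ)) -
        (∑ α ∈ I, g α * lineW a (b + 1) d s x α) * (∑ α ∈ I, (lineW a b d s x α : ℝ))) =
      2 * ((∑ α ∈ I, g α * α * lineW a (b + 1) d s x α) * (∑ α ∈ I, (lineW a (b + 1) d s x α : ℝ)) -
        (∑ α ∈ I, g α * lineW a (b + 1) d s x α) * (∑ α ∈ I, (α : ℝ) * lineW a (b + 1) d s x α)) := by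
  have t := sum_affine_tilt I (fun α => (lineW a (b + 1) d s x α : ℝ)) g ((b : ℝ) + 1 - x) 2
  have e1 : ∑ α ∈ I, g α * (((b : ℝ) + 1 - x) + 2 * α) * (lineW a (b + 1) d s x α : ℝ) =
      ((b : ℝ) + 1) * ∑ α ∈ I, g α * lineW a b d s x α := by
    rw [Finset.mul_sum]
    refine Finset.sum_congr rfl fun α _ => ?_
    have := lineW_succ_b_mul_real a b d s x α
    linear_combination (g α) * this
  have e2 : ∑ α ∈ I, (((b : ℝ) + 1 - x) + 2 * α) * (lineW a (b + 1) d s x α : ℝ) =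
      ((b : ℝ) + 1) * ∑ α ∈ I, (lineW a b d s x α : ℝ) := by
    rw [Finset.mul_sum]
    refine Finset.sum_congr rfl fun α _ => ?_
    have := lineW_succ_b_mul_real a b d s x α
    linear_combination this
  rw [e1, e2] at t
  linear_combination t

/-- **The `d`-shift moves expectations by a covariance, exactly**:
`(d+1)·((Σ gW_d)(Σ W_{d+1}) − (Σ gW_{d+1})(Σ W_d)) = −((Σ gαW_{d+1})(Σ W_{d+1}) − (Σ gW_{d+1})(Σ αW_{d+1}))`,
i.e. `E_d[g] − E_{d+1}[g] = −Cov_{d+1}(g, α)/E_{d+1}[d+1−m]`. [cite: ChattamvelliShanmugam2020, §7.4 Table 7.1 (PDF p. 143)] -/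
theorem lineW_dShift_moment_identity (I : Finset ℕ) (g : ℕ → ℝ) (a b d s x : ℕ) :
    ((d : ℝ) + 1) * ((∑ α ∈ I, g α * lineW a b d s x α) * (∑ α ∈ I, (lineW a b (d + 1) s x α : ℝ)) -
        (∑ α ∈ I, g α * lineW a b (d + 1) s x α) * (∑ α ∈ I, (lineW a b d s x α : ℝ))) =
      -((∑ α ∈ I, g α * α * lineW a b (d + 1) s x α) * (∑ α ∈ I, (lineW a b (d + 1) s x α : ℝ)) -
        (∑ α ∈ I, g α * lineW a b (d + 1) s x α) * (∑ α ∈ I, (α : ℝ) * lineW a b (d + 1) s x α)) := by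
  have t := sum_affine_tilt I (fun α => (lineW a b (d + 1) s x α : ℝ)) g ((d : ℝ) + 1 + x - s) (-1)
  have e1 : ∑ α ∈ I, g α * (((d : ℝ) + 1 + x - s) + (-1) * α) * (lineW a b (d + 1) s x α : ℝ) =
      ((d : ℝ) + 1) * ∑ α ∈ I, g α * lineW a b d s x α := by
    rw [Finset.mul_sum]
    refine Finset.sum_congr rfl fun α _ => ?_
    have := lineW_succ_d_mul_real a b d s x α
    linear_combination (g α) * this
  have e2 : ∑ α ∈ I, (((d : ℝ) + 1 + x - s) + (-1) * α) * (lineW a b (d + 1) s x α : ℝ) =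
      ((d : ℝ) + 1) * ∑ α ∈ I, (lineW a b d s x α : ℝ) := by
    rw [Finset.mul_sum]
    refine Finset.sum_congr rfl fun α _ => ?_
    have := lineW_succ_d_mul_real a b d s x α
    linear_combination this
  rw [e1, e2] at t
  linear_combination t

/-- **The `s`-step moves expectations by TWO covariances, exactly** (division-free): with
`Z_s = Σ W_s`, `Z' = Σ W_{s+1}`, `U = Σ (d+x−s−α)·W_s(α) = Σ (s+α+1−x)·W_{s+1}(α)` and
`K_s(g) = (Σ gαW_s)(Σ W_s) − (Σ gW_s)(Σ αW_s)` (`= Z_s²·Cov_s(g,α)`), `K'` likewise: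
`U·((Σ gW_{s+1})·Z_s − (Σ gW_s)·Z') = −(K_s(g)·Z' + K'(g)·Z_s)`, i.e.
`E_{s+1}[g] − E_s[g] = −Cov_s(g,α)/E_s[d−m] − Cov_{s+1}(g,α)/E_{s+1}[m+1]` (`g = α`: the mean falls by exactly
`Var_s/E_s[d−m] + Var_{s+1}/E_{s+1}[m+1]`; `g = (α−m₀)²`: the second moment about a fixed centre moves by two
third-moment covariances). [cite: ChattamvelliShanmugam2020, §7.4 Table 7.1 (PDF p. 143)]
[cite: SaumardWellner2014, §4 (arXiv p. 13)] -/
theorem lineW_sStep_moment_identity (I : Finset ℕ) (g : ℕ → ℝ) (a b d s x : ℕ) :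
    (∑ α ∈ I, ((d : ℝ) + x - s - α) * lineW a b d s x α) *
        ((∑ α ∈ I, g α * lineW a b d (s + 1) x α) * (∑ α ∈ I, (lineW a b d s x α : ℝ)) -
          (∑ α ∈ I, g α * lineW a b d s x α) * (∑ α ∈ I, (lineW a b d (s + 1) x α : ℝ))) =
      -(((∑ α ∈ I, g α * α * lineW a b d s x α) * (∑ α ∈ I, (lineW a b d s x α : ℝ)) -
            (∑ α ∈ I, g α * lineW a b d s x α) * (∑ α ∈ I, (α : ℝ) * lineW a b d s x α)) *
          (∑ α ∈ I, (lineW a b d (s + 1) x α : ℝ)) +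
        ((∑ α ∈ I, g α * α * lineW a b d (s + 1) x α) * (∑ α ∈ I, (lineW a b d (s + 1) x α : ℝ)) -
            (∑ α ∈ I, g α * lineW a b d (s + 1) x α) * (∑ α ∈ I, (α : ℝ) * lineW a b d (s + 1) x α)) *
          (∑ α ∈ I, (lineW a b d s x α : ℝ))) := by
  -- the intermediate weight `u = W_s·(d+x−s−α) = W_{s+1}·(s+α+1−x)` is an affine tilt of both laws
  have t1 := sum_affine_tilt I (fun α => (lineW a b d s x α : ℝ)) g ((d : ℝ) + x - s) (-1)
  have t2 := sum_affine_tilt I (fun α => (lineW a b d (s + 1) x α : ℝ)) g ((s : ℝ) + 1 - x) 1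
  have eU : ∑ α ∈ I, (((s : ℝ) + 1 - x) + 1 * α) * (lineW a b d (s + 1) x α : ℝ) =
      ∑ α ∈ I, (((d : ℝ) + x - s) + (-1) * α) * (lineW a b d s x α : ℝ) := by
    refine Finset.sum_congr rfl fun α _ => ?_
    have := lineW_succ_sample_mul_real a b d s x α
    linear_combination this
  have eG : ∑ α ∈ I, g α * (((s : ℝ) + 1 - x) + 1 * α) * (lineW a b d (s + 1) x α : ℝ) =
      ∑ α ∈ I, g α * (((d : ℝ) + x - s) + (-1) * α) * (lineW a b d s x α : ℝ) := by
    refine Finset.sum_congr rfl fun α _ => ?_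
    have := lineW_succ_sample_mul_real a b d s x α
    linear_combination (g α) * this
  rw [eU, eG] at t2
  have eU' : ∑ α ∈ I, (((d : ℝ) + x - s) + (-1) * α) * (lineW a b d s x α : ℝ) =
      ∑ α ∈ I, ((d : ℝ) + x - s - α) * lineW a b d s x α :=
    Finset.sum_congr rfl fun α _ => by ring
  rw [eU'] at t1 t2
  set U := ∑ α ∈ I, ((d : ℝ) + x - s - α) * lineW a b d s x α
  set GU := ∑ α ∈ I, g α * (((d : ℝ) + x - s) + (-1) * α) * (lineW a b d s x α : ℝ)
  linear_combination (∑ α ∈ I, (lineW a b d (s + 1) x α : ℝ)) * t1 -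
    (∑ α ∈ I, (lineW a b d s x α : ℝ)) * t2

/-- Cauchy–Schwarz for a weighted mean: `(Σ α·w)² ≤ (Σ α²·w)·(Σ w)` for `w ≥ 0` (the variance numerator
`(Σ α²w)(Σ w) − (Σ αw)²` is nonnegative). [folklore] -/
private theorem sq_sum_mul_le (I : Finset ℕ) (w : ℕ → ℝ) (hw : ∀ α, 0 ≤ w α) :
    (∑ α ∈ I, (α : ℝ) * w α) ^ 2 ≤ (∑ α ∈ I, (α : ℝ) * α * w α) * (∑ α ∈ I, w α) := by
  have t := Finset.sum_mul_sq_le_sq_mul_sq I (fun α : ℕ => (α : ℝ) * Real.sqrt (w α))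
    (fun α : ℕ => Real.sqrt (w α))
  have e1 : ∀ α : ℕ, (α : ℝ) * Real.sqrt (w α) * Real.sqrt (w α) = (α : ℝ) * w α := fun α => by
    rw [mul_assoc, Real.mul_self_sqrt (hw α)]
  have e2 : ∀ α : ℕ, ((α : ℝ) * Real.sqrt (w α)) ^ 2 = (α : ℝ) * α * w α := fun α => by
    rw [mul_pow, Real.sq_sqrt (hw α)]; ring
  have e3 : ∀ α : ℕ, Real.sqrt (w α) ^ 2 = w α := fun α => Real.sq_sqrt (hw α)
  simp only [e1, e2, e3] at t
  exact t

/-- **The conditional mean of the `HH` count is non-increasing in the sample size** (unconditionally, over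
any index set): `(Σ α·W_{s+1}(α))·(Σ W_s) ≤ (Σ α·W_s(α))·(Σ W_{s+1})` — from `lineW_sStep_moment_identity` with
`g = α`: both covariances are variances (`≥ 0`, Cauchy–Schwarz) and `U ≥ 0` termwise (`W_s(α) > 0 ⇒ m ≤ d`).
[cite: ChattamvelliShanmugam2020, §7.4 Table 7.1 (PDF p. 143)] [cite: SaumardWellner2014, §4 (arXiv p. 13)] -/
theorem lineW_sStep_mean_antitone (I : Finset ℕ) (a b d s x : ℕ) :
    (∑ α ∈ I, (α : ℝ) * lineW a b d (s + 1) x α) * (∑ α ∈ I, (lineW a b d s x α : ℝ)) ≤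
      (∑ α ∈ I, (α : ℝ) * lineW a b d s x α) * (∑ α ∈ I, (lineW a b d (s + 1) x α : ℝ)) := by
  have t := lineW_sStep_moment_identity I (fun α => (α : ℝ)) a b d s x
  -- the variance numerators are nonnegative
  have v0 := sq_sum_mul_le I (fun α => (lineW a b d s x α : ℝ)) (fun α => by positivity)
  have v1 := sq_sum_mul_le I (fun α => (lineW a b d (s + 1) x α : ℝ)) (fun α => by positivity)
  have hZ : (0 : ℝ) ≤ ∑ α ∈ I, (lineW a b d s x α : ℝ) := Finset.sum_nonneg fun α _ => by positivity
  have hZ' : (0 : ℝ) ≤ ∑ α ∈ I, (lineW a b d (s + 1) x α : ℝ) := Finset.sum_nonneg fun α _ => by positivity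
  -- `U ≥ 0` termwise
  have hU : (0 : ℝ) ≤ ∑ α ∈ I, ((d : ℝ) + x - s - α) * lineW a b d s x α := by
    refine Finset.sum_nonneg fun α _ => ?_
    rcases Nat.eq_zero_or_pos (lineW a b d s x α) with h | h
    · rw [h]; simp
    · have := lineW_pos_iff.1 h
      have hf : (0 : ℝ) ≤ (d : ℝ) + x - s - α := by
        have : (s : ℝ) + α ≤ (d : ℝ) + x := by exact_mod_cast (show s + α ≤ d + x by omega)
        linarith
      exact mul_nonneg hf (by positivity)
  set Z := ∑ α ∈ I, (lineW a b d s x α : ℝ)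
  set Z' := ∑ α ∈ I, (lineW a b d (s + 1) x α : ℝ)
  set U := ∑ α ∈ I, ((d : ℝ) + x - s - α) * lineW a b d s x α
  set A1 := ∑ α ∈ I, (α : ℝ) * lineW a b d s x α
  set A1' := ∑ α ∈ I, (α : ℝ) * lineW a b d (s + 1) x α
  set A2 := ∑ α ∈ I, (α : ℝ) * α * lineW a b d s x α
  set A2' := ∑ α ∈ I, (α : ℝ) * α * lineW a b d (s + 1) x α
  -- `U·(A1'·Z − A1·Z') = −((A2 Z − A1²)·Z' + (A2' Z' − A1'²)·Z) ≤ 0`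
  have key : U * (A1' * Z - A1 * Z') ≤ 0 := by
    have e : U * (A1' * Z - A1 * Z') = -((A2 * Z - A1 * A1) * Z' + (A2' * Z' - A1' * A1') * Z) := by
      linear_combination t
    rw [e, neg_nonpos]
    have h1 : 0 ≤ A2 * Z - A1 * A1 := by nlinarith [v0]
    have h2 : 0 ≤ A2' * Z' - A1' * A1' := by nlinarith [v1]
    positivity
  rcases hU.eq_or_lt with hU0 | hUpos
  · -- `U = 0`: every `W_{s+1}(α) > 0` on `I` sits at `α = x − s − 1`, every `W_s(α) > 0` at `α ≥ x − s`
    have hnn : ∀ β ∈ I, (0 : ℝ) ≤ ((d : ℝ) + x - s - β) * lineW a b d s x β := by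
      intro β _
      rcases Nat.eq_zero_or_pos (lineW a b d s x β) with h | h
      · rw [h]; simp
      · have := lineW_pos_iff.1 h
        have hf : (0 : ℝ) ≤ (d : ℝ) + x - s - β := by
          have : (s : ℝ) + β ≤ (d : ℝ) + x := by exact_mod_cast (show s + β ≤ d + x by omega)
          linarith
        exact mul_nonneg hf (by positivity)
    have hz : ∀ α ∈ I, (lineW a b d (s + 1) x α : ℝ) = 0 ∨ ((α : ℝ) = (x : ℝ) - s - 1) := by
      intro α hα
      have hterm : ((d : ℝ) + x - s - α) * lineW a b d s x α = 0 :=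
        (Finset.sum_eq_zero_iff_of_nonneg hnn).1 hU0.symm α hα
      have t1 := lineW_succ_sample_mul_real a b d s x α
      have e : (lineW a b d (s + 1) x α : ℝ) * ((s : ℝ) + α + 1 - x) = 0 := by
        rw [t1]; linear_combination hterm
      rcases mul_eq_zero.1 e with h | h
      · exact Or.inl h
      · exact Or.inr (by linarith)
    have hA1' : A1' = ((x : ℝ) - s - 1) * Z' := by
      simp only [A1', Z', Finset.mul_sum]
      refine Finset.sum_congr rfl fun α hα => ?_
      rcases hz α hα with h | h
      · rw [h]; simp
      · rw [h]
    have hA1 : ((x : ℝ) - s) * Z ≤ A1 := by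
      simp only [A1, Z, Finset.mul_sum]
      refine Finset.sum_le_sum fun α _ => ?_
      rcases Nat.eq_zero_or_pos (lineW a b d s x α) with h | h
      · rw [h]; simp
      · have := lineW_pos_iff.1 h
        have hα : (x : ℝ) - s ≤ (α : ℝ) := by
          have : (x : ℝ) ≤ (s : ℝ) + α := by exact_mod_cast (show x ≤ s + α by omega)
          linarith
        exact mul_le_mul_of_nonneg_right hα (by positivity)
    rw [hA1']
    have hZZ : 0 ≤ Z * Z' := mul_nonneg hZ hZ'
    nlinarith [mul_le_mul_of_nonneg_right hA1 hZ']
  · have : A1' * Z - A1 * Z' ≤ 0 := by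
      by_contra hcon
      push Not at hcon
      have := mul_pos hUpos hcon
      linarith
    linarith

/-! ### §10 (v5) The variance floor and the law of total variance (prover brick 130's input (V))

(V) «a variance FLOOR `Var(n_A | X = x) ≥ c₀·N` on the window, and the mixture step `E[Var(α | comp)] ≤ Var`»
(prover g26, STATUS 2026-08-28T22:49Z). At the line-section level: the total mass is at least
`T_L·W(α*)`, `T_L = 1 + 2·Σ_{1 ≤ i ≤ L} ((1−2/M)^8)^{C(i+1,2)}` (the two-sided floor of §6 summed), at most
`2r + 1` integers lie within distance `< r` of any centre, and every atom is `≤ W(α*)`; so for every real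
centre `m` and every `r`: `Σ (α−m)²·W ≥ r²·(Z − (2r+1)·W(α*)) ≥ r²·(1 − (2r+1)/T_L)·Z` — a variance floor
`≍ M` once `L ≍ √M` (then `T_L ≍ √M`) and `r ≍ T_L`. The mixture step is Sedrakyan's form of Cauchy–Schwarz:
`(Σ_c Z_c)·Σ_c (S_c − A_c²/Z_c) ≤ (Σ_c Z_c)(Σ_c S_c) − (Σ_c A_c)²`. -/

/-- **Mass floor around a maximiser.** If `W(α) ≤ W(α*)` for all `α`, `W(α*−1) > 0`, `W(α*+1) > 0`,
`L + 1 ≤ α*`, `α* + L ≤ a`, and the six margins are `≥ M ≥ 2` at every `α* − 1 + l`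
(`l + 1 ≤ L`, right floor) and at every `α* − 1 − l` (`l + 1 ≤ L`, left floor), then
`W(α*)·(1 + Σ_{i=1}^{L} 2·((1−2/M)^8)^{C(i+1,2)}) ≤ Σ_{α ≤ a} W(α)`.
[cite: SaumardWellner2014, §4 (arXiv p. 13)] -/
theorem lineW_mode_mul_floorSum_le_sum (a b d s x αs M L : ℕ) (hM : 2 ≤ M) (hL : L + 1 ≤ αs) (hLa : αs + L ≤ a)
    (hmax : ∀ α, lineW a b d s x α ≤ lineW a b d s x αs) (hleft : 0 < lineW a b d s x (αs - 1))
    (hright : 0 < lineW a b d s x (αs + 1))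
    (hmarR : ∀ l, l + 1 ≤ L → αs - 1 + l + M ≤ a ∧ M ≤ αs - 1 + l + 2 ∧ 2 * (αs - 1 + l) + M + 1 ≤ x ∧
      x + M ≤ 2 * (αs - 1 + l) + b + 3 ∧ x + M ≤ s + (αs - 1 + l) + 2 ∧ s + (αs - 1 + l) + M ≤ x + d)
    (hmarL : ∀ l, l + 1 ≤ L → αs - (l + 1) + M ≤ a ∧ M ≤ αs - (l + 1) + 2 ∧
      2 * (αs - (l + 1)) + M + 1 ≤ x ∧ x + M ≤ 2 * (αs - (l + 1)) + b + 3 ∧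
      x + M ≤ s + (αs - (l + 1)) + 2 ∧ s + (αs - (l + 1)) + M ≤ x + d) :
    (lineW a b d s x αs : ℝ) * (1 + ∑ i ∈ Finset.Icc 1 L, 2 * ((1 - 2 / (M : ℝ)) ^ 8) ^ ((i + 1).choose 2)) ≤
      ∑ α ∈ Finset.range (a + 1), (lineW a b d s x α : ℝ) := by
  classical
  -- the three disjoint pieces `{α*}`, `{α* + i}`, `{α* − i}` (`1 ≤ i ≤ L`) of `range (a+1)`
  set R := Finset.Icc 1 L with hR
  have hβ : αs - 1 + 1 = αs := by omega
  have floorR : ∀ i ∈ R, ((1 - 2 / (M : ℝ)) ^ 8) ^ ((i + 1).choose 2) * lineW a b d s x αs ≤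
      lineW a b d s x (αs + i) := by
    intro i hi
    rw [Finset.mem_Icc] at hi
    have hmax' : ∀ α, lineW a b d s x α ≤ lineW a b d s x (αs - 1 + 1) := by rw [hβ]; exact hmax
    have t := lineW_max_mul_pow_le_add a b d s x (αs - 1) M i hM hmax' hleft (fun l hl => hmarR l (by omega))
    rw [hβ] at t
    exact t
  have floorL : ∀ i ∈ R, ((1 - 2 / (M : ℝ)) ^ 8) ^ ((i + 1).choose 2) * lineW a b d s x αs ≤
      lineW a b d s x (αs - i) := by
    intro i hi
    rw [Finset.mem_Icc] at hi
    exact lineW_max_mul_pow_le_sub a b d s x αs M i hM (by omega) hmax hright (fun l hl => hmarL l (by omega))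
  -- embed the three pieces
  have hsub : ({αs} ∪ R.image (fun i => αs + i) ∪ R.image (fun i => αs - i)) ⊆ Finset.range (a + 1) := by
    intro α hα
    simp only [Finset.mem_union, Finset.mem_singleton, Finset.mem_image, hR, Finset.mem_Icc] at hα
    rw [Finset.mem_range]
    rcases hα with (rfl | ⟨i, hi, rfl⟩) | ⟨i, hi, rfl⟩ <;> omega
  have hd1 : Disjoint ({αs} : Finset ℕ) (R.image (fun i => αs + i)) := by
    rw [Finset.disjoint_left]
    intro α hα hα'
    simp only [Finset.mem_singleton] at hα
    simp only [Finset.mem_image, hR, Finset.mem_Icc] at hα'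
    obtain ⟨i, hi, he⟩ := hα'
    omega
  have hd2 : Disjoint ({αs} ∪ R.image (fun i => αs + i)) (R.image (fun i => αs - i)) := by
    rw [Finset.disjoint_left]
    intro α hα hα'
    simp only [Finset.mem_union, Finset.mem_singleton, Finset.mem_image, hR, Finset.mem_Icc] at hα hα'
    obtain ⟨i, hi, he⟩ := hα'
    rcases hα with rfl | ⟨i', hi', he'⟩ <;> omega
  have hinjA : Set.InjOn (fun i => αs + i) (R : Set ℕ) := fun i _ j _ h => by simpa using h
  have hinjS : Set.InjOn (fun i => αs - i) (R : Set ℕ) := by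
    intro i hi j hj h
    simp only [Finset.coe_Icc, Set.mem_Icc, hR] at hi hj
    have : αs - i = αs - j := h
    omega
  calc (lineW a b d s x αs : ℝ) * (1 + ∑ i ∈ R, 2 * ((1 - 2 / (M : ℝ)) ^ 8) ^ ((i + 1).choose 2))
      = (lineW a b d s x αs : ℝ) +
          (∑ i ∈ R, ((1 - 2 / (M : ℝ)) ^ 8) ^ ((i + 1).choose 2) * lineW a b d s x αs +
            ∑ i ∈ R, ((1 - 2 / (M : ℝ)) ^ 8) ^ ((i + 1).choose 2) * lineW a b d s x αs) := by
        rw [mul_add, mul_one, Finset.mul_sum, ← Finset.sum_add_distrib]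
        congr 1
        exact Finset.sum_congr rfl fun i _ => by ring
    _ ≤ (lineW a b d s x αs : ℝ) +
          (∑ i ∈ R, (lineW a b d s x (αs + i) : ℝ) + ∑ i ∈ R, (lineW a b d s x (αs - i) : ℝ)) := by
        gcongr with i hi i hi
        · exact floorR i hi
        · exact floorL i hi
    _ = ∑ α ∈ ({αs} ∪ R.image (fun i => αs + i) ∪ R.image (fun i => αs - i)), (lineW a b d s x α : ℝ) := by
        rw [Finset.sum_union hd2, Finset.sum_union hd1, Finset.sum_singleton, Finset.sum_image hinjA,
          Finset.sum_image hinjS, add_assoc]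
    _ ≤ ∑ α ∈ Finset.range (a + 1), (lineW a b d s x α : ℝ) :=
        Finset.sum_le_sum_of_subset_of_nonneg hsub fun α _ _ => by positivity

/-- **Second moment about any centre, from below (Chebyshev form).** If every atom is `≤ W(α*)` then for every
real `m` and every `r : ℕ`: `r²·(Σ_{α∈I} W(α) − (2r+1)·W(α*)) ≤ Σ_{α∈I} (α − m)²·W(α)` — at most `2r + 1`
integers lie within distance `< r` of `m`, all other atoms carry `(α − m)² ≥ r²`.
[cite: Durrett2019, Thm. 1.6.4 (Chebyshev's inequality), here in counting form] -/
theorem sq_mul_sub_le_sum_sq_mul_lineW (I : Finset ℕ) (a b d s x αs : ℕ)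
    (hmax : ∀ α, lineW a b d s x α ≤ lineW a b d s x αs) (m : ℝ) (r : ℕ) :
    (r : ℝ) ^ 2 * (∑ α ∈ I, (lineW a b d s x α : ℝ) - (2 * r + 1) * lineW a b d s x αs) ≤
      ∑ α ∈ I, ((α : ℝ) - m) ^ 2 * lineW a b d s x α := by
  classical
  set near := I.filter (fun α : ℕ => |(α : ℝ) - m| < r) with hnear
  set far := I.filter (fun α : ℕ => ¬ |(α : ℝ) - m| < r) with hfar
  have hsplit : ∑ α ∈ I, (lineW a b d s x α : ℝ) =
      ∑ α ∈ near, (lineW a b d s x α : ℝ) + ∑ α ∈ far, (lineW a b d s x α : ℝ) :=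
    (Finset.sum_filter_add_sum_filter_not I _ _).symm
  -- the near set has at most `2r + 1` elements: it lies in an integer interval of that length
  have hcard : near.card ≤ 2 * r + 1 := by
    have hsub : near ⊆ Finset.Icc (⌈m⌉₊ - r) (⌊m⌋₊ + r) := by
      intro α hα
      rw [hnear, Finset.mem_filter] at hα
      obtain ⟨_, hα⟩ := hα
      rw [abs_lt] at hα
      rw [Finset.mem_Icc]
      constructor
      · -- `⌈m⌉ − r ≤ α`
        rcases lt_or_ge m 0 with hm | hm
        · rw [Nat.ceil_eq_zero.2 hm.le]; omega
        · have h1 : (⌈m⌉₊ : ℝ) < m + 1 := Nat.ceil_lt_add_one hm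
          have h3 : ⌈m⌉₊ < α + 1 + r := by
            exact_mod_cast (by linarith [hα.2] : (⌈m⌉₊ : ℝ) < (α : ℝ) + 1 + r)
          omega
      · -- `α ≤ ⌊m⌋ + r`
        rcases lt_or_ge m 0 with hm | hm
        · have : (α : ℝ) < r := by linarith [hα.2]
          have : α < r := by exact_mod_cast this
          omega
        · have h1 : m < (⌊m⌋₊ : ℝ) + 1 := Nat.lt_floor_add_one m
          have h2 : (α : ℝ) < (⌊m⌋₊ : ℝ) + 1 + r := by linarith [hα.1]
          have h3 : α < ⌊m⌋₊ + 1 + r := by exact_mod_cast h2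
          omega
    calc near.card ≤ (Finset.Icc (⌈m⌉₊ - r) (⌊m⌋₊ + r)).card := Finset.card_le_card hsub
      _ = ⌊m⌋₊ + r + 1 - (⌈m⌉₊ - r) := Nat.card_Icc _ _
      _ ≤ 2 * r + 1 := by have := Nat.floor_le_ceil m; omega
  have hW : (0 : ℝ) ≤ lineW a b d s x αs := by positivity
  have hnear_le : ∑ α ∈ near, (lineW a b d s x α : ℝ) ≤ (2 * r + 1) * lineW a b d s x αs := by
    calc ∑ α ∈ near, (lineW a b d s x α : ℝ) ≤ ∑ α ∈ near, (lineW a b d s x αs : ℝ) :=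
          Finset.sum_le_sum fun α _ => by exact_mod_cast hmax α
      _ = near.card * lineW a b d s x αs := by rw [Finset.sum_const, nsmul_eq_mul]
      _ ≤ (2 * r + 1) * lineW a b d s x αs := by
          apply mul_le_mul_of_nonneg_right _ hW; exact_mod_cast hcard
  have hfar_ge : (r : ℝ) ^ 2 * ∑ α ∈ far, (lineW a b d s x α : ℝ) ≤
      ∑ α ∈ far, ((α : ℝ) - m) ^ 2 * lineW a b d s x α := by
    rw [Finset.mul_sum]
    refine Finset.sum_le_sum fun α hα => ?_
    rw [hfar, Finset.mem_filter, not_lt] at hα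
    have hsq : (r : ℝ) ^ 2 ≤ ((α : ℝ) - m) ^ 2 := by
      have hr : (0 : ℝ) ≤ r := by positivity
      calc (r : ℝ) ^ 2 ≤ |(α : ℝ) - m| ^ 2 := pow_le_pow_left₀ hr hα.2 2
        _ = ((α : ℝ) - m) ^ 2 := sq_abs _
    exact mul_le_mul_of_nonneg_right hsq (by positivity)
  have hfar_sub : ∑ α ∈ far, ((α : ℝ) - m) ^ 2 * lineW a b d s x α ≤
      ∑ α ∈ I, ((α : ℝ) - m) ^ 2 * lineW a b d s x α :=
    Finset.sum_le_sum_of_subset_of_nonneg (Finset.filter_subset _ _) fun α _ _ => by positivity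
  rw [hsplit]
  nlinarith [hnear_le, hfar_ge, hfar_sub, sq_nonneg (r : ℝ)]

/-- **The law of total variance, numerator form** (generic; Sedrakyan's Cauchy–Schwarz): for finitely many
components with masses `Z_c > 0`, first moments `A_c` and second moments `S_c`,
`(Σ Z_c)·Σ (S_c − A_c²/Z_c) ≤ (Σ Z_c)(Σ S_c) − (Σ A_c)²` — the variance of a mixture is at least the average
of the component variances (`Var_c = S_c/Z_c − (A_c/Z_c)²`, `Var_mix = ΣS/ΣZ − (ΣA/ΣZ)²`).
[cite: Durrett2019, §4.1 (conditional expectation: the law of total variance); elementary Cauchy–Schwarz] -/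
theorem sum_mul_sum_var_le {κ : Type*} (C : Finset κ) (Z A S : κ → ℝ) (hZ : ∀ c ∈ C, 0 < Z c) :
    (∑ c ∈ C, Z c) * (∑ c ∈ C, (S c - A c ^ 2 / Z c)) ≤
      (∑ c ∈ C, Z c) * (∑ c ∈ C, S c) - (∑ c ∈ C, A c) ^ 2 := by
  -- Sedrakyan: `(Σ A_c)² ≤ (Σ A_c²/Z_c)(Σ Z_c)`
  have cs := Finset.sum_mul_sq_le_sq_mul_sq C (fun c => A c / Real.sqrt (Z c)) (fun c => Real.sqrt (Z c))
  have e1 : ∀ c ∈ C, A c / Real.sqrt (Z c) * Real.sqrt (Z c) = A c := fun c hc =>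
    div_mul_cancel₀ _ (Real.sqrt_pos.2 (hZ c hc)).ne'
  have e2 : ∀ c ∈ C, (A c / Real.sqrt (Z c)) ^ 2 = A c ^ 2 / Z c := fun c hc => by
    rw [div_pow, Real.sq_sqrt (hZ c hc).le]
  have e3 : ∀ c ∈ C, Real.sqrt (Z c) ^ 2 = Z c := fun c hc => Real.sq_sqrt (hZ c hc).le
  rw [Finset.sum_congr rfl e1, Finset.sum_congr rfl e2, Finset.sum_congr rfl e3] at cs
  rw [Finset.sum_sub_distrib, mul_sub]
  nlinarith [cs, Finset.sum_nonneg (fun c (hc : c ∈ C) => (hZ c hc).le)]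

/-! ### §11 (v6) Central moments about the maximiser, bounded by explicit discrete-Gaussian sums

From the sub-Gaussian envelope `W(α* ± i) ≤ q^{C(i,2)}·W(α*)`, `q = (1−1/Y)^{12}` (§6): for every `p`,
`Σ_{i=1}^{a} i^p·W(α*+i) ≤ W(α*)·Σ_{i=1}^{a} i^p q^{C(i,2)}` and the same to the left; hence for `p ≥ 1`
`Σ_{α ≤ a} (α − α*)^{2p}·W(α) ≤ 2·W(α*)·Σ_{i=1}^{a} i^{2p} q^{C(i,2)}`. With the mass floor `Σ W ≥ T_L·W(α*)` of
§10 this bounds every even central moment about the maximiser by `2·G_{2p}(q)/T_L`,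
`G_p(q) = Σ_{i ≤ a} i^p q^{C(i,2)} ≍ Y^{(p+1)/2}` (a finite Gaussian-type sum, left explicit here) — the
fourth-moment input of the (L2) estimates (`E(α−m)⁴ ≤ 8(E(α−α*)⁴ + (α*−m)⁴)`). -/

/-- **Right power sums under the envelope**: `Σ_{i=1}^{a} i^p·W(α*+i) ≤ W(α*)·Σ_{i=1}^{a} i^p·((1−1/Y)^{12})^{C(i,2)}`.
[cite: SaumardWellner2014, Definition 2.8 (arXiv p. 5), §4 (arXiv p. 13)] -/
theorem sum_pow_mul_lineW_add_le (a b d s x αs Y p : ℕ) (ha : a + 2 ≤ Y) (hb : b + 4 ≤ Y) (hd : d + 2 ≤ Y)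
    (hmax : ∀ α, lineW a b d s x α ≤ lineW a b d s x αs) (hpos : 0 < lineW a b d s x αs) :
    ∑ i ∈ Finset.Icc 1 a, (i : ℝ) ^ p * lineW a b d s x (αs + i) ≤
      lineW a b d s x αs * ∑ i ∈ Finset.Icc 1 a, (i : ℝ) ^ p * ((1 - 1 / (Y : ℝ)) ^ 12) ^ (i.choose 2) := by
  rw [Finset.mul_sum]
  refine Finset.sum_le_sum fun i _ => ?_
  have t := lineW_max_add_le a b d s x αs Y ha hb hd hmax hpos i
  have hi : (0 : ℝ) ≤ (i : ℝ) ^ p := by positivity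
  calc (i : ℝ) ^ p * lineW a b d s x (αs + i)
      ≤ (i : ℝ) ^ p * (((1 - 1 / (Y : ℝ)) ^ 12) ^ (i.choose 2) * lineW a b d s x αs) :=
        mul_le_mul_of_nonneg_left t hi
    _ = lineW a b d s x αs * ((i : ℝ) ^ p * ((1 - 1 / (Y : ℝ)) ^ 12) ^ (i.choose 2)) := by ring

/-- **Left power sums under the envelope**: `Σ_{i=1}^{α*} i^p·W(α*−i) ≤ W(α*)·Σ_{i=1}^{α*} i^p·((1−1/Y)^{12})^{C(i,2)}`.
[cite: SaumardWellner2014, Definition 2.8 (arXiv p. 5), §4 (arXiv p. 13)] -/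
theorem sum_pow_mul_lineW_sub_le (a b d s x αs Y p : ℕ) (ha : a + 2 ≤ Y) (hb : b + 4 ≤ Y) (hd : d + 2 ≤ Y)
    (hmax : ∀ α, lineW a b d s x α ≤ lineW a b d s x αs) (hpos : 0 < lineW a b d s x αs) :
    ∑ i ∈ Finset.Icc 1 αs, (i : ℝ) ^ p * lineW a b d s x (αs - i) ≤
      lineW a b d s x αs * ∑ i ∈ Finset.Icc 1 αs, (i : ℝ) ^ p * ((1 - 1 / (Y : ℝ)) ^ 12) ^ (i.choose 2) := by
  rw [Finset.mul_sum]
  refine Finset.sum_le_sum fun i hi => ?_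
  rw [Finset.mem_Icc] at hi
  have t := lineW_max_sub_le a b d s x αs Y ha hb hd hmax hpos (i := i) hi.2
  have hi' : (0 : ℝ) ≤ (i : ℝ) ^ p := by positivity
  calc (i : ℝ) ^ p * lineW a b d s x (αs - i)
      ≤ (i : ℝ) ^ p * (((1 - 1 / (Y : ℝ)) ^ 12) ^ (i.choose 2) * lineW a b d s x αs) :=
        mul_le_mul_of_nonneg_left t hi'
    _ = lineW a b d s x αs * ((i : ℝ) ^ p * ((1 - 1 / (Y : ℝ)) ^ 12) ^ (i.choose 2)) := by ring

/-- **Even central moments about the maximiser**: for `p ≥ 1` and a maximiser `α* ≤ a`,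
`Σ_{α ≤ a} (α − α*)^{2p}·W(α) ≤ 2·W(α*)·Σ_{i=1}^{a} i^{2p}·((1−1/Y)^{12})^{C(i,2)}` — divide by the mass floor
`Σ W ≥ T_L·W(α*)` of `lineW_mode_mul_floorSum_le_sum` for the `2p`-th central moment.
[cite: SaumardWellner2014, Definition 2.8 (arXiv p. 5), §4 (arXiv p. 13)] -/
theorem sum_even_pow_sub_mul_lineW_le (a b d s x αs Y p : ℕ) (hp : 1 ≤ p) (ha : a + 2 ≤ Y) (hb : b + 4 ≤ Y)
    (hd : d + 2 ≤ Y) (hmax : ∀ α, lineW a b d s x α ≤ lineW a b d s x αs) (hpos : 0 < lineW a b d s x αs)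
    (hαs : αs ≤ a) :
    ∑ α ∈ Finset.range (a + 1), ((α : ℝ) - αs) ^ (2 * p) * lineW a b d s x α ≤
      2 * lineW a b d s x αs *
        ∑ i ∈ Finset.Icc 1 a, (i : ℝ) ^ (2 * p) * ((1 - 1 / (Y : ℝ)) ^ 12) ^ (i.choose 2) := by
  classical
  have hY : (1 : ℝ) ≤ Y := by exact_mod_cast (show 1 ≤ Y by omega)
  have hq : (0 : ℝ) ≤ (1 - 1 / (Y : ℝ)) ^ 12 := by
    apply pow_nonneg
    have : 1 / (Y : ℝ) ≤ 1 := by rw [div_le_one (by linarith)]; exact hY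
    linarith
  set f : ℕ → ℝ := fun α => ((α : ℝ) - αs) ^ (2 * p) * lineW a b d s x α with hf
  set g : ℕ → ℝ := fun i => (i : ℝ) ^ (2 * p) * ((1 - 1 / (Y : ℝ)) ^ 12) ^ (i.choose 2) with hg
  have hg0 : ∀ i, 0 ≤ g i := fun i => by simp only [hg]; positivity
  -- split `range (a+1) = Ico 0 αs ∪ {αs} ∪ Ico (αs+1) (a+1)`
  have hsplit : ∑ α ∈ Finset.range (a + 1), f α =
      ∑ α ∈ Finset.Ico 0 αs, f α + f αs + ∑ α ∈ Finset.Ico (αs + 1) (a + 1), f α := by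
    rw [Finset.range_eq_Ico, ← Finset.sum_Ico_consecutive f (Nat.zero_le αs) (by omega : αs ≤ a + 1),
      Finset.sum_eq_sum_Ico_succ_bot (by omega : αs < a + 1), add_assoc]
  have hmid : f αs = 0 := by
    simp only [hf, sub_self]
    rw [zero_pow (by omega), zero_mul]
  -- left block: reindex `α = αs − i`, `i ∈ Icc 1 αs`
  have hleft : ∑ α ∈ Finset.Ico 0 αs, f α = ∑ i ∈ Finset.Icc 1 αs, (i : ℝ) ^ (2 * p) * lineW a b d s x (αs - i) := by
    refine Finset.sum_nbij' (fun α => αs - α) (fun i => αs - i) ?_ ?_ ?_ ?_ ?_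
    · intro α hα; rw [Finset.mem_Ico] at hα; rw [Finset.mem_Icc]; omega
    · intro i hi; rw [Finset.mem_Icc] at hi; rw [Finset.mem_Ico]; omega
    · intro α hα; rw [Finset.mem_Ico] at hα; show αs - (αs - α) = α; omega
    · intro i hi; rw [Finset.mem_Icc] at hi; show αs - (αs - i) = i; omega
    · intro α hα
      rw [Finset.mem_Ico] at hα
      simp only [hf]
      have e1 : αs - (αs - α) = α := by omega
      have e2 : ((α : ℝ) - αs) ^ (2 * p) = (((αs - α : ℕ) : ℝ)) ^ (2 * p) := by
        rw [Nat.cast_sub (by omega : α ≤ αs), pow_mul, pow_mul, ← neg_sub, neg_sq]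
      rw [e1, e2]
  -- right block: reindex `α = αs + i`, `i ∈ Icc 1 (a − αs)`
  have hright : ∑ α ∈ Finset.Ico (αs + 1) (a + 1), f α =
      ∑ i ∈ Finset.Icc 1 (a - αs), (i : ℝ) ^ (2 * p) * lineW a b d s x (αs + i) := by
    refine Finset.sum_nbij' (fun α => α - αs) (fun i => αs + i) ?_ ?_ ?_ ?_ ?_
    · intro α hα; rw [Finset.mem_Ico] at hα; rw [Finset.mem_Icc]; omega
    · intro i hi; rw [Finset.mem_Icc] at hi; rw [Finset.mem_Ico]; omega
    · intro α hα; rw [Finset.mem_Ico] at hα; show αs + (α - αs) = α; omega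
    · intro i hi; show αs + i - αs = i; omega
    · intro α hα
      rw [Finset.mem_Ico] at hα
      simp only [hf]
      have e1 : αs + (α - αs) = α := by omega
      have e2 : ((α : ℝ) - αs) ^ (2 * p) = (((α - αs : ℕ) : ℝ)) ^ (2 * p) := by
        rw [Nat.cast_sub (by omega : αs ≤ α)]
      rw [e1, e2]
  have L := sum_pow_mul_lineW_sub_le a b d s x αs Y (2 * p) ha hb hd hmax hpos
  have R := sum_pow_mul_lineW_add_le a b d s x αs Y (2 * p) ha hb hd hmax hpos
  have hW : (0 : ℝ) ≤ lineW a b d s x αs := by positivity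
  -- compare the index ranges with `Icc 1 a`
  have hL' : lineW a b d s x αs * ∑ i ∈ Finset.Icc 1 αs, g i ≤ lineW a b d s x αs * ∑ i ∈ Finset.Icc 1 a, g i := by
    apply mul_le_mul_of_nonneg_left _ hW
    exact Finset.sum_le_sum_of_subset_of_nonneg (Finset.Icc_subset_Icc_right hαs) fun i _ _ => hg0 i
  have hR' : ∑ i ∈ Finset.Icc 1 (a - αs), (i : ℝ) ^ (2 * p) * lineW a b d s x (αs + i) ≤
      ∑ i ∈ Finset.Icc 1 a, (i : ℝ) ^ (2 * p) * lineW a b d s x (αs + i) :=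
    Finset.sum_le_sum_of_subset_of_nonneg (Finset.Icc_subset_Icc_right (Nat.sub_le a αs))
      fun i _ _ => by positivity
  rw [hsplit, hmid, add_zero, hleft, hright]
  calc ∑ i ∈ Finset.Icc 1 αs, (i : ℝ) ^ (2 * p) * lineW a b d s x (αs - i) +
        ∑ i ∈ Finset.Icc 1 (a - αs), (i : ℝ) ^ (2 * p) * lineW a b d s x (αs + i)
      ≤ lineW a b d s x αs * ∑ i ∈ Finset.Icc 1 a, g i + lineW a b d s x αs * ∑ i ∈ Finset.Icc 1 a, g i :=
        add_le_add (L.trans hL') (hR'.trans R)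
    _ = 2 * lineW a b d s x αs * ∑ i ∈ Finset.Icc 1 a, g i := by ring

/-! ### §12 (v6) Closed form for the discrete Gaussian-type sums `Σ_i i^p q^{C(i,2)}`

Block the sum at `B`: the first `B` terms are each `≤ B^p`; for `i > B`, `C(i,2) ≥ B·(i−B)` makes the tail a
geometric series in `ρ = q^B ≤ (1−δ)^B ≤ 1/(1+Bδ)` (Bernoulli), and `j^p ≤ p!·C(j+p,p)` turns `Σ_j j^p ρ^j` into
the binomial series `Σ_j C(j+p,p)ρ^j ≤ 1/(1−ρ)^{p+1} ≤ (1 + 1/(Bδ))^{p+1}`. With `δ = 1/Y`, `B = ⌈√Y⌉`: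
`Σ_{i ≤ K} i^p ((1−1/Y)^{12})^{C(i,2)} ≤ (1 + 2^p(1 + p!))·(√Y + 1)^{p+1}` — the order `Y^{(p+1)/2}` of a Gaussian
moment of variance `≍ Y`, in closed form (prover g26's ask of 2026-08-28T23:00Z: «elementary closed form,
block at B ≍ √Y»). -/

/-- Bernoulli in reciprocal form: for `0 ≤ δ ≤ 1`, `(1 − δ)^B ≤ 1/(1 + B·δ)`. [folklore] -/
private theorem one_sub_pow_le_inv (δ : ℝ) (hδ0 : 0 ≤ δ) (hδ1 : δ ≤ 1) (B : ℕ) :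
    (1 - δ) ^ B ≤ 1 / (1 + B * δ) := by
  have h1 : 1 + (B : ℝ) * δ ≤ (1 + δ) ^ B := one_add_mul_le_pow (by linarith) B
  have h2 : (1 - δ) ^ B * (1 + δ) ^ B ≤ 1 := by
    rw [← mul_pow]
    have : (1 - δ) * (1 + δ) ≤ 1 := by nlinarith
    exact pow_le_one₀ (by nlinarith) this
  have hpos : 0 < 1 + (B : ℝ) * δ := by positivity
  rw [le_div_iff₀ hpos]
  calc (1 - δ) ^ B * (1 + B * δ) ≤ (1 - δ) ^ B * (1 + δ) ^ B :=
        mul_le_mul_of_nonneg_left h1 (pow_nonneg (by linarith) _)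
    _ ≤ 1 := h2

/-- `C(i,2) ≥ B·(i − B)` for `B ≤ i`. [folklore] -/
private theorem mul_sub_le_choose_two {B i : ℕ} (h : B ≤ i) : B * (i - B) ≤ i.choose 2 := by
  obtain ⟨j, rfl⟩ : ∃ j, i = B + j := ⟨i - B, by omega⟩
  rw [Nat.add_sub_cancel_left, Nat.choose_two_right]
  -- `2·B·j ≤ (B+j)(B+j−1)`, i.e. `0 ≤ B(B−1) + j(j−1)`
  apply (Nat.le_div_iff_mul_le (by norm_num)).2
  rcases Nat.eq_zero_or_pos (B + j) with h0 | h0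
  · have : B = 0 := by omega
    subst this; simp
  · have hcast : ((B + j - 1 : ℕ) : ℤ) = (B : ℤ) + j - 1 := by
      rw [Nat.cast_sub (by omega)]; push_cast; ring
    have hB' : (0 : ℤ) ≤ (B : ℤ) * ((B : ℤ) - 1) := by
      rcases Nat.eq_zero_or_pos B with hB | hB
      · subst hB; simp
      · have : (1 : ℤ) ≤ B := by exact_mod_cast hB
        nlinarith
    have hj' : (0 : ℤ) ≤ (j : ℤ) * ((j : ℤ) - 1) := by
      rcases Nat.eq_zero_or_pos j with hj | hj
      · subst hj; simp
      · have : (1 : ℤ) ≤ j := by exact_mod_cast hj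
        nlinarith
    have key : ((B * j * 2 : ℕ) : ℤ) ≤ (((B + j) * (B + j - 1) : ℕ) : ℤ) := by
      push_cast [hcast]
      nlinarith [hB', hj']
    exact_mod_cast key

/-- `j^p ≤ p!·C(j+p,p)` (`= (j+1)(j+2)⋯(j+p)`). [folklore] -/
private theorem pow_le_factorial_mul_choose (j p : ℕ) : j ^ p ≤ p.factorial * (j + p).choose p := by
  calc j ^ p ≤ (j + 1) ^ p := Nat.pow_le_pow_left (by omega) p
    _ ≤ (j + 1).ascFactorial p := Nat.pow_succ_le_ascFactorial (j + 1) p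
    _ = p.factorial * (j + p).choose p := Nat.ascFactorial_eq_factorial_mul_choose j p

/-- **Discrete Gaussian-type sums, blocked form.** For `0 ≤ q ≤ 1 − δ`, `0 < δ ≤ 1`, `B ≥ 1` and all `K, p`:
`Σ_{i=1}^{K} i^p·q^{C(i,2)} ≤ B^{p+1} + 2^p·(B^p/(Bδ) + p!·(1 + 1/(Bδ))^{p+1})`.
[cite: SaumardWellner2014, Definition 2.8 (arXiv p. 5) (the Gaussian comparison); elementary] -/
theorem sum_pow_mul_pow_choose_two_le (q δ : ℝ) (hq0 : 0 ≤ q) (hqδ : q ≤ 1 - δ) (hδ0 : 0 < δ) (hδ1 : δ ≤ 1)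
    (B K p : ℕ) (hB : 1 ≤ B) :
    ∑ i ∈ Finset.Icc 1 K, (i : ℝ) ^ p * q ^ (i.choose 2) ≤
      (B : ℝ) ^ (p + 1) + 2 ^ p * ((B : ℝ) ^ p / (B * δ) + p.factorial * (1 + 1 / (B * δ)) ^ (p + 1)) := by
  classical
  have hq1 : q ≤ 1 := by linarith
  have hBδ : 0 < (B : ℝ) * δ := by positivity
  -- the geometric ratio of the tail and its Bernoulli bound
  set ρ : ℝ := q ^ B with hρ
  have hρ0 : 0 ≤ ρ := pow_nonneg hq0 _
  have hρle : ρ ≤ 1 / (1 + B * δ) :=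
    (pow_le_pow_left₀ hq0 hqδ B).trans (one_sub_pow_le_inv δ hδ0.le hδ1 B)
  have hρ1 : ρ < 1 := by
    have : 1 / (1 + (B : ℝ) * δ) < 1 := by rw [div_lt_one (by positivity)]; linarith
    linarith
  have hinv : 1 / (1 - ρ) ≤ 1 + 1 / (B * δ) := by
    -- `ρ ≤ 1/(1+Bδ)` ⇒ `1 − ρ ≥ Bδ/(1+Bδ)`
    have h1 : B * δ / (1 + B * δ) ≤ 1 - ρ := by
      have e : (B : ℝ) * δ / (1 + B * δ) = 1 - 1 / (1 + B * δ) := by field_simp; ring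
      rw [e]; linarith
    have h2 : 0 < (B : ℝ) * δ / (1 + B * δ) := by positivity
    calc 1 / (1 - ρ) ≤ 1 / (B * δ / (1 + B * δ)) := one_div_le_one_div_of_le h2 h1
      _ = 1 + 1 / (B * δ) := by field_simp; ring
  -- split the index set at `B`
  set head := (Finset.Icc 1 K).filter (fun i => i ≤ B) with hhead
  set tail := (Finset.Icc 1 K).filter (fun i => ¬ i ≤ B) with htail
  have hsplit : ∑ i ∈ Finset.Icc 1 K, (i : ℝ) ^ p * q ^ (i.choose 2) =
      ∑ i ∈ head, (i : ℝ) ^ p * q ^ (i.choose 2) + ∑ i ∈ tail, (i : ℝ) ^ p * q ^ (i.choose 2) :=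
    (Finset.sum_filter_add_sum_filter_not _ _ _).symm
  -- head: at most `B` terms, each `≤ B^p`
  have hH : ∑ i ∈ head, (i : ℝ) ^ p * q ^ (i.choose 2) ≤ (B : ℝ) ^ (p + 1) := by
    have each : ∀ i ∈ head, (i : ℝ) ^ p * q ^ (i.choose 2) ≤ (B : ℝ) ^ p := by
      intro i hi
      rw [hhead, Finset.mem_filter] at hi
      have h1 : (i : ℝ) ^ p ≤ (B : ℝ) ^ p := pow_le_pow_left₀ (by positivity) (by exact_mod_cast hi.2) p
      have h2 : q ^ (i.choose 2) ≤ 1 := pow_le_one₀ hq0 hq1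
      calc (i : ℝ) ^ p * q ^ (i.choose 2) ≤ (B : ℝ) ^ p * 1 :=
            mul_le_mul h1 h2 (pow_nonneg hq0 _) (by positivity)
        _ = (B : ℝ) ^ p := mul_one _
    have hcard : head.card ≤ B := by
      calc head.card ≤ (Finset.Icc 1 B).card := Finset.card_le_card (fun i hi => by
            rw [hhead, Finset.mem_filter, Finset.mem_Icc] at hi; rw [Finset.mem_Icc]; omega)
        _ = B := by simp
    calc ∑ i ∈ head, (i : ℝ) ^ p * q ^ (i.choose 2) ≤ ∑ i ∈ head, (B : ℝ) ^ p := Finset.sum_le_sum each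
      _ = head.card * (B : ℝ) ^ p := by rw [Finset.sum_const, nsmul_eq_mul]
      _ ≤ B * (B : ℝ) ^ p := by gcongr
      _ = (B : ℝ) ^ (p + 1) := by ring
  -- tail: reindex `i = B + j`, `j ∈ Icc 1 (K − B)`
  have hT1 : ∑ i ∈ tail, (i : ℝ) ^ p * q ^ (i.choose 2) =
      ∑ j ∈ Finset.Icc 1 (K - B), ((B + j : ℕ) : ℝ) ^ p * q ^ ((B + j).choose 2) := by
    refine Finset.sum_nbij' (fun i => i - B) (fun j => B + j) ?_ ?_ ?_ ?_ ?_
    · intro i hi; rw [htail, Finset.mem_filter, Finset.mem_Icc] at hi; rw [Finset.mem_Icc]; omega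
    · intro j hj; rw [Finset.mem_Icc] at hj; rw [htail, Finset.mem_filter, Finset.mem_Icc]; omega
    · intro i hi; rw [htail, Finset.mem_filter] at hi; show B + (i - B) = i; omega
    · intro j hj; show B + j - B = j; omega
    · intro i hi
      rw [htail, Finset.mem_filter] at hi
      have e : B + (i - B) = i := by omega
      rw [e]
  -- termwise bound on the tail
  have hterm : ∀ j ∈ Finset.Icc 1 (K - B), ((B + j : ℕ) : ℝ) ^ p * q ^ ((B + j).choose 2) ≤
      2 ^ p * ((B : ℝ) ^ p * ρ ^ j + (p.factorial : ℝ) * ((j + p).choose p : ℝ) * ρ ^ j) := by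
    intro j hj
    rw [Finset.mem_Icc] at hj
    -- `q^{C(B+j,2)} ≤ ρ^j`
    have hexp : q ^ ((B + j).choose 2) ≤ ρ ^ j := by
      have hle : B * j ≤ (B + j).choose 2 := by
        have := mul_sub_le_choose_two (B := B) (i := B + j) (by omega)
        rwa [Nat.add_sub_cancel_left] at this
      calc q ^ ((B + j).choose 2) ≤ q ^ (B * j) := pow_le_pow_of_le_one hq0 hq1 hle
        _ = ρ ^ j := by rw [pow_mul]
    -- `(B+j)^p ≤ 2^p (B^p + j^p)` and `j^p ≤ p!·C(j+p,p)`
    have hpow : ((B + j : ℕ) : ℝ) ^ p ≤ 2 ^ p * ((B : ℝ) ^ p + (p.factorial : ℝ) * ((j + p).choose p : ℝ)) := by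
      have hm : ((B + j : ℕ) : ℝ) ≤ 2 * max (B : ℝ) (j : ℝ) := by
        push_cast
        have h1 := le_max_left (B : ℝ) (j : ℝ)
        have h2 := le_max_right (B : ℝ) (j : ℝ)
        linarith
      have hmax : (max (B : ℝ) (j : ℝ)) ^ p ≤ (B : ℝ) ^ p + (j : ℝ) ^ p := by
        rcases le_total (B : ℝ) (j : ℝ) with h | h
        · rw [max_eq_right h]; have : (0 : ℝ) ≤ (B : ℝ) ^ p := by positivity
          linarith
        · rw [max_eq_left h]; have : (0 : ℝ) ≤ (j : ℝ) ^ p := by positivity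
          linarith
      have hj : (j : ℝ) ^ p ≤ (p.factorial : ℝ) * ((j + p).choose p : ℝ) := by
        exact_mod_cast pow_le_factorial_mul_choose j p
      calc ((B + j : ℕ) : ℝ) ^ p ≤ (2 * max (B : ℝ) (j : ℝ)) ^ p := pow_le_pow_left₀ (by positivity) hm p
        _ = 2 ^ p * (max (B : ℝ) (j : ℝ)) ^ p := mul_pow _ _ _
        _ ≤ 2 ^ p * ((B : ℝ) ^ p + (j : ℝ) ^ p) := by gcongr
        _ ≤ 2 ^ p * ((B : ℝ) ^ p + (p.factorial : ℝ) * ((j + p).choose p : ℝ)) := by gcongr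
    calc ((B + j : ℕ) : ℝ) ^ p * q ^ ((B + j).choose 2)
        ≤ (2 ^ p * ((B : ℝ) ^ p + (p.factorial : ℝ) * ((j + p).choose p : ℝ))) * ρ ^ j :=
          mul_le_mul hpow hexp (pow_nonneg hq0 _) (by positivity)
      _ = 2 ^ p * ((B : ℝ) ^ p * ρ ^ j + (p.factorial : ℝ) * ((j + p).choose p : ℝ) * ρ ^ j) := by ring
  -- the two series bounds
  have hgeo : ∑ j ∈ Finset.Icc 1 (K - B), ρ ^ j ≤ 1 / (B * δ) := by
    -- `Σ_{j=1}^{n} ρ^j = ρ·Σ_{j<n} ρ^j ≤ ρ/(1−ρ) = 1/(1−ρ) − 1`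
    have hs : ∑ j ∈ Finset.Icc 1 (K - B), ρ ^ j = ρ * ∑ j ∈ Finset.range (K - B), ρ ^ j := by
      rw [Finset.mul_sum]
      refine Finset.sum_nbij' (fun j => j - 1) (fun j => j + 1) ?_ ?_ ?_ ?_ ?_
      · intro j hj; rw [Finset.mem_Icc] at hj; rw [Finset.mem_range]; omega
      · intro j hj; rw [Finset.mem_range] at hj; rw [Finset.mem_Icc]; omega
      · intro j hj; rw [Finset.mem_Icc] at hj; show j - 1 + 1 = j; omega
      · intro j hj; show j + 1 - 1 = j; omega
      · intro j hj
        rw [Finset.mem_Icc] at hj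
        have e : j = (j - 1) + 1 := by omega
        conv_lhs => rw [e]
        rw [pow_succ]; ring
    have hg : ∑ j ∈ Finset.range (K - B), ρ ^ j ≤ 1 / (1 - ρ) := by
      rw [one_div]
      exact sum_le_hasSum _ (fun j _ => pow_nonneg hρ0 _) (hasSum_geometric_of_lt_one hρ0 hρ1)
    rw [hs]
    have h1 : ρ * ∑ j ∈ Finset.range (K - B), ρ ^ j ≤ ρ * (1 / (1 - ρ)) := mul_le_mul_of_nonneg_left hg hρ0
    have hne : (1 : ℝ) - ρ ≠ 0 := by linarith
    have h2 : ρ * (1 / (1 - ρ)) = 1 / (1 - ρ) - 1 := by field_simp; ring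
    linarith [h1, h2, hinv]
  have hbin : ∑ j ∈ Finset.Icc 1 (K - B), ((j + p).choose p : ℝ) * ρ ^ j ≤ (1 + 1 / (B * δ)) ^ (p + 1) := by
    have hsum := hasSum_choose_mul_geometric_of_norm_lt_one p (r := ρ) (by rw [Real.norm_eq_abs, abs_of_nonneg hρ0]; exact hρ1)
    have hle : ∑ j ∈ Finset.Icc 1 (K - B), ((j + p).choose p : ℝ) * ρ ^ j ≤ 1 / (1 - ρ) ^ (p + 1) :=
      sum_le_hasSum _ (fun j _ => by positivity) hsum
    calc ∑ j ∈ Finset.Icc 1 (K - B), ((j + p).choose p : ℝ) * ρ ^ j ≤ 1 / (1 - ρ) ^ (p + 1) := hle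
      _ = (1 / (1 - ρ)) ^ (p + 1) := by rw [one_div_pow]
      _ ≤ (1 + 1 / (B * δ)) ^ (p + 1) := pow_le_pow_left₀ (by positivity) hinv _
  -- assemble
  have hT : ∑ i ∈ tail, (i : ℝ) ^ p * q ^ (i.choose 2) ≤
      2 ^ p * ((B : ℝ) ^ p / (B * δ) + p.factorial * (1 + 1 / (B * δ)) ^ (p + 1)) := by
    rw [hT1]
    calc ∑ j ∈ Finset.Icc 1 (K - B), ((B + j : ℕ) : ℝ) ^ p * q ^ ((B + j).choose 2)
        ≤ ∑ j ∈ Finset.Icc 1 (K - B),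
            2 ^ p * ((B : ℝ) ^ p * ρ ^ j + (p.factorial : ℝ) * ((j + p).choose p : ℝ) * ρ ^ j) :=
          Finset.sum_le_sum hterm
      _ = 2 ^ p * ((B : ℝ) ^ p * ∑ j ∈ Finset.Icc 1 (K - B), ρ ^ j +
            (p.factorial : ℝ) * ∑ j ∈ Finset.Icc 1 (K - B), ((j + p).choose p : ℝ) * ρ ^ j) := by
          rw [← Finset.mul_sum, Finset.sum_add_distrib, Finset.mul_sum, Finset.mul_sum]
          congr 1; congr 1
          exact Finset.sum_congr rfl fun j _ => by ring
      _ ≤ 2 ^ p * ((B : ℝ) ^ p * (1 / (B * δ)) + (p.factorial : ℝ) * (1 + 1 / (B * δ)) ^ (p + 1)) := by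
          gcongr
      _ = 2 ^ p * ((B : ℝ) ^ p / (B * δ) + p.factorial * (1 + 1 / (B * δ)) ^ (p + 1)) := by ring
  rw [hsplit]
  exact add_le_add hH hT

/-- **Closed form for the envelope sums**: for `Y ≥ 1` and all `K, p`,
`Σ_{i=1}^{K} i^p·((1−1/Y)^{12})^{C(i,2)} ≤ (1 + 2^p(1 + p!))·(√Y + 1)^{p+1}` (block at `B = ⌈√Y⌉`).
[cite: SaumardWellner2014, Definition 2.8 (arXiv p. 5); elementary] -/
theorem gaussSum_pow_le (Y : ℕ) (hY : 1 ≤ Y) (K p : ℕ) :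
    ∑ i ∈ Finset.Icc 1 K, (i : ℝ) ^ p * ((1 - 1 / (Y : ℝ)) ^ 12) ^ (i.choose 2) ≤
      (1 + 2 ^ p * (1 + p.factorial)) * (Real.sqrt Y + 1) ^ (p + 1) := by
  have hY' : (1 : ℝ) ≤ Y := by exact_mod_cast hY
  have hYpos : (0 : ℝ) < Y := by linarith
  set δ : ℝ := 1 / Y with hδ
  have hδ0 : 0 < δ := by positivity
  have hδ1 : δ ≤ 1 := by rw [hδ, div_le_one hYpos]; exact hY'
  have hq0 : (0 : ℝ) ≤ (1 - 1 / (Y : ℝ)) ^ 12 := pow_nonneg (by rw [← hδ]; linarith) _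
  have hqδ : (1 - 1 / (Y : ℝ)) ^ 12 ≤ 1 - δ := by
    rw [← hδ]
    calc (1 - δ) ^ 12 ≤ (1 - δ) ^ 1 := pow_le_pow_of_le_one (by linarith) (by linarith) (by norm_num)
      _ = 1 - δ := pow_one _
  set B : ℕ := ⌈Real.sqrt Y⌉₊ with hB
  have hsqrt1 : (1 : ℝ) ≤ Real.sqrt Y := by rw [← Real.sqrt_one]; exact Real.sqrt_le_sqrt hY'
  have hB1 : 1 ≤ B := by
    rw [hB]; exact Nat.one_le_ceil_iff.2 (by linarith)
  have hBge : Real.sqrt Y ≤ (B : ℝ) := Nat.le_ceil _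
  have hBle : (B : ℝ) ≤ Real.sqrt Y + 1 := by
    have := Nat.ceil_lt_add_one (Real.sqrt_nonneg (Y : ℝ)); rw [← hB] at this; linarith
  have t := sum_pow_mul_pow_choose_two_le _ δ hq0 hqδ hδ0 hδ1 B K p hB1
  -- `1/(Bδ) = Y/B ≤ √Y`
  have hinv : 1 / ((B : ℝ) * δ) ≤ Real.sqrt Y := by
    rw [hδ, div_le_iff₀ (by positivity)]
    have hsq : (Y : ℝ) = Real.sqrt Y * Real.sqrt Y := (Real.mul_self_sqrt hYpos.le).symm
    calc (1 : ℝ) = (Y : ℝ) * (1 / Y) := by field_simp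
      _ = Real.sqrt Y * Real.sqrt Y * (1 / Y) := by rw [← hsq]
      _ ≤ Real.sqrt Y * B * (1 / Y) := by gcongr
      _ = Real.sqrt Y * (B * (1 / Y)) := by ring
  set S := Real.sqrt (Y : ℝ) with hS
  have hS0 : 0 ≤ S := Real.sqrt_nonneg _
  have hfac : (0 : ℝ) ≤ p.factorial := by positivity
  -- bound each piece by powers of `S + 1`
  have e1 : (B : ℝ) ^ (p + 1) ≤ (S + 1) ^ (p + 1) := pow_le_pow_left₀ (by positivity) hBle _
  have e2 : (B : ℝ) ^ p / (B * δ) ≤ (S + 1) ^ (p + 1) := by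
    rw [div_eq_mul_one_div]
    calc (B : ℝ) ^ p * (1 / (B * δ)) ≤ (S + 1) ^ p * S :=
          mul_le_mul (pow_le_pow_left₀ (by positivity) hBle _) hinv (by positivity) (by positivity)
      _ ≤ (S + 1) ^ p * (S + 1) := by gcongr; linarith
      _ = (S + 1) ^ (p + 1) := by ring
  have e3 : (1 + 1 / ((B : ℝ) * δ)) ^ (p + 1) ≤ (S + 1) ^ (p + 1) :=
    pow_le_pow_left₀ (by positivity) (by linarith) _
  calc ∑ i ∈ Finset.Icc 1 K, (i : ℝ) ^ p * ((1 - 1 / (Y : ℝ)) ^ 12) ^ (i.choose 2)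
      ≤ (B : ℝ) ^ (p + 1) + 2 ^ p * ((B : ℝ) ^ p / (B * δ) + p.factorial * (1 + 1 / (B * δ)) ^ (p + 1)) := t
    _ ≤ (S + 1) ^ (p + 1) + 2 ^ p * ((S + 1) ^ (p + 1) + p.factorial * (S + 1) ^ (p + 1)) := by
        gcongr
    _ = (1 + 2 ^ p * (1 + p.factorial)) * (S + 1) ^ (p + 1) := by ring

/-- **Even central moments about the maximiser, closed form**: for `p ≥ 1`, `a + 2, b + 4, d + 2 ≤ Y` and a
maximiser `α* ≤ a` with `W(α*) > 0`:
`Σ_{α ≤ a} (α − α*)^{2p}·W(α) ≤ 2·(1 + 4^p(1 + (2p)!))·(√Y + 1)^{2p+1}·W(α*)` — with the mass floor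
`Σ W ≥ T_L·W(α*)` (`T_L ≍ √M`) the `2p`-th central moment is `≤ C_p·Y^p·√(Y/M)`, in particular
`E(α − α*)⁴ ≤ C·(Y/M)^{1/2}·Y² = C(β)·N²`. [cite: SaumardWellner2014, Definition 2.8 (arXiv p. 5), §4 (arXiv p. 13)] -/
theorem sum_even_pow_sub_mul_lineW_le_closed (a b d s x αs Y p : ℕ) (hp : 1 ≤ p) (ha : a + 2 ≤ Y)
    (hb : b + 4 ≤ Y) (hd : d + 2 ≤ Y) (hmax : ∀ α, lineW a b d s x α ≤ lineW a b d s x αs)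
    (hpos : 0 < lineW a b d s x αs) (hαs : αs ≤ a) :
    ∑ α ∈ Finset.range (a + 1), ((α : ℝ) - αs) ^ (2 * p) * lineW a b d s x α ≤
      2 * ((1 + 2 ^ (2 * p) * (1 + (2 * p).factorial)) * (Real.sqrt Y + 1) ^ (2 * p + 1)) *
        lineW a b d s x αs := by
  have t := sum_even_pow_sub_mul_lineW_le a b d s x αs Y p hp ha hb hd hmax hpos hαs
  have g := gaussSum_pow_le Y (by omega) a (2 * p)
  have hW : (0 : ℝ) ≤ lineW a b d s x αs := by positivity
  calc ∑ α ∈ Finset.range (a + 1), ((α : ℝ) - αs) ^ (2 * p) * lineW a b d s x α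
      ≤ 2 * lineW a b d s x αs *
          ∑ i ∈ Finset.Icc 1 a, (i : ℝ) ^ (2 * p) * ((1 - 1 / (Y : ℝ)) ^ 12) ^ (i.choose 2) := t
    _ ≤ 2 * lineW a b d s x αs * ((1 + 2 ^ (2 * p) * (1 + (2 * p).factorial)) * (Real.sqrt Y + 1) ^ (2 * p + 1)) :=
        mul_le_mul_of_nonneg_left g (by positivity)
    _ = 2 * ((1 + 2 ^ (2 * p) * (1 + (2 * p).factorial)) * (Real.sqrt Y + 1) ^ (2 * p + 1)) *
        lineW a b d s x αs := by ring

/-! ### §13 (v7) The variance CEILING in closed form; the bias–variance (Steiner) decomposition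

The companion of §10's floor. For any weights `w` and any real centre `c` (division-free Steiner identity,
[Durrett2019, §1.6.3 (1.6.2)–(1.6.4)]): `(Σ w)·Σ (α−c)²w = ((Σ w)(Σ α²w) − (Σ αw)²) + (Σ αw − c·Σ w)²`, so the
variance numerator `(Σ w)(Σ α²w) − (Σ αw)²` is at most `(Σ w)·Σ (α−c)²w` for EVERY centre — in particular for the
maximiser `c = α*`, where §12 gives `Σ_{α≤a} (α−α*)²W ≤ 26(√Y+1)³·W(α*)` (`p = 1`: `2(1 + 4·(1 + 2!)) = 26`). With a
mass floor `T·W(α*) ≤ Σ W` (§10: `T = T_L = 1 + 2Σ_{i≤L}((1−2/M)^8)^{C(i+1,2)}`): **`Var ≤ 26(√Y+1)³/T`**, the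
«`Var(n_A | x) ≤ C·a`» input of prover MEMO-29 §3b (B1) (`Y ≍ N`, `T_L ≍ √M ≍ √N` for `L ≍ √M`: `Var ≤ C(β)·N`). -/

/-- **Steiner / bias–variance decomposition, division-free**: for any real weights `w` and any real centre `c`,
`(Σ w)·Σ (α − c)²·w = ((Σ w)(Σ α²w) − (Σ αw)²) + (Σ αw − c·Σ w)²`. After division by `(Σ w)²`:
`E(α − c)² = Var(α) + (E α − c)²`. [cite: Durrett2019, §1.6.3 (1.6.2)–(1.6.4) (PDF pp. 69–70)] -/
theorem sum_mul_sum_sq_sub_mul_eq (I : Finset ℕ) (w : ℕ → ℝ) (c : ℝ) :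
    (∑ α ∈ I, w α) * (∑ α ∈ I, ((α : ℝ) - c) ^ 2 * w α) =
      ((∑ α ∈ I, w α) * (∑ α ∈ I, (α : ℝ) ^ 2 * w α) - (∑ α ∈ I, (α : ℝ) * w α) ^ 2) +
        ((∑ α ∈ I, (α : ℝ) * w α) - c * ∑ α ∈ I, w α) ^ 2 := by
  have h : ∑ α ∈ I, ((α : ℝ) - c) ^ 2 * w α =
      ∑ α ∈ I, (α : ℝ) ^ 2 * w α - 2 * c * ∑ α ∈ I, (α : ℝ) * w α + c ^ 2 * ∑ α ∈ I, w α := by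
    rw [Finset.mul_sum, Finset.mul_sum, ← Finset.sum_sub_distrib, ← Finset.sum_add_distrib]
    exact Finset.sum_congr rfl fun α _ => by ring
  rw [h]; ring

/-- **The variance numerator is at most `(Σ w)` times the second moment about ANY centre**:
`(Σ w)(Σ α²w) − (Σ αw)² ≤ (Σ w)·Σ (α − c)²·w` (no sign hypothesis on `w`: the defect is a square).
[cite: Durrett2019, §1.6.3 (1.6.2)–(1.6.4) (PDF pp. 69–70)] -/
theorem varNumer_le_sum_mul_sum_sq_sub (I : Finset ℕ) (w : ℕ → ℝ) (c : ℝ) :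
    (∑ α ∈ I, w α) * (∑ α ∈ I, (α : ℝ) ^ 2 * w α) - (∑ α ∈ I, (α : ℝ) * w α) ^ 2 ≤
      (∑ α ∈ I, w α) * (∑ α ∈ I, ((α : ℝ) - c) ^ 2 * w α) := by
  rw [sum_mul_sum_sq_sub_mul_eq]
  nlinarith [sq_nonneg ((∑ α ∈ I, (α : ℝ) * w α) - c * ∑ α ∈ I, w α)]

/-- **The second moment about the mean, as the variance numerator over the mass**: for `Σ w ≠ 0` and
`μ = (Σ αw)/(Σ w)`, `Σ (α − μ)²·w = ((Σ w)(Σ α²w) − (Σ αw)²)/(Σ w)`.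
[cite: Durrett2019, §1.6.3 (1.6.2) (PDF p. 69)] -/
theorem sum_sq_sub_mean_mul_eq (I : Finset ℕ) (w : ℕ → ℝ) (hZ : ∑ α ∈ I, w α ≠ 0) :
    ∑ α ∈ I, ((α : ℝ) - (∑ β ∈ I, (β : ℝ) * w β) / (∑ β ∈ I, w β)) ^ 2 * w α =
      ((∑ α ∈ I, w α) * (∑ α ∈ I, (α : ℝ) ^ 2 * w α) - (∑ α ∈ I, (α : ℝ) * w α) ^ 2) /
        (∑ α ∈ I, w α) := by
  have t := sum_mul_sum_sq_sub_mul_eq I w ((∑ β ∈ I, (β : ℝ) * w β) / (∑ β ∈ I, w β))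
  have e : (∑ α ∈ I, (α : ℝ) * w α) - (∑ β ∈ I, (β : ℝ) * w β) / (∑ β ∈ I, w β) * ∑ α ∈ I, w α = 0 := by
    field_simp; ring
  rw [e, zero_pow two_ne_zero, add_zero] at t
  rw [eq_div_iff hZ, mul_comm]
  exact t

/-- **The mean minimises the second moment**: for `Σ w > 0`, `μ = (Σ αw)/(Σ w)` and every real `c`,
`Σ (α − μ)²·w ≤ Σ (α − c)²·w`. [cite: Durrett2019, §1.6.3 (1.6.2)–(1.6.4) (PDF pp. 69–70)] -/
theorem sum_sq_sub_mean_mul_le (I : Finset ℕ) (w : ℕ → ℝ) (hZ : 0 < ∑ α ∈ I, w α) (c : ℝ) :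
    ∑ α ∈ I, ((α : ℝ) - (∑ β ∈ I, (β : ℝ) * w β) / (∑ β ∈ I, w β)) ^ 2 * w α ≤
      ∑ α ∈ I, ((α : ℝ) - c) ^ 2 * w α := by
  rw [sum_sq_sub_mean_mul_eq I w hZ.ne', div_le_iff₀ hZ]
  have t := varNumer_le_sum_mul_sum_sq_sub I w c
  linarith [mul_comm (∑ α ∈ I, w α) (∑ α ∈ I, ((α : ℝ) - c) ^ 2 * w α)]

/-- **Second moment about the maximiser, closed form (`p = 1` of §12)**: for `a + 2, b + 4, d + 2 ≤ Y` and a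
maximiser `α* ≤ a` with `W(α*) > 0`: `Σ_{α ≤ a} (α − α*)²·W(α) ≤ 26·(√Y + 1)³·W(α*)`.
[cite: SaumardWellner2014, Definition 2.8 (arXiv p. 5), §4 (arXiv p. 13)] -/
theorem sum_sq_sub_max_mul_lineW_le (a b d s x αs Y : ℕ) (ha : a + 2 ≤ Y) (hb : b + 4 ≤ Y) (hd : d + 2 ≤ Y)
    (hmax : ∀ α, lineW a b d s x α ≤ lineW a b d s x αs) (hpos : 0 < lineW a b d s x αs) (hαs : αs ≤ a) :
    ∑ α ∈ Finset.range (a + 1), ((α : ℝ) - αs) ^ 2 * lineW a b d s x α ≤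
      26 * (Real.sqrt Y + 1) ^ 3 * lineW a b d s x αs := by
  have t := sum_even_pow_sub_mul_lineW_le_closed a b d s x αs Y 1 le_rfl ha hb hd hmax hpos hαs
  have e : (2 : ℝ) * ((1 + 2 ^ (2 * 1) * (1 + ((2 * 1).factorial : ℕ))) * (Real.sqrt Y + 1) ^ (2 * 1 + 1)) =
      26 * (Real.sqrt Y + 1) ^ 3 := by
    norm_num [Nat.factorial]; ring
  rw [e] at t
  simpa using t

/-- **Variance-numerator ceiling for the line section**: under the same hypotheses,
`(Σ_{α≤a} W)(Σ_{α≤a} α²W) − (Σ_{α≤a} αW)² ≤ 26·(√Y + 1)³·W(α*)·Σ_{α≤a} W`.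
[cite: SaumardWellner2014, Definition 2.8 (arXiv p. 5), §4 (arXiv p. 13)]
[cite: Durrett2019, §1.6.3 (1.6.2)–(1.6.4) (PDF pp. 69–70)] -/
theorem lineW_varNumer_le (a b d s x αs Y : ℕ) (ha : a + 2 ≤ Y) (hb : b + 4 ≤ Y) (hd : d + 2 ≤ Y)
    (hmax : ∀ α, lineW a b d s x α ≤ lineW a b d s x αs) (hpos : 0 < lineW a b d s x αs) (hαs : αs ≤ a) :
    (∑ α ∈ Finset.range (a + 1), (lineW a b d s x α : ℝ)) *
          (∑ α ∈ Finset.range (a + 1), (α : ℝ) ^ 2 * lineW a b d s x α) -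
        (∑ α ∈ Finset.range (a + 1), (α : ℝ) * lineW a b d s x α) ^ 2 ≤
      26 * (Real.sqrt Y + 1) ^ 3 * lineW a b d s x αs *
        ∑ α ∈ Finset.range (a + 1), (lineW a b d s x α : ℝ) := by
  have t1 := varNumer_le_sum_mul_sum_sq_sub (Finset.range (a + 1)) (fun α => (lineW a b d s x α : ℝ)) αs
  have t2 := sum_sq_sub_max_mul_lineW_le a b d s x αs Y ha hb hd hmax hpos hαs
  have hZ : (0 : ℝ) ≤ ∑ α ∈ Finset.range (a + 1), (lineW a b d s x α : ℝ) :=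
    Finset.sum_nonneg fun α _ => by positivity
  calc (∑ α ∈ Finset.range (a + 1), (lineW a b d s x α : ℝ)) *
          (∑ α ∈ Finset.range (a + 1), (α : ℝ) ^ 2 * lineW a b d s x α) -
        (∑ α ∈ Finset.range (a + 1), (α : ℝ) * lineW a b d s x α) ^ 2
      ≤ (∑ α ∈ Finset.range (a + 1), (lineW a b d s x α : ℝ)) *
          ∑ α ∈ Finset.range (a + 1), ((α : ℝ) - αs) ^ 2 * lineW a b d s x α := t1
    _ ≤ (∑ α ∈ Finset.range (a + 1), (lineW a b d s x α : ℝ)) * (26 * (Real.sqrt Y + 1) ^ 3 * lineW a b d s x αs) :=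
        mul_le_mul_of_nonneg_left t2 hZ
    _ = 26 * (Real.sqrt Y + 1) ^ 3 * lineW a b d s x αs *
        ∑ α ∈ Finset.range (a + 1), (lineW a b d s x α : ℝ) := by ring

/-- **THE VARIANCE CEILING (divided form).** Under the hypotheses of `sum_sq_sub_max_mul_lineW_le` and a mass
floor `T·W(α*) ≤ Σ_{α≤a} W` with `T > 0` (e.g. `T = T_L` of `lineW_mode_mul_floorSum_le_sum`): with
`μ = (Σ αW)/(Σ W)` the conditional variance satisfies `Σ_{α≤a} (α − μ)²W / Σ_{α≤a} W ≤ 26·(√Y + 1)³ / T`.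
[cite: SaumardWellner2014, Definition 2.8 (arXiv p. 5), §4 (arXiv p. 13)]
[cite: Durrett2019, §1.6.3 (1.6.2)–(1.6.4) (PDF pp. 69–70)] -/
theorem lineW_variance_le_of_massFloor (a b d s x αs Y : ℕ) (ha : a + 2 ≤ Y) (hb : b + 4 ≤ Y) (hd : d + 2 ≤ Y)
    (hmax : ∀ α, lineW a b d s x α ≤ lineW a b d s x αs) (hpos : 0 < lineW a b d s x αs) (hαs : αs ≤ a)
    (T : ℝ) (hT0 : 0 < T)
    (hT : T * lineW a b d s x αs ≤ ∑ α ∈ Finset.range (a + 1), (lineW a b d s x α : ℝ)) :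
    (∑ α ∈ Finset.range (a + 1),
          ((α : ℝ) - (∑ β ∈ Finset.range (a + 1), (β : ℝ) * lineW a b d s x β) /
              (∑ β ∈ Finset.range (a + 1), (lineW a b d s x β : ℝ))) ^ 2 * lineW a b d s x α) /
        (∑ α ∈ Finset.range (a + 1), (lineW a b d s x α : ℝ)) ≤
      26 * (Real.sqrt Y + 1) ^ 3 / T := by
  set Z := ∑ α ∈ Finset.range (a + 1), (lineW a b d s x α : ℝ) with hZdef
  have hW : (0 : ℝ) < lineW a b d s x αs := by exact_mod_cast hpos
  have hZ : 0 < Z := lt_of_lt_of_le (mul_pos hT0 hW) hT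
  have t1 := sum_sq_sub_mean_mul_le (Finset.range (a + 1)) (fun α => (lineW a b d s x α : ℝ)) hZ αs
  have t2 := sum_sq_sub_max_mul_lineW_le a b d s x αs Y ha hb hd hmax hpos hαs
  have hC : (0 : ℝ) ≤ 26 * (Real.sqrt Y + 1) ^ 3 := by positivity
  rw [div_le_div_iff₀ hZ hT0]
  calc (∑ α ∈ Finset.range (a + 1),
          ((α : ℝ) - (∑ β ∈ Finset.range (a + 1), (β : ℝ) * lineW a b d s x β) / Z) ^ 2 *
            lineW a b d s x α) * T
      ≤ (26 * (Real.sqrt Y + 1) ^ 3 * lineW a b d s x αs) * T :=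
        mul_le_mul_of_nonneg_right (t1.trans t2) hT0.le
    _ = 26 * (Real.sqrt Y + 1) ^ 3 * (T * lineW a b d s x αs) := by ring
    _ ≤ 26 * (Real.sqrt Y + 1) ^ 3 * Z := mul_le_mul_of_nonneg_left hT hC

/-- **THE VARIANCE CEILING, assembled** with the mass floor `T_L = 1 + Σ_{i=1}^{L} 2·((1−2/M)^8)^{C(i+1,2)}` of
`lineW_mode_mul_floorSum_le_sum`: if `a + 2, b + 4, d + 2 ≤ Y`, `W(α) ≤ W(α*)` for all `α`, `W(α* ± 1) > 0`,
`L + 1 ≤ α*`, `α* + L ≤ a`, and the six margins are `≥ M ≥ 2` along both floors, then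
`Var = Σ_{α≤a}(α − μ)²W / Σ_{α≤a} W ≤ 26·(√Y + 1)³ / T_L` (`≍ Y^{3/2}/√M = C(β)·N` for `L ≍ √M`).
[cite: SaumardWellner2014, Definition 2.8 (arXiv p. 5), §4 (arXiv p. 13)]
[cite: Durrett2019, §1.6.3 (1.6.2)–(1.6.4) (PDF pp. 69–70)] -/
theorem lineW_variance_ceiling (a b d s x αs Y M L : ℕ) (ha : a + 2 ≤ Y) (hb : b + 4 ≤ Y) (hd : d + 2 ≤ Y)
    (hM : 2 ≤ M) (hL : L + 1 ≤ αs) (hLa : αs + L ≤ a)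
    (hmax : ∀ α, lineW a b d s x α ≤ lineW a b d s x αs) (hleft : 0 < lineW a b d s x (αs - 1))
    (hright : 0 < lineW a b d s x (αs + 1))
    (hmarR : ∀ l, l + 1 ≤ L → αs - 1 + l + M ≤ a ∧ M ≤ αs - 1 + l + 2 ∧ 2 * (αs - 1 + l) + M + 1 ≤ x ∧
      x + M ≤ 2 * (αs - 1 + l) + b + 3 ∧ x + M ≤ s + (αs - 1 + l) + 2 ∧ s + (αs - 1 + l) + M ≤ x + d)
    (hmarL : ∀ l, l + 1 ≤ L → αs - (l + 1) + M ≤ a ∧ M ≤ αs - (l + 1) + 2 ∧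
      2 * (αs - (l + 1)) + M + 1 ≤ x ∧ x + M ≤ 2 * (αs - (l + 1)) + b + 3 ∧
      x + M ≤ s + (αs - (l + 1)) + 2 ∧ s + (αs - (l + 1)) + M ≤ x + d) :
    (∑ α ∈ Finset.range (a + 1),
          ((α : ℝ) - (∑ β ∈ Finset.range (a + 1), (β : ℝ) * lineW a b d s x β) /
              (∑ β ∈ Finset.range (a + 1), (lineW a b d s x β : ℝ))) ^ 2 * lineW a b d s x α) /
        (∑ α ∈ Finset.range (a + 1), (lineW a b d s x α : ℝ)) ≤
      26 * (Real.sqrt Y + 1) ^ 3 /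
        (1 + ∑ i ∈ Finset.Icc 1 L, 2 * ((1 - 2 / (M : ℝ)) ^ 8) ^ ((i + 1).choose 2)) := by
  have hpos : 0 < lineW a b d s x αs := lt_of_lt_of_le hleft (hmax _)
  have floor := lineW_mode_mul_floorSum_le_sum a b d s x αs M L hM hL hLa hmax hleft hright hmarR hmarL
  have hM' : (0 : ℝ) ≤ 1 - 2 / (M : ℝ) := by
    have hM2 : (2 : ℝ) ≤ M := by exact_mod_cast hM
    have : 2 / (M : ℝ) ≤ 1 := by rw [div_le_one (by linarith)]; exact hM2
    linarith
  have hT0 : (0 : ℝ) < 1 + ∑ i ∈ Finset.Icc 1 L, 2 * ((1 - 2 / (M : ℝ)) ^ 8) ^ ((i + 1).choose 2) := by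
    have : (0 : ℝ) ≤ ∑ i ∈ Finset.Icc 1 L, 2 * ((1 - 2 / (M : ℝ)) ^ 8) ^ ((i + 1).choose 2) :=
      Finset.sum_nonneg fun i _ => by positivity
    linarith
  refine lineW_variance_le_of_massFloor a b d s x αs Y ha hb hd hmax hpos (by omega) _ hT0 ?_
  rw [mul_comm]; exact floor

/-! ### §14 (v7) The one-pinned law is the size-biased full law (shifted by one)

Summing the kind-`A` pinning identity `W_{a+1,b,d,s+1,x+2}(α+1)·(α+1) = W_{a,b,d,s,x}(α)·(a+1)` against a test
function: `(a+1)·Σ_α g(α)·W_{a,b,d,s,x}(α) = Σ_α (α+1)·g(α)·W_{a+1,b,d,s+1,x+2}(α+1)` — the law of `α` under the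
«small» parameters `(a, s, x)` (one kind-`A` item and one sample slot removed, score down by `2`: in the cell, the
ground set with one `HH` full edge deleted) is the law of `k − 1` under the «full» parameters `(a+1, s+1, x+2)`
SIZE-BIASED by `k`. Hence `E_small[α] = E_full[k(k−1)]/E_full[k] = μ + Var/μ − 1` (`μ, Var` of the full law) —
the check line «`E_{S∖v}[n_A | X′ = x−2] = m + Var/m − 1`» of prover MEMO-29 §3b (B1), at the level of line
sections. -/

/-- **Size biasing with a test function** (summed kind-`A` pin):
`(a+1)·Σ_{α≤a} g(α)·W_{a,b,d,s,x}(α) = Σ_{α≤a} (α+1)·g(α)·W_{a+1,b,d,s+1,x+2}(α+1)`.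
[cite: ChattamvelliShanmugam2020, §7.4 Table 7.1 (PDF p. 143)] -/
theorem sum_mul_lineW_eq_sum_pin (g : ℕ → ℝ) (a b d s x : ℕ) :
    ((a : ℝ) + 1) * ∑ α ∈ Finset.range (a + 1), g α * lineW a b d s x α =
      ∑ α ∈ Finset.range (a + 1), ((α : ℝ) + 1) * g α * lineW (a + 1) b d (s + 1) (x + 2) (α + 1) := by
  rw [Finset.mul_sum]
  refine Finset.sum_congr rfl fun α _ => ?_
  have t := lineW_pinA_mul a b d s x α
  have t' : ((lineW (a + 1) b d (s + 1) (x + 2) (α + 1) : ℕ) : ℝ) * ((α : ℝ) + 1) =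
      (lineW a b d s x α : ℝ) * ((a : ℝ) + 1) := by exact_mod_cast t
  linear_combination (g α) * t'.symm

/-- **Mass of the pinned law = first moment of the full law** (real form of `sum_lineW_mul_alpha`, in the full
law's own index): `(a+1)·Σ_{α≤a} W_{a,b,d,s,x}(α) = Σ_{k≤a+1} k·W_{a+1,b,d,s+1,x+2}(k)`.
[cite: ChattamvelliShanmugam2020, §7.4 Table 7.1 (PDF p. 143)] -/
theorem sum_lineW_pin_mass (a b d s x : ℕ) :
    ((a : ℝ) + 1) * ∑ α ∈ Finset.range (a + 1), (lineW a b d s x α : ℝ) =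
      ∑ k ∈ Finset.range (a + 2), (k : ℝ) * lineW (a + 1) b d (s + 1) (x + 2) k := by
  have t := sum_mul_lineW_eq_sum_pin (fun _ => (1 : ℝ)) a b d s x
  simp only [one_mul, mul_one] at t
  rw [t, Finset.sum_range_succ' (fun k => (k : ℝ) * lineW (a + 1) b d (s + 1) (x + 2) k)]
  simp

/-- **First moment of the pinned law = second factorial moment of the full law**:
`(a+1)·Σ_{α≤a} α·W_{a,b,d,s,x}(α) = Σ_{k≤a+1} k(k−1)·W_{a+1,b,d,s+1,x+2}(k)`.
[cite: ChattamvelliShanmugam2020, §7.4 Table 7.1 (PDF p. 143)] -/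
theorem sum_lineW_pin_firstMoment (a b d s x : ℕ) :
    ((a : ℝ) + 1) * ∑ α ∈ Finset.range (a + 1), (α : ℝ) * lineW a b d s x α =
      ∑ k ∈ Finset.range (a + 2), (k : ℝ) * ((k : ℝ) - 1) * lineW (a + 1) b d (s + 1) (x + 2) k := by
  have t := sum_mul_lineW_eq_sum_pin (fun α => (α : ℝ)) a b d s x
  rw [t, Finset.sum_range_succ' (fun k => (k : ℝ) * ((k : ℝ) - 1) * lineW (a + 1) b d (s + 1) (x + 2) k)]
  simp only [Nat.cast_zero, zero_mul, add_zero, Nat.cast_add, Nat.cast_one]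
  exact Finset.sum_congr rfl fun α _ => by ring

/-- **Size biasing, divided**: if the full law has a positive first moment, the mean of the pinned law is
`E_small[α] = (Σ k²W_full)/(Σ kW_full) − 1`. [cite: ChattamvelliShanmugam2020, §7.4 Table 7.1 (PDF p. 143)] -/
theorem lineW_pinned_mean_eq (a b d s x : ℕ)
    (hA : 0 < ∑ k ∈ Finset.range (a + 2), (k : ℝ) * lineW (a + 1) b d (s + 1) (x + 2) k) :
    (∑ α ∈ Finset.range (a + 1), (α : ℝ) * lineW a b d s x α) /
        (∑ α ∈ Finset.range (a + 1), (lineW a b d s x α : ℝ)) =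
      (∑ k ∈ Finset.range (a + 2), (k : ℝ) ^ 2 * lineW (a + 1) b d (s + 1) (x + 2) k) /
          (∑ k ∈ Finset.range (a + 2), (k : ℝ) * lineW (a + 1) b d (s + 1) (x + 2) k) - 1 := by
  have m0 := sum_lineW_pin_mass a b d s x
  have m1 := sum_lineW_pin_firstMoment a b d s x
  have ha1 : (0 : ℝ) < (a : ℝ) + 1 := by positivity
  set Z := ∑ α ∈ Finset.range (a + 1), (lineW a b d s x α : ℝ)
  set A := ∑ α ∈ Finset.range (a + 1), (α : ℝ) * lineW a b d s x α
  set F1 := ∑ k ∈ Finset.range (a + 2), (k : ℝ) * lineW (a + 1) b d (s + 1) (x + 2) k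
  set F2 := ∑ k ∈ Finset.range (a + 2), (k : ℝ) ^ 2 * lineW (a + 1) b d (s + 1) (x + 2) k
  have e2 : ∑ k ∈ Finset.range (a + 2), (k : ℝ) * ((k : ℝ) - 1) * lineW (a + 1) b d (s + 1) (x + 2) k =
      F2 - F1 := by
    rw [← Finset.sum_sub_distrib]
    exact Finset.sum_congr rfl fun k _ => by ring
  rw [e2] at m1
  have hZ : Z ≠ 0 := by
    intro h
    rw [h, mul_zero] at m0
    exact hA.ne' m0.symm
  have hF1 : F1 ≠ 0 := hA.ne'
  rw [div_eq_iff hZ, sub_mul, div_mul_eq_mul_div, one_mul]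
  -- `Z = F1/(a+1)`, `A = (F2 − F1)/(a+1)`
  have eZ : Z = F1 / ((a : ℝ) + 1) := by rw [eq_div_iff ha1.ne', mul_comm]; exact m0
  have eA : A = (F2 - F1) / ((a : ℝ) + 1) := by rw [eq_div_iff ha1.ne', mul_comm]; exact m1
  rw [eZ, eA]
  field_simp

/-- **Second moment over first moment** (generic): for weights with `Σ w > 0` and `Σ kw > 0`,
`(Σ k²w)/(Σ kw) = μ + V/μ` with `μ = (Σ kw)/(Σ w)` and `V = Σ (k − μ)²w / Σ w` — so the size-biased mean is
`μ + Var/μ` and the pinned mean `μ + Var/μ − 1`. [cite: Durrett2019, §1.6.3 (1.6.2) (PDF p. 69)] -/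
theorem sum_sq_mul_div_sum_mul_eq (I : Finset ℕ) (w : ℕ → ℝ) (hZ : 0 < ∑ k ∈ I, w k)
    (hA : 0 < ∑ k ∈ I, (k : ℝ) * w k) :
    (∑ k ∈ I, (k : ℝ) ^ 2 * w k) / (∑ k ∈ I, (k : ℝ) * w k) =
      (∑ k ∈ I, (k : ℝ) * w k) / (∑ k ∈ I, w k) +
        ((∑ k ∈ I, ((k : ℝ) - (∑ j ∈ I, (j : ℝ) * w j) / (∑ j ∈ I, w j)) ^ 2 * w k) / (∑ k ∈ I, w k)) /
          ((∑ k ∈ I, (k : ℝ) * w k) / (∑ k ∈ I, w k)) := by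
  rw [sum_sq_sub_mean_mul_eq I w hZ.ne']
  field_simp
  ring

/-- **The pinned mean in `μ + Var/μ − 1` form**: with `μ`, `V` the mean and variance of the full law
`W_{a+1,b,d,s+1,x+2}` (positive mass and mean), `E_small[α] = μ + V/μ − 1`.
[cite: ChattamvelliShanmugam2020, §7.4 Table 7.1 (PDF p. 143)] [cite: Durrett2019, §1.6.3 (1.6.2) (PDF p. 69)] -/
theorem lineW_pinned_mean_eq_mean_add_var_div (a b d s x : ℕ)
    (hZ : 0 < ∑ k ∈ Finset.range (a + 2), (lineW (a + 1) b d (s + 1) (x + 2) k : ℝ))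
    (hA : 0 < ∑ k ∈ Finset.range (a + 2), (k : ℝ) * lineW (a + 1) b d (s + 1) (x + 2) k) :
    (∑ α ∈ Finset.range (a + 1), (α : ℝ) * lineW a b d s x α) /
        (∑ α ∈ Finset.range (a + 1), (lineW a b d s x α : ℝ)) =
      (∑ k ∈ Finset.range (a + 2), (k : ℝ) * lineW (a + 1) b d (s + 1) (x + 2) k) /
            (∑ k ∈ Finset.range (a + 2), (lineW (a + 1) b d (s + 1) (x + 2) k : ℝ)) +
          ((∑ k ∈ Finset.range (a + 2),
                ((k : ℝ) - (∑ j ∈ Finset.range (a + 2), (j : ℝ) * lineW (a + 1) b d (s + 1) (x + 2) j) /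
                    (∑ j ∈ Finset.range (a + 2), (lineW (a + 1) b d (s + 1) (x + 2) j : ℝ))) ^ 2 *
                  lineW (a + 1) b d (s + 1) (x + 2) k) /
              (∑ k ∈ Finset.range (a + 2), (lineW (a + 1) b d (s + 1) (x + 2) k : ℝ))) /
            ((∑ k ∈ Finset.range (a + 2), (k : ℝ) * lineW (a + 1) b d (s + 1) (x + 2) k) /
              (∑ k ∈ Finset.range (a + 2), (lineW (a + 1) b d (s + 1) (x + 2) k : ℝ))) -
        1 := by
  rw [lineW_pinned_mean_eq a b d s x hA,
    sum_sq_mul_div_sum_mul_eq (Finset.range (a + 2)) (fun k => (lineW (a + 1) b d (s + 1) (x + 2) k : ℝ)) hZ hA]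

/-! ### §15 (v8) The variance FLOOR, packaged (prover MEMO-30 (B3a): `var_lineW_ge`)

§10 gives the mass floor `T_L·W(α*) ≤ Σ W` and the Chebyshev counting bound `r²(Σ W − (2r+1)W(α*)) ≤ Σ(α−m)²W`
for every real centre `m`; together `r²(1 − (2r+1)/T_L)·Σ W ≤ Σ (α−m)²W`. Here the hypotheses are stated AT THE
MAXIMISER only (the six margins with a slack `L`, `2L` absorbing the window), the floor sum is bounded below in
closed form (`16L(L+1) ≤ M ⇒ T_L ≥ 1 + L`, Bernoulli), and a maximiser-free form takes the mode brackets of §6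
(`D(lo) < N(lo)`, `N(hi) < D(hi)`) instead. Result: `Var(α | line section) ≥ r²/2` for `4r + 2 ≤ L + 1`,
`16L(L+1) ≤ M` — `≍ M/512`, i.e. `≥ c(β)·N` on the bulk, for EVERY centre `m` (so no law of total variance is
needed to pass to mixtures of line sections). -/

/-- The weight vanishes for `α > s` (on the line `α + j + m = s`).
[cite: ChattamvelliShanmugam2020, §7.4 (PDF p. 144)] -/
theorem lineW_eq_zero_of_lt_s {a b d s x α : ℕ} (h : s < α) : lineW a b d s x α = 0 := by
  rcases Nat.eq_zero_or_pos (lineW a b d s x α) with h0 | h0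
  · exact h0
  · have := lineW_pos_iff.1 h0; omega

/-- Sums of `g·W` over `range (s+1)` and over `range (a+1)` agree (the weight vanishes beyond both `a` and `s`).
[cite: ChattamvelliShanmugam2020, §7.4 (PDF p. 144)] -/
theorem sum_range_mul_lineW_eq_of_s {M : Type*} [AddCommMonoid M] (g : ℕ → ℕ → M) (hg : ∀ α, g α 0 = 0)
    (a b d s x : ℕ) :
    ∑ α ∈ Finset.range (s + 1), g α (lineW a b d s x α) = ∑ α ∈ Finset.range (a + 1), g α (lineW a b d s x α) := by
  -- both equal the sum over `range (max a s + 1)`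
  have key : ∀ K K', K ≤ K' → (∀ α, K ≤ α → lineW a b d s x α = 0) →
      ∑ α ∈ Finset.range K', g α (lineW a b d s x α) = ∑ α ∈ Finset.range K, g α (lineW a b d s x α) := by
    intro K K' hKK' hz
    obtain ⟨k, rfl⟩ : ∃ k, K' = K + k := ⟨K' - K, by omega⟩
    rw [Finset.sum_range_add]
    have : ∑ α ∈ Finset.range k, g (K + α) (lineW a b d s x (K + α)) = 0 :=
      Finset.sum_eq_zero fun α _ => by rw [hz (K + α) (by omega), hg]
    rw [this, add_zero]
  rw [← key (s + 1) (max a s + 1) (by omega) (fun α hα => lineW_eq_zero_of_lt_s (by omega)),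
    ← key (a + 1) (max a s + 1) (by omega) (fun α hα => lineW_eq_zero_of_lt_alpha (by omega))]

/-- **The variance floor, packaged at the maximiser.** Let `α*` be a maximiser (`W(α) ≤ W(α*)` for all `α`),
`M ≥ 3`, `1 ≤ L`, `L + 1 ≤ α*`, and suppose the six margins hold with slack at `α*`:
`α* + L + M ≤ a`, `M + L ≤ α* + 2`, `2(α* + L) + M + 1 ≤ x`, `x + M + 2L ≤ 2α* + b + 3`, `x + M + L ≤ s + α* + 2`,
`s + α* + L + M ≤ x + d`. Then for EVERY real centre `m` and every `r : ℕ`, with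
`T_L = 1 + Σ_{i=1}^{L} 2·((1−2/M)^8)^{C(i+1,2)}`:  `r²·(1 − (2r+1)/T_L)·Σ_{α≤a} W ≤ Σ_{α≤a} (α − m)²·W`.
[cite: SaumardWellner2014, §4 (arXiv p. 13)] [cite: Durrett2019, Thm. 1.6.4 (Chebyshev's inequality)] -/
theorem var_lineW_ge (a b d s x αs M L : ℕ) (hM : 3 ≤ M) (hL1 : 1 ≤ L) (hL : L + 1 ≤ αs)
    (hmax : ∀ α, lineW a b d s x α ≤ lineW a b d s x αs)
    (m1 : αs + L + M ≤ a) (m2 : M + L ≤ αs + 2) (m3 : 2 * (αs + L) + M + 1 ≤ x)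
    (m4 : x + M + 2 * L ≤ 2 * αs + b + 3) (m5 : x + M + L ≤ s + αs + 2) (m6 : s + αs + L + M ≤ x + d)
    (m : ℝ) (r : ℕ) :
    (r : ℝ) ^ 2 * (1 - (2 * r + 1) / (1 + ∑ i ∈ Finset.Icc 1 L, 2 * ((1 - 2 / (M : ℝ)) ^ 8) ^ ((i + 1).choose 2))) *
        ∑ α ∈ Finset.range (a + 1), (lineW a b d s x α : ℝ) ≤
      ∑ α ∈ Finset.range (a + 1), ((α : ℝ) - m) ^ 2 * lineW a b d s x α := by
  obtain ⟨k, rfl⟩ : ∃ k, αs = k + 1 := ⟨αs - 1, by omega⟩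
  have hleft : 0 < lineW a b d s x (k + 1 - 1) := by
    rw [Nat.add_sub_cancel]; exact lineW_pos_iff.2 (by omega)
  have hright : 0 < lineW a b d s x (k + 1 + 1) := lineW_pos_iff.2 (by omega)
  have floor := lineW_mode_mul_floorSum_le_sum a b d s x (k + 1) M L (by omega) hL (by omega) hmax hleft hright
    (fun l hl => by rw [Nat.add_sub_cancel]; omega) (fun l hl => by omega)
  have cheb := sq_mul_sub_le_sum_sq_mul_lineW (Finset.range (a + 1)) a b d s x (k + 1) hmax m r
  set T := 1 + ∑ i ∈ Finset.Icc 1 L, 2 * ((1 - 2 / (M : ℝ)) ^ 8) ^ ((i + 1).choose 2) with hT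
  set Z := ∑ α ∈ Finset.range (a + 1), (lineW a b d s x α : ℝ)
  have hM' : (0 : ℝ) ≤ 1 - 2 / (M : ℝ) := by
    have hM2 : (2 : ℝ) ≤ M := by exact_mod_cast (show 2 ≤ M by omega)
    have : 2 / (M : ℝ) ≤ 1 := by rw [div_le_one (by linarith)]; exact hM2
    linarith
  have hT0 : 0 < T := by
    have : (0 : ℝ) ≤ ∑ i ∈ Finset.Icc 1 L, 2 * ((1 - 2 / (M : ℝ)) ^ 8) ^ ((i + 1).choose 2) :=
      Finset.sum_nonneg fun i _ => by positivity
    linarith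
  -- `W(α*) ≤ Z/T`
  have hW : (lineW a b d s x (k + 1) : ℝ) ≤ Z / T := by
    rw [le_div_iff₀ hT0]; exact floor
  have hr : (0 : ℝ) ≤ (r : ℝ) ^ 2 * (2 * r + 1) := by positivity
  calc (r : ℝ) ^ 2 * (1 - (2 * r + 1) / T) * Z
      = (r : ℝ) ^ 2 * (Z - (2 * r + 1) * (Z / T)) := by ring
    _ ≤ (r : ℝ) ^ 2 * (Z - (2 * r + 1) * lineW a b d s x (k + 1)) := by nlinarith [hW, hr]
    _ ≤ ∑ α ∈ Finset.range (a + 1), ((α : ℝ) - m) ^ 2 * lineW a b d s x α := cheb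

/-- **The floor sum in closed form**: if `16·L(L+1) ≤ M` then
`T_L = 1 + Σ_{i=1}^{L} 2·((1−2/M)^8)^{C(i+1,2)} ≥ 1 + L` — each term is `≥ 2·(1−2/M)^{4L(L+1)} ≥ 2(1 − 8L(L+1)/M) ≥ 1`
(Bernoulli). [cite: SaumardWellner2014, §4 (arXiv p. 13); elementary] -/
theorem floorSum_ge (M L : ℕ) (hLM : 16 * (L * (L + 1)) ≤ M) (hM : 2 ≤ M) :
    (1 : ℝ) + L ≤ 1 + ∑ i ∈ Finset.Icc 1 L, 2 * ((1 - 2 / (M : ℝ)) ^ 8) ^ ((i + 1).choose 2) := by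
  have hMpos : (0 : ℝ) < M := by exact_mod_cast (show 0 < M by omega)
  have hM2 : (2 : ℝ) ≤ M := by exact_mod_cast hM
  set p : ℝ := (1 - 2 / (M : ℝ)) ^ 8 with hp
  have hbase0 : (0 : ℝ) ≤ 1 - 2 / (M : ℝ) := by
    have : 2 / (M : ℝ) ≤ 1 := by rw [div_le_one hMpos]; exact hM2
    linarith
  have hbase1 : 1 - 2 / (M : ℝ) ≤ 1 := by
    have : (0 : ℝ) ≤ 2 / (M : ℝ) := by positivity
    linarith
  have hp0 : 0 ≤ p := pow_nonneg hbase0 _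
  have hp1 : p ≤ 1 := pow_le_one₀ hbase0 hbase1
  -- Bernoulli: `(1 − 2/M)^{8·C(L+1,2)} ≥ 1 − 8·C(L+1,2)·(2/M) ≥ 1/2`
  have hC : (L + 1).choose 2 * 2 = L * (L + 1) := by
    rw [Nat.choose_two_right, Nat.add_sub_cancel, mul_comm (L + 1) L]
    exact Nat.div_mul_cancel (Nat.even_mul_succ_self L).two_dvd
  have hbern : (1 : ℝ) / 2 ≤ p ^ ((L + 1).choose 2) := by
    rw [hp, ← pow_mul]
    have t := one_add_mul_le_pow (show (-2 : ℝ) ≤ -(2 / (M : ℝ)) by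
      have : 2 / (M : ℝ) ≤ 1 := by rw [div_le_one hMpos]; exact hM2
      linarith) (8 * (L + 1).choose 2)
    have e : (1 : ℝ) + -(2 / (M : ℝ)) = 1 - 2 / M := by ring
    rw [e] at t
    have hsmall : ((8 * (L + 1).choose 2 : ℕ) : ℝ) * (2 / (M : ℝ)) ≤ 1 / 2 := by
      rw [← mul_div_assoc, div_le_iff₀ hMpos]
      have : ((8 * (L + 1).choose 2 : ℕ) : ℝ) * 2 * 2 ≤ (M : ℝ) := by
        have h4 : 8 * (L + 1).choose 2 * 2 * 2 ≤ M := by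
          calc 8 * (L + 1).choose 2 * 2 * 2 = 16 * ((L + 1).choose 2 * 2) := by ring
            _ = 16 * (L * (L + 1)) := by rw [hC]
            _ ≤ M := hLM
        exact_mod_cast h4
      linarith
    calc (1 : ℝ) / 2 ≤ 1 + ((8 * (L + 1).choose 2 : ℕ) : ℝ) * -(2 / (M : ℝ)) := by linarith
      _ ≤ (1 - 2 / (M : ℝ)) ^ (8 * (L + 1).choose 2) := t
  -- each term of the sum is `≥ 1`
  have hterm : ∀ i ∈ Finset.Icc 1 L, (1 : ℝ) ≤ 2 * p ^ ((i + 1).choose 2) := by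
    intro i hi
    rw [Finset.mem_Icc] at hi
    have hmono : p ^ ((L + 1).choose 2) ≤ p ^ ((i + 1).choose 2) :=
      pow_le_pow_of_le_one hp0 hp1 (Nat.choose_le_choose 2 (by omega))
    linarith
  calc (1 : ℝ) + L = 1 + ∑ i ∈ Finset.Icc 1 L, (1 : ℝ) := by simp
    _ ≤ 1 + ∑ i ∈ Finset.Icc 1 L, 2 * p ^ ((i + 1).choose 2) := by
        gcongr with i hi; exact hterm i hi

/-- **THE VARIANCE FLOOR, closed form (B3a)**: under the hypotheses of `var_lineW_ge`, if moreover
`16·L(L+1) ≤ M` and `4r + 2 ≤ L + 1`, then for every real centre `m`: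
`(r²/2)·Σ_{α≤a} W ≤ Σ_{α≤a} (α − m)²·W` — the conditional variance of the `HH` count on a line section is at
least `r²/2` (`≍ M/512` with `L ≍ √M/4`, `r ≍ L/4`; on the cell's bulk `M ≍ c(β)N`).
[cite: SaumardWellner2014, §4 (arXiv p. 13)] [cite: Durrett2019, Thm. 1.6.4 (Chebyshev's inequality)] -/
theorem var_lineW_ge_closed (a b d s x αs M L : ℕ) (hM : 2 ≤ M) (hL1 : 1 ≤ L) (hL : L + 1 ≤ αs)
    (hmax : ∀ α, lineW a b d s x α ≤ lineW a b d s x αs)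
    (m1 : αs + L + M ≤ a) (m2 : M + L ≤ αs + 2) (m3 : 2 * (αs + L) + M + 1 ≤ x)
    (m4 : x + M + 2 * L ≤ 2 * αs + b + 3) (m5 : x + M + L ≤ s + αs + 2) (m6 : s + αs + L + M ≤ x + d)
    (hLM : 16 * (L * (L + 1)) ≤ M) (r : ℕ) (hr : 4 * r + 2 ≤ L + 1) (m : ℝ) :
    ((r : ℝ) ^ 2 / 2) * ∑ α ∈ Finset.range (a + 1), (lineW a b d s x α : ℝ) ≤
      ∑ α ∈ Finset.range (a + 1), ((α : ℝ) - m) ^ 2 * lineW a b d s x α := by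
  have hLL : 1 * (1 + 1) ≤ L * (L + 1) := Nat.mul_le_mul hL1 (by omega)
  have hM3 : 3 ≤ M := by omega
  have t := var_lineW_ge a b d s x αs M L hM3 hL1 hL hmax m1 m2 m3 m4 m5 m6 m r
  have f := floorSum_ge M L hLM hM
  set T := 1 + ∑ i ∈ Finset.Icc 1 L, 2 * ((1 - 2 / (M : ℝ)) ^ 8) ^ ((i + 1).choose 2)
  have hZ : (0 : ℝ) ≤ ∑ α ∈ Finset.range (a + 1), (lineW a b d s x α : ℝ) :=
    Finset.sum_nonneg fun α _ => by positivity
  have hT : (0 : ℝ) < T := by have : (0:ℝ) ≤ L := by positivity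
                              linarith
  -- `(2r+1)/T ≤ (2r+1)/(L+1) ≤ 1/2`
  have hfrac : (2 * (r : ℝ) + 1) / T ≤ 1 / 2 := by
    rw [div_le_iff₀ hT]
    have : (4 : ℝ) * r + 2 ≤ L + 1 := by exact_mod_cast hr
    linarith
  have hcoef : (r : ℝ) ^ 2 / 2 ≤ (r : ℝ) ^ 2 * (1 - (2 * r + 1) / T) := by
    have hr2 : (0 : ℝ) ≤ (r : ℝ) ^ 2 := by positivity
    nlinarith [hfrac, hr2]
  exact (mul_le_mul_of_nonneg_right hcoef hZ).trans t

/-- **THE VARIANCE FLOOR, maximiser-free form (B3a).** Suppose `lo + 1 ≤ hi` bracket the modes —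
`D(lo) < N(lo)` and `N(hi) < D(hi)` with `N(α) = (a−α)·j(j−1)·(d−m)`, `D(α) = (α+1)(b+2−j)(b+1−j)(s+α+1−x)`,
`j = x − 2α`, `m = s + α − x` (`lt_max_of_denom_lt_numer`, `max_le_of_numer_lt_denom`) — and the margins hold
uniformly on `[lo+1, hi]`: `hi + L + M ≤ a`, `M + L ≤ lo + 3`, `L ≤ lo`, `2(hi + L) + M + 1 ≤ x`,
`x + M + 2L ≤ 2(lo+1) + b + 3`, `x + M + L ≤ s + lo + 3`, `s + hi + L + M ≤ x + d`, with `M ≥ 2`, `1 ≤ L`,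
`16·L(L+1) ≤ M`, `4r + 2 ≤ L + 1`. Then for every real `m`: `(r²/2)·Σ_{α≤a} W ≤ Σ_{α≤a} (α − m)²·W`.
[cite: SaumardWellner2014, §4 (arXiv p. 13)] [cite: Durrett2019, Thm. 1.6.4 (Chebyshev's inequality)]
[cite: ChattamvelliShanmugam2020, §7.4 Table 7.1 (PDF p. 143), mode from the ratio] -/
theorem var_lineW_ge_of_bracket (a b d s x lo hi M L : ℕ) (hM : 2 ≤ M) (hL1 : 1 ≤ L) (hlohi : lo + 1 ≤ hi)
    (hlo : (lo + 1) * ((b + 2 - (x - 2 * lo)) * (b + 1 - (x - 2 * lo))) * (s + lo + 1 - x) <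
      (a - lo) * ((x - 2 * lo) * (x - 2 * lo - 1)) * (d - (s + lo - x)))
    (hhi : (a - hi) * ((x - 2 * hi) * (x - 2 * hi - 1)) * (d - (s + hi - x)) <
      (hi + 1) * ((b + 2 - (x - 2 * hi)) * (b + 1 - (x - 2 * hi))) * (s + hi + 1 - x))
    (m1 : hi + L + M ≤ a) (m2 : M + L ≤ lo + 3) (m2' : L ≤ lo) (m3 : 2 * (hi + L) + M + 1 ≤ x)
    (m4 : x + M + 2 * L ≤ 2 * (lo + 1) + b + 3) (m5 : x + M + L ≤ s + lo + 3) (m6 : s + hi + L + M ≤ x + d)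
    (hLM : 16 * (L * (L + 1)) ≤ M) (r : ℕ) (hr : 4 * r + 2 ≤ L + 1) (m : ℝ) :
    ((r : ℝ) ^ 2 / 2) * ∑ α ∈ Finset.range (a + 1), (lineW a b d s x α : ℝ) ≤
      ∑ α ∈ Finset.range (a + 1), ((α : ℝ) - m) ^ 2 * lineW a b d s x α := by
  obtain ⟨αs, -, hmax⟩ := exists_lineW_max a b d s x
  -- a positive weight inside the bracket: `W(lo+1) > 0`
  have hpos1 : 0 < lineW a b d s x (lo + 1) := lineW_pos_iff.2 (by omega)
  have hpos : 0 < lineW a b d s x αs := lt_of_lt_of_le hpos1 (hmax _)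
  have h1 : lo < αs := lt_max_of_denom_lt_numer hmax hpos hlo
  have h2 : αs ≤ hi := max_le_of_numer_lt_denom hmax hpos hhi
  exact var_lineW_ge_closed a b d s x αs M L hM hL1 (by omega) hmax (by omega) (by omega) (by omega)
    (by omega) (by omega) (by omega) hLM r hr m

/-! ### §16 (v8) The law of total variance, EXACT, and the mixture variance ceiling

`sum_mul_sum_var_le` (§10) is the floor direction `Var_mix ≥ E[Var_comp]`. The exact decomposition in numerator
form: `(ΣZ)(ΣS) − (ΣA)² = (ΣZ)·Σ_c (S_c − A_c²/Z_c) + ((ΣZ)·Σ_c A_c²/Z_c − (ΣA)²)` and the between-part is a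
Steiner sum about ANY centre minus a square: `(ΣZ)·Σ_c A_c²/Z_c − (ΣA)² = (ΣZ)·Σ_c Z_c(A_c/Z_c − m₀)² − (ΣA − m₀ΣZ)²`.
Hence the CEILING: component variances `≤ v` (`S_c·Z_c − A_c² ≤ v·Z_c²`) and component means within `Δ` of a
common centre (`|A_c/Z_c − m₀| ≤ Δ`) give `(ΣZ)(ΣS) − (ΣA)² ≤ (v + Δ²)·(ΣZ)²`, i.e. `Var_mix ≤ v + Δ²` — the
mixture step of «`Var(n_A | x) ≤ C·a`» over the half-data components (prover MEMO-29 §3 (L3): the component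
means differ by `O(D)`). -/

/-- **Law of total variance, exact numerator form**: for components with masses `Z_c ≠ 0`, first moments
`A_c`, second moments `S_c`:
`(ΣZ)(ΣS) − (ΣA)² = (ΣZ)·Σ_c (S_c − A_c²/Z_c) + ((ΣZ)·Σ_c A_c²/Z_c − (ΣA)²)` (within + between).
[cite: Durrett2019, §4.1 (conditional expectation; the law of total variance), §1.6.3 (1.6.2) (PDF p. 69)] -/
theorem sum_mul_sum_var_eq {κ : Type*} (C : Finset κ) (Z A S : κ → ℝ) :
    (∑ c ∈ C, Z c) * (∑ c ∈ C, S c) - (∑ c ∈ C, A c) ^ 2 =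
      (∑ c ∈ C, Z c) * (∑ c ∈ C, (S c - A c ^ 2 / Z c)) +
        ((∑ c ∈ C, Z c) * (∑ c ∈ C, A c ^ 2 / Z c) - (∑ c ∈ C, A c) ^ 2) := by
  rw [Finset.sum_sub_distrib]; ring

/-- **The between-component part as a Steiner sum**: for `Z_c ≠ 0` on `C` and ANY real centre `m₀`,
`(ΣZ)·Σ_c A_c²/Z_c − (ΣA)² = (ΣZ)·Σ_c Z_c·(A_c/Z_c − m₀)² − (ΣA − m₀·ΣZ)²`.
[cite: Durrett2019, §1.6.3 (1.6.2)–(1.6.4) (PDF pp. 69–70)] -/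
theorem between_eq_steiner {κ : Type*} (C : Finset κ) (Z A : κ → ℝ) (hZ : ∀ c ∈ C, Z c ≠ 0) (m₀ : ℝ) :
    (∑ c ∈ C, Z c) * (∑ c ∈ C, A c ^ 2 / Z c) - (∑ c ∈ C, A c) ^ 2 =
      (∑ c ∈ C, Z c) * (∑ c ∈ C, Z c * (A c / Z c - m₀) ^ 2) -
        ((∑ c ∈ C, A c) - m₀ * ∑ c ∈ C, Z c) ^ 2 := by
  have e : ∑ c ∈ C, Z c * (A c / Z c - m₀) ^ 2 =
      ∑ c ∈ C, A c ^ 2 / Z c - 2 * m₀ * ∑ c ∈ C, A c + m₀ ^ 2 * ∑ c ∈ C, Z c := by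
    rw [Finset.mul_sum, Finset.mul_sum, ← Finset.sum_sub_distrib, ← Finset.sum_add_distrib]
    refine Finset.sum_congr rfl fun c hc => ?_
    have hz := hZ c hc
    field_simp
    ring
  rw [e]; ring

/-- **Mixture variance CEILING** (law of total variance read upwards): if every component has mass `Z_c > 0`,
variance `≤ v` (`S_c·Z_c − A_c² ≤ v·Z_c²`) and mean within `Δ` of a common centre (`|A_c/Z_c − m₀| ≤ Δ`), then
`(ΣZ)(ΣS) − (ΣA)² ≤ (v + Δ²)·(ΣZ)²`, i.e. `Var_mix ≤ v + Δ²`.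
[cite: Durrett2019, §4.1 (the law of total variance), §1.6.3 (1.6.2)–(1.6.4) (PDF pp. 69–70)] -/
theorem mixture_varNumer_le {κ : Type*} (C : Finset κ) (Z A S : κ → ℝ) (hZ : ∀ c ∈ C, 0 < Z c) (v Δ m₀ : ℝ)
    (hv : ∀ c ∈ C, S c * Z c - A c ^ 2 ≤ v * Z c ^ 2) (hΔ : ∀ c ∈ C, |A c / Z c - m₀| ≤ Δ) :
    (∑ c ∈ C, Z c) * (∑ c ∈ C, S c) - (∑ c ∈ C, A c) ^ 2 ≤ (v + Δ ^ 2) * (∑ c ∈ C, Z c) ^ 2 := by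
  have hZ' : ∀ c ∈ C, Z c ≠ 0 := fun c hc => (hZ c hc).ne'
  have hZsum : 0 ≤ ∑ c ∈ C, Z c := Finset.sum_nonneg fun c hc => (hZ c hc).le
  rw [sum_mul_sum_var_eq, between_eq_steiner C Z A hZ' m₀]
  -- within: `Σ (S_c − A_c²/Z_c) ≤ v·ΣZ`
  have within : ∑ c ∈ C, (S c - A c ^ 2 / Z c) ≤ v * ∑ c ∈ C, Z c := by
    rw [Finset.mul_sum]
    refine Finset.sum_le_sum fun c hc => ?_
    have hz := hZ c hc
    have t := hv c hc
    have key : (S c - A c ^ 2 / Z c) * Z c ≤ (v * Z c) * Z c := by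
      have : (S c - A c ^ 2 / Z c) * Z c = S c * Z c - A c ^ 2 := by field_simp
      rw [this]; nlinarith [t]
    exact le_of_mul_le_mul_right key hz
  -- between: `Σ Z_c (A_c/Z_c − m₀)² ≤ Δ²·ΣZ`
  have between : ∑ c ∈ C, Z c * (A c / Z c - m₀) ^ 2 ≤ Δ ^ 2 * ∑ c ∈ C, Z c := by
    rw [Finset.mul_sum]
    refine Finset.sum_le_sum fun c hc => ?_
    have hz := hZ c hc
    have t := hΔ c hc
    have hsq : (A c / Z c - m₀) ^ 2 ≤ Δ ^ 2 := by
      rw [← sq_abs]; exact pow_le_pow_left₀ (abs_nonneg _) t 2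
    nlinarith [hsq, hz]
  nlinarith [mul_le_mul_of_nonneg_left within hZsum, mul_le_mul_of_nonneg_left between hZsum,
    sq_nonneg ((∑ c ∈ C, A c) - m₀ * ∑ c ∈ C, Z c)]

end Literature.Probability.Distributions.TrinomialLineSection
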